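import Literature.Computability.Complexity.OccurrenceObstructions
import Literature.Computability.AlgebraicComplexity.BIPNoOccurrence
import Literature.Computability.AlgebraicComplexity.OrbitCoordinateRingProofs
import Literature.Computability.AlgebraicComplexity.PaddedPowerSums
import Literature.Computability.AlgebraicComplexity.OrbitClosureWeights
import Literature.Computability.AlgebraicComplexity.PlethysmLifting
import Literature.Computability.AlgebraicComplexity.Hyperdeterminant
import Literature.NumberTheory.DiophantineGeometry.SchurWeylPlethysmRenameProofs
import Mathlib.Analysis.Complex.Polynomial.Basic
import Literature.NumberTheory.DiophantineGeometry.GLHighestWeightFacts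
import Literature.NumberTheory.DiophantineGeometry.TensorWordModel
import HarnessLib

/-!
# No occurrence obstructions (Bürgisser–Ikenmeyer–Panova): the printed statement, its
intermediate results, and the assembly of the proof (family PNP, companion of **pnp.S28**)

This file accompanies `Literature/Computability/Complexity/OccurrenceObstructions.lean`
(fact `Literature.Computability.Complexity.no_occurrence_obstructions`) and
`Literature/Computability/AlgebraicComplexity/BIPNoOccurrence.lean`
(fact `Literature.CplxAlg.bip_no_occurrence_obstruction`). Letters as in the former: `n` = PERMANENT
size, `m` = DETERMINANT size, `d` = degree (BIP write `m`, `n`, `d` respectively); everything over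
`ℂ`; `V = ℂ^{m²}` with the lexicographically ordered matrix variables `MatIdx m`, `Ω = Ω_m =
\overline{GL_{m²} · det_m}`; "the partition `λ ⊢ d·m` occurs in `ℂ[Z]_d`" is rendered, as in the
companion file, by `HasHighestWeight ρ_Z (Weight.dualOfPartition (m*m) λ).toMatIdx`
(`partitionWeightLex m λ` below), and "`λ` occurs in `Sym^d Sym^m V`" by the same weight
occurring in G20's `coordRep (MatIdx m) ℂ m` on `ℂ[Sym^m V^*] = ⊕_d Sym^d Sym^m V`.

**Numbering.** All locators refer to arXiv:1604.06431 **v3** (17 Sep 2018, the final arXiv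
version, "to appear in J. AMS"; the bib key `BurgisserIkenmeyerPanovaJAMS2019` is J. AMS 32 (2019)
163–193): main theorem = Thm. 1.4; Kadish–Landsberg bounds = Thm. 2.1 (general form Thm. 4.9);
semigroup property = Lemma 2.2; even rectangles = Prop. 2.3; small degrees = Prop. 2.4; padded power
sums (Valiant) = Thm. 2.5; nonvanishing on power sums = Prop. 3.2; Schur–Weyl = Prop. 3.3;
generators `v_T` = Def. 4.2 / Prop. 4.5; contraction formula = Thm. 4.7; lifting = §5 (Thm. 5.4,
Thm. 5.5, Prop. 5.6, Prop. 5.8); extremely long first rows = Prop. 6.1; building blocks = Thm. 6.2;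
splitting = Prop. 6.3; the assembly = "Proof of Theorem 1.4" at the end of §6 (v3 p. 22); tableaux =
§7. (arXiv v1/v2 number differently, e.g. v2: Thm. 1.5, Prop. 3.13, Props. 5.1/5.2/5.5. The tree
file `BIPNoOccurrence.lean` calls the J. AMS main theorem "Thm. 1.1"; the J. AMS pagination could
not be checked here, v3 is used throughout.)

## 1. The printed theorem and a discrepancy in two tree facts

BIP v3 Thm. 1.4: *Let `n, d, m` be positive integers with `n ≥ m^25` and `λ ⊢ nd`. If `λ` occurs
in `ℂ[Z_{n,m}]`, then `λ` also occurs in `ℂ[Ω_n]`. In particular, Conjecture 1.3 is false.*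
Here (BIP §1(a), (1.2)) `Z_{n,m}` is the orbit closure of the padded permanent
`X_{11}^{n-m} per_m ∈ Sym^n (ℂ^{m×m})^*`, "where `X_{11}` denotes the linear form providing the
`(1,1)`-entry": **the padding variable is one of the `m²` variables of `per_m`**, so the padded
permanent involves only `m²` variables, and BIP Thm. 2.1 (Kadish–Landsberg; general form
Thm. 4.9(1): `ℓ(λ) ≤ dim W` for a form pulled back from `W`) gives `ℓ(λ) ≤ m²` for every `λ`
occurring in `ℂ[Z_{n,m}]`; the whole case analysis of §6 runs on the parameter `m` through
`ℓ(λ) ≤ m²` and `|λ̄| ≤ m d` only (§2(d): "the permanent can be replaced by any homogeneous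
polynomial `p` of degree `m` in `m²` variables").

Two tree facts render Thm. 1.4 for G20's padded permanent
`paddedPerPoly k n m = X₀₀^(m-n) · per_n(bottom-right block)`, whose padding variable `X₀₀` is
**not** a variable of `per_n` ("`ℓ` a new variable", `n² + 1` variables), with BIP's threshold
`n ^ 25 ≤ m` for all `n ≥ 1`:

* `Literature.Computability.Complexity.no_occurrence_obstructions` (`OccurrenceObstructions.lean`, weight form, over
  `paddedPerOrbitRep ℂ n m`);
* `Literature.CplxAlg.bip_no_occurrence_obstruction` (`BIPNoOccurrence.lean`, module form
  `¬ HasOccurrenceObstruction (detPoly (Fin n) ℂ) (paddedPerPoly ℂ m n) n d` in BIP's letters, whose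
  docstring asserts "the same `GL_{n²}`-orbit closure as BIP's `X₁₁`-padding").

Since `X₀₀ ↦` (a block variable) is a linear substitution, BIP's orbit closure is *contained* in
the tree's, and the containment is proper: already for `per_1`, BIP's `Z` is the Veronese cone
`{ℓ^m}`, where only `λ = (dm)` occurs, while `x^{m-1} y` lies in the tree's `Z` and
`λ = (2m-2, 2)`, of length `2 = n² + 1`, occurs. So *more* weights occur in the tree's `ℂ[Z]`, the
"same orbit closure" claim is false, and neither tree statement is a consequence of the printed
theorem (BIP §1(a) defers the padding convention to Ikenmeyer–Panova, Adv. Math. 319 (2017) =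
arXiv:1512.03798, §7 "Appendix", which shows the two conventions agree only up to a polynomial
change of the determinant size). The only printed statement in the direction of the tree's form is
the *outline* in Landsberg, *Geometry and Complexity Theory* (2017), Thm. 8.10.1.4, which
paraphrases BIP with `ℓ(π) ≤ m² + 1` and the strict threshold `n > m^{25}` (no proof of the extra
case is given there; BIP's printed constants use `ℓ(λ) ≤ m²`, and BIP's Prop. 6.1 needs
`ℓ(λ) · λ₂ ≤ m² s`). This file

* defines BIP's padded permanent `bipPaddedPerPoly` / `bipPaddedPerFormLex` /
  `bipPaddedPerOrbitRep` (padding by `X₀₀`, permanent of the TOP-LEFT `n × n` block, which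
  contains `X₀₀` as soon as `0 < n`) and states Thm. 1.4 for it verbatim in both tree renderings:
  `bip2019_no_occurrence_obstructions` (weight form, corrected `no_occurrence_obstructions`) and
  `bip2019_not_hasOccurrenceObstruction` (module form, corrected `bip_no_occurrence_obstruction`);
* vendors the intermediate results of BIP's proof as named facts (weight form):
  Thm. 2.1 (`bip2019_thm_2_1`), Prop. 2.4 (`bip2019_prop_2_4`), Prop. 6.1 (`bip2019_prop_6_1`),
  Prop. 6.3 (`bip2019_prop_6_3`), and Thm. 4.9(1) for the fresh-variable padding
  (`exists_partition_of_hasHighestWeight_paddedPerOrbitRep`, `ℓ(λ) ≤ n² + 1 = dim W`);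
* PROVES the assembly step — BIP §6, "Proof of Theorem 1.4", an arithmetic case analysis —
  from these facts: the padding-free core `hasHighestWeight_detOrbitRep_of_parts` (parameter
  `M ≥ 1`, `M ^ 25 ≤ m`, `ℓ(λ) ≤ M²`, `|λ̄| ≤ M d`), BIP's theorem
  `bip2019_no_occurrence_obstructions_of_parts` (`M = n`), and, running the same proof with
  `M = n + 1` (`ℓ(λ) ≤ n² + 1 ≤ (n+1)²`, `|λ̄| ≤ n d ≤ (n+1) d`), the fresh-variable statement at
  threshold `(n + 1) ^ 25 ≤ m` (`no_occurrence_obstructions_succ_of_parts`), which still kills the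
  occurrence-obstruction route (`not_occurrenceObstructionRoute_of_succ`, proved);
* states AND PROVES the two leaves of BIP §2(a) on which Props. 2.4, 6.1, 6.3 rest (§3 below):
  the semigroup property Lemma 2.2 (`bip2019_lemma_2_2`, from the general
  `CplxAlg.HasHighestWeight.add_of_orbitCoordRep`: products of highest-weight vectors in the
  domain `k[Δ[f]]`, `CplxAlg.isDomain_orbitCoordRing`) and Valiant's padded power sums Thm. 2.5
  (`bip2019_thm_2_5`, from `CplxAlg.X_pow_mul_sum_pow_mem_orbitClosure_detPoly` of
  `PaddedPowerSums.lean`);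
* vendors the two families of building blocks of BIP §6(b) as named facts — Prop. 2.3
  (`bip2019_prop_2_3`, the row-extended even rectangles `(k × ℓ)♯(km)`, `rowExtendedRectangle`)
  and Thm. 6.2 (`bip2019_thm_6_2`, the shapes `b × 1 + c × i + 1 × j`, `hookPartition`; proved
  in print by explicit tableaux, §7) — PROVES "`(m)` occurs in `ℂ[Ω_m]_1`" (§6(a):
  `CplxAlg.hasHighestWeight_detOrbitRep_single_top`, over any field), and PROVES Prop. 6.3 from
  these: `bip2019_prop_6_3_of_parts (h23) (h62) : bip2019_prop_6_3` (§4 below; the splitting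
  technique (6.1)–(6.2) and the Claim `|μ| ≤ dn` of the printed proof are the abstract
  `mem_of_splitting` over the additive monoid `detOccWeights m` of occurring weights);
* PROVES Thm. 2.1 and Thm. 4.9(1) for both paddings and the Kadish–Landsberg constraint (§5 below:
  `bip2019_thm_2_1_holds`, `exists_partition_of_hasHighestWeight_paddedPerOrbitRep_holds`,
  `kadish_landsberg_padding_holds`) from the general theorems of
  `Literature/Computability/AlgebraicComplexity/OrbitClosureWeights.lean` (highest weights of
  `k[Δ[f]]` are duals of partitions; BIP Thm. 4.9(1),(2) proved on the orbit, without complete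
  reducibility), so that `bip2019_no_occurrence_obstructions_of_parts` and
  `no_occurrence_obstructions_succ_of_parts` now rest on Props. 2.4, 6.1, 2.3, Thm. 6.2 and the
  BLMW lift only (`bip2019_no_occurrence_obstructions_of_parts'`,
  `no_occurrence_obstructions_succ_of_parts'`);
* vendors the plethysm-stability statements Prop. 5.6(2) (inner degree lifting,
  `bip2019_prop_5_6_2`) and Prop. 5.8(2) (outer degree lifting, `bip2019_prop_5_8_2`) as named
  facts over the proved lifting machinery of
  `Literature/Computability/AlgebraicComplexity/PlethysmLifting.lean` (`CplxAlg.innerLift`,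
  Thm. 5.4, Lemmas 5.2, 5.3 proved there) and PROVES Prop. 2.4 and Prop. 6.1 from them (§6 below:
  `bip2019_prop_2_4_of_parts`, `bip2019_prop_6_1_of_parts`, with BIP Prop. 3.2 proved in
  `PowerSumNonvanishing.lean` and Thm. 2.5 proved in `PaddedPowerSums.lean`), so that Thm. 1.4 rests
  on Props. 5.6(2), 5.8(2), 2.3, Thm. 6.2 and the BLMW lift only
  (`bip2019_no_occurrence_obstructions_of_stability`);
* PROVES Prop. 2.3 (`bip2019_prop_2_3_holds`, §7 below) with Cayley's first hyperdeterminant as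
  the highest-weight vector of the even rectangle (`CplxAlg.hyperdetPoly`,
  `Literature/Computability/AlgebraicComplexity/Hyperdeterminant.lean`, replacing the tableau `v_T`
  of Cor. 4.8), lifted by `CplxAlg.innerLift` and evaluated at the padded power sum of the top
  letters (Thm. 2.5), so that Thm. 1.4 rests on Props. 5.6(2), 5.8(2), Thm. 6.2 and the BLMW lift
  only (`bip2019_no_occurrence_obstructions_of_stability'`).

## 2. Architecture of BIP's proof (for the bottom-up discharge of the facts below; v3 labels)

Thm. 2.5 (Valiant): `X^{m-s}(φ_1^s + ⋯ + φ_k^s) ∈ Ω_m` for `m ≥ s k` — the only property of `Ω_m`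
used (formula size `≤ s k`, homogenise, substitute; the substitution step is the tree fact
`CplxAlg.endOrbit_subset_orbitClosure`). Prop. 3.2 (a nonzero `f ∈ Sym^d Sym^n V` does not
vanish on some power sum with `≤ d` terms), Prop. 3.3 (Schur–Weyl: `HWV_λ(⊗^D V)` spanned by the
`S_D`-orbit of `v_λ`). §4: generators `v_T` of `HWV_λ(Sym^d Sym^n V)` indexed by tableaux with
content `d × n` (Def. 4.2, Prop. 4.5), the contraction formula Thm. 4.7, Cor. 4.8, and Thm. 4.9
(⇒ Thm. 2.1). Lemma 2.2 (semigroup property: product of highest-weight vectors, `Ω` irreducible).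
§5: inner and outer degree lifting (Lemma 5.1–5.3, Thm. 5.4, Thm. 5.5, Prop. 5.6, Lemma 5.7,
Prop. 5.8). §6: Prop. 2.4 (small degree) and Prop. 6.1 (extremely long first row) from lifting +
Prop. 3.2 + Thm. 2.5; Prop. 2.3 / Thm. 6.2 (building blocks, the latter proved in §7) and Prop. 6.3
(splitting into blocks + semigroup property); "Proof of Theorem 1.4" (v3 p. 22): w.l.o.g. `M ≥ 2`;
if `m ≥ M d²` use 2.4; else `d > M^{12}`; if `|λ̄| < M^{10}` use 6.1 with `s = M^{10}`; else 6.3.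

## Sources

* P. Bürgisser, C. Ikenmeyer, G. Panova, *No occurrence obstructions in geometric complexity
  theory*, J. Amer. Math. Soc. 32 (2019), 163–193 = arXiv:1604.06431v3: §1(a) with (1.2),
  Thm. 1.4, Thm. 2.1, Lemma 2.2, Prop. 2.3, Prop. 2.4, Thm. 2.5, §2(d), Thm. 4.9, Prop. 6.1,
  Thm. 6.2, Prop. 6.3 and "Proof of Theorem 1.4" (end of §6). Key `BurgisserIkenmeyerPanovaJAMS2019`.
* H. Kadish, J. M. Landsberg, *Padded polynomials, their cousins, and geometric complexity theory*,
  Comm. Algebra 42 (2014), 2171–2180, Thm. 1.2/1.3 (key `KadishLandsberg2014`).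
* J. M. Landsberg, *Geometry and Complexity Theory*, CUP (2017), §8.4: Prop. 8.4.1.1 (cones:
  modules `S_π V^*` with `ℓ(π) > k` lie in `I(Sub_k(S^d V))`), and §8.10.1 (Thm. 8.10.1.4,
  Prop. 8.10.1.5) (key `LandsbergGCT2017`).
* P. Bürgisser, J. M. Landsberg, L. Manivel, J. Weyman, SIAM J. Comput. 40 (2011), §5.2, formula
  (5.2.2) (key `BurgisserEtAl2011`).
* C. Ikenmeyer, G. Panova, Adv. Math. 319 (2017) = arXiv:1512.03798, §7 (Appendix: padding with
  the first variable versus a new variable) (key `IkenmeyerPanova2017`).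

## Design

* All facts are over `ℂ` and in the weight form of the companion file (its design remarks 1–2
  apply verbatim: complete reducibility and "a weight pins the degree" are what make the weight
  form equivalent to the printed module-theoretic form; they are theorem-level, not restated).
* "Every highest weight vector of weight `λ` in `Sym^d Sym^n V`, viewed as a degree `d`
  polynomial function on `Sym^n V^*`, does not vanish on `Ω_n`" (Props. 2.4, 6.1) is rendered
  literally: every nonzero `v` in the highest-weight space of weight `partitionWeightLex m λ` of
  `coordRep (MatIdx m) ℂ m` lies outside the vanishing ideal
  `orbitVanishingIdeal (detFormLex ℂ m) m` of the orbit `GL_{m²} · det_m` (vanishing on the orbit =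
  vanishing on its closure `Ω_m`). The "in particular, `λ` occurs in `ℂ[Ω_m]_d`" is then a proved
  corollary (`hasHighestWeight_orbitCoordRep_of_forall_not_mem`).
* Partition bookkeeping: `ℓ(λ) = λ.parts.card`, `λ₁ = λ.parts.sup` (as in
  `kadish_landsberg_padding`), `λ₂ = secondPart λ`, `|λ̄| = bodySize λ = |λ| - λ₁`
  (`ℕ`-subtraction, harmless: `λ₁ ≤ |λ|`, `sup_parts_le`).
* Side conditions `λ.parts.card ≤ m * m` demanded by the truncating `Weight.dualOfPartition`
  are kept where BIP's hypotheses do not imply them (Prop. 2.4) and dropped where they do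
  (Props. 6.1, 6.3: `M² ≤ m`).
* `bipPaddedPerPoly k n m` has the same documented junk as G20's `paddedPerPoly` for `n > m`
  (the block is all of `Fin m` and the value is `per_m`); all statements assume `n ≤ m`.
* The generic lemmas `mkIntertwiningMap`, `hasHighestWeight_orbitCoordRep_of_forall_not_mem`,
  `hasHighestWeight_orbitCoordRep_zero` (any `σ`, any `f`) would sit naturally next to
  `mkₐ_comp_coordRep` in `SchurWeylPlethysm.lean`; they are kept here to leave the preludes
  untouched (librarian may move them; the former local copy of `inv_apply_diag_of_isUpperTriangular`
  is now the upstream `CplxAlg.inv_apply_diag_of_isUpperTriangular'` of `OrbitClosureWeights.lean`,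
  review of p7897); likewise §4's `partitionOfRows` (a `Nat.Partition` with
  prescribed rows, `Nat.Partition.ofSums` of the row multiset) and the evaluation lemmas of
  `CplxAlg` forms (`eval_linSubst`, `eval_pi_single_of_isHomogeneous`).
* §4 works in the coordinates `Fin (m²) → ℤ` of `Weight.ofPartition (m*m) λ = (λ₁, λ₂, …)`
  (before dualisation and transport, which are additive bijections): BIP's `λ ↦ λ♯D` becomes the
  additive map `sharpAddHom m (m²) : (body, degree) ↦ weight`, a column of length `k` has body
  `colBody (m²) k`, and "the occurring `λ` form a semigroup containing `(m)`" becomes the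
  `AddSubmonoid` `detOccWeights m` containing `sharpAddHom m (m²) (0, 1)`.
-/

noncomputable section

open MvPolynomial

namespace Literature.Computability.Complexity

/-! ### BIP's padded permanent: padding by a variable of the permanent -/

section BIPPadding

variable (k : Type*) [Field k]

/-- The index type `{i : Fin m // i < n}` of the top-left `n × n` block of an `m × m` matrix
(`n` elements for `n ≤ m`, Mathlib `Fintype.card_fin_lt_of_le`; all of `Fin m` for `n > m`).
It contains the index `0` as soon as `0 < n`, so that the padding variable `X₀₀` of
`bipPaddedPerPoly` is a variable of the permanent, as in BIP §1(a), (1.2)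
("`X_{11}^{n-m} per_m`, where `X_{11}` denotes the linear form providing the `(1,1)`-entry").
[cite: BurgisserIkenmeyerPanovaJAMS2019, §1(a) (1.2)] -/
abbrev TopBlockIdx (n m : ℕ) : Type :=
  {i : Fin m // (i : ℕ) < n}

/-- **BIP's padded permanent** `X₀₀ ^ (m - n) · per_n`, where `per_n` is the permanent of the
TOP-LEFT `n × n` block of the generic `m × m` matrix, so that (for `0 < n`) the padding variable
`X₀₀` is one of the `n²` variables of `per_n` and the form involves only `n²` variables:
BIP §1(a), "for `n > m` we consider the padded permanent defined as
`X_{11}^{n-m} per_m ∈ Sym^n (ℂ^{m×m})^*`, where `X_{11}` denotes the linear form providing the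
`(1,1)`-entry", and (1.2) `Z_{n,m} := \overline{GL_{n²} · X_{11}^{n-m} per_m}`. Contrast G20's
`paddedPerPoly k n m` (bottom-right block, `X₀₀` a fresh variable, `n² + 1` variables). Junk for
`n > m` exactly as for `paddedPerPoly` (`m - n = 0` and the block is all of `Fin m`, value
`per_m`); statements assume `n ≤ m`. [cite: BurgisserIkenmeyerPanovaJAMS2019, §1(a) (1.2)] -/
def bipPaddedPerPoly (n m : ℕ) [NeZero m] : MvPolynomial (Fin m × Fin m) k :=
  X (0, 0) ^ (m - n) *
    rename (fun ij : TopBlockIdx n m × TopBlockIdx n m => ((ij.1 : Fin m), (ij.2 : Fin m)))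
      (AlgebraicComplexity.perPoly (TopBlockIdx n m) k)

/-- BIP's padded permanent as a form in the lexicographically ordered matrix variables
`MatIdx m` (transport along `rename toLex`, as `paddedPerFormLex`).
[cite: BurgisserIkenmeyerPanovaJAMS2019, §1(a) (1.2)] -/
def bipPaddedPerFormLex (n m : ℕ) [NeZero m] : MvPolynomial (Literature.NumberTheory.DiophantineGeometry.MatIdx m) k :=
  rename toLex (bipPaddedPerPoly k n m)

/-- The `GL_{m²}`-representation on the coordinate ring `k[Z]` of the orbit closure of BIP's
padded permanent (G20's `orbitCoordRep` in degree `m`), the `ℂ[Z_{n,m}]` of BIP Thm. 1.4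
(letters swapped). [cite: BurgisserIkenmeyerPanovaJAMS2019, §1(a) (1.2)] -/
def bipPaddedPerOrbitRep (n m : ℕ) [NeZero m] :
    Representation k (GL (Literature.NumberTheory.DiophantineGeometry.MatIdx m) k) (AlgebraicComplexity.OrbitCoordRing (bipPaddedPerFormLex k n m) m) :=
  AlgebraicComplexity.orbitCoordRep (bipPaddedPerFormLex k n m) m

variable {k}

/-- For `n ≤ m`, BIP's padded permanent `X₀₀ ^ (m - n) per_n` is homogeneous of degree `m`
(BIP §1(a): it lies in `Sym^n (ℂ^{n×n})^*` in their letters). [cite: BurgisserIkenmeyerPanovaJAMS2019, §1(a) (1.2)] -/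
theorem bipPaddedPerPoly_isHomogeneous {n m : ℕ} [NeZero m] (h : n ≤ m) :
    (bipPaddedPerPoly k n m).IsHomogeneous m := by
  have h1 := isHomogeneous_X_pow (R := k) ((0 : Fin m), (0 : Fin m)) (m - n)
  have h2 := (AlgebraicComplexity.perPoly_isHomogeneous (n := TopBlockIdx n m) (k := k)).rename_isHomogeneous
    (f := fun ij : TopBlockIdx n m × TopBlockIdx n m => ((ij.1 : Fin m), (ij.2 : Fin m)))
  rw [Fintype.card_fin_lt_of_le h] at h2
  have := h1.mul h2
  rwa [Nat.sub_add_cancel h] at this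

/-- For `n ≤ m`, `bipPaddedPerFormLex k n m` is homogeneous of degree `m`.
[cite: BurgisserIkenmeyerPanovaJAMS2019, §1(a) (1.2)] -/
theorem bipPaddedPerFormLex_isHomogeneous {n m : ℕ} [NeZero m] (h : n ≤ m) :
    (bipPaddedPerFormLex k n m).IsHomogeneous m :=
  (bipPaddedPerPoly_isHomogeneous (k := k) h).rename_isHomogeneous

/-- **BIP Thm. 1.4 in the module form of `BIPNoOccurrence.lean`, for BIP's own padded permanent**
(corrected form of `Literature.CplxAlg.bip_no_occurrence_obstruction`, same cite). "Let `n, d, m` be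
positive integers with `n ≥ m^25` and `λ ⊢ nd`. If `λ` occurs in `ℂ[Z_{n,m}]`, then `λ` also occurs
in `ℂ[Ω_n]`", `Z_{n,m} = \overline{GL_{n²} · X_{11}^{n-m} per_m}` with `X_{11}` a variable of `per_m`
((1.2)). In this file's letters (permanent `n`, determinant `m`): for `1 ≤ n`, `1 ≤ d`,
`n ^ 25 ≤ m`, there is no occurrence obstruction (`HasOccurrenceObstruction`, `GCTObstructions.lean`)
against `bipPaddedPerPoly ℂ n m ∈ Δ[det_m]` in degree `d`. **Discrepancy**: the tree's
`bip_no_occurrence_obstruction` states this for `paddedPerPoly ℂ n m` (fresh padding variable,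
`n² + 1` variables), whose orbit closure strictly contains BIP's `Z` (see the module docstring, §1);
that statement is not the printed theorem. [cite: BurgisserIkenmeyerPanovaJAMS2019, Thm. 1.4] -/
def bip2019_not_hasOccurrenceObstruction : Prop :=
  ∀ (n m d : ℕ) [NeZero m], 1 ≤ n → 1 ≤ d → n ^ 25 ≤ m →
    ¬ AlgebraicComplexity.HasOccurrenceObstruction (AlgebraicComplexity.detPoly (Fin m) ℂ) (bipPaddedPerPoly ℂ n m) m d

end BIPPadding

/-! ### Two elementary facts on occurrence in coordinate rings of orbit closures -/

section Occurrence

variable {k σ : Type*} [Field k] [Fintype σ] [LinearOrder σ]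

/-- The quotient map `k[Sym^m] ↠ k[Δ_m[f]]` as an intertwining map `coordRep σ k m ⟶
orbitCoordRep f m` (it is `GL`-equivariant by construction, `mkₐ_comp_coordRep`).
Mulmuley–Sohoni 2001 §5; BIP §1(a) (restriction of regular functions `ℂ[Sym^n V^*] → ℂ[Ω_n]`,
"the `G`-action descends"). [cite: BurgisserIkenmeyerPanovaJAMS2019, §1(a)] -/
def mkIntertwiningMap (f : MvPolynomial σ k) (m : ℕ) :
    (AlgebraicComplexity.coordRep σ k m).IntertwiningMap (AlgebraicComplexity.orbitCoordRep f m) :=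
  ⟨(Ideal.Quotient.mkₐ k (AlgebraicComplexity.orbitVanishingIdeal f m)).toLinearMap, Literature.NumberTheory.DiophantineGeometry.mkₐ_comp_coordRep f m⟩

/-- Unfolding lemma for `mkIntertwiningMap`. [cite: BurgisserIkenmeyerPanovaJAMS2019, §1(a)] -/
@[simp]
theorem mkIntertwiningMap_apply (f : MvPolynomial σ k) (m : ℕ)
    (F : MvPolynomial (AlgebraicComplexity.DegIdx σ m) k) :
    mkIntertwiningMap f m F = Ideal.Quotient.mk (AlgebraicComplexity.orbitVanishingIdeal f m) F :=
  rfl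

/-- **"In particular, `λ` occurs in `ℂ[Ω_n]_d`."** If the weight `χ` occurs in `k[Sym^m V]` and
every nonzero highest-weight vector of weight `χ` in `k[Sym^m V]` lies outside the vanishing ideal
of the orbit `GL · f` (i.e. does not vanish on the orbit closure `Z = Δ_m[f]`), then `χ` occurs in
the coordinate ring `k[Z]`: the class of such a vector is a nonzero highest-weight vector of the
quotient. This is the step from "does not vanish on `Ω_n`" to "in particular, `λ` occurs in
`ℂ[Ω_n]_d`" in BIP Prop. 2.4 (and §3(b), definition of occurrence).
[cite: BurgisserIkenmeyerPanovaJAMS2019, Prop. 2.4 ("In particular")] -/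
theorem hasHighestWeight_orbitCoordRep_of_forall_not_mem (f : MvPolynomial σ k) (m : ℕ)
    {χ : Literature.NumberTheory.DiophantineGeometry.Weight σ} (hχ : Literature.NumberTheory.DiophantineGeometry.HasHighestWeight (AlgebraicComplexity.coordRep σ k m) χ)
    (h : ∀ v ∈ Literature.NumberTheory.DiophantineGeometry.highestWeightSpace (AlgebraicComplexity.coordRep σ k m) χ, v ≠ 0 → v ∉ AlgebraicComplexity.orbitVanishingIdeal f m) :
    Literature.NumberTheory.DiophantineGeometry.HasHighestWeight (AlgebraicComplexity.orbitCoordRep f m) χ := by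
  rw [Literature.NumberTheory.DiophantineGeometry.hasHighestWeight_iff_exists] at hχ ⊢
  obtain ⟨v, hv0, hv⟩ := hχ
  refine ⟨mkIntertwiningMap f m v, ?_,
    Literature.NumberTheory.DiophantineGeometry.highestWeightSpace_le_comap_intertwiningMap (mkIntertwiningMap f m) χ hv⟩
  rw [mkIntertwiningMap_apply, Ne, Ideal.Quotient.eq_zero_iff_mem]
  exact h v hv hv0

/-- The trivial weight `0` occurs in every coordinate ring `k[Δ_m[f]]`: the constant function
`1` is a nonzero `GL`-invariant (the orbit is nonempty, so `1 ∉ I(GL · f)`). This is the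
degree-`0` case (`λ = ∅`, `d = 0`) left implicit in BIP ("`n, d, m` positive").
[cite: BurgisserIkenmeyerPanovaJAMS2019, §3(b)] -/
theorem hasHighestWeight_orbitCoordRep_zero (f : MvPolynomial σ k) (m : ℕ) :
    Literature.NumberTheory.DiophantineGeometry.HasHighestWeight (AlgebraicComplexity.orbitCoordRep f m) 0 := by
  rw [Literature.NumberTheory.DiophantineGeometry.hasHighestWeight_iff_exists]
  refine ⟨1, ?_, ?_⟩
  · rw [Ne, ← map_one (Ideal.Quotient.mk (AlgebraicComplexity.orbitVanishingIdeal f m)),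
      Ideal.Quotient.eq_zero_iff_mem, AlgebraicComplexity.mem_orbitVanishingIdeal_iff, not_forall]
    exact ⟨1, by simp⟩
  · intro g _
    rw [AlgebraicComplexity.orbitCoordRep_apply, map_one]
    simp [Literature.NumberTheory.DiophantineGeometry.weightChar]

end Occurrence

end Literature.Computability.Complexity

namespace Literature.Computability.Complexity

/-! ### Partition bookkeeping: `λ₁`, `λ₂`, `|λ̄|` -/

section Partitions

variable {N : ℕ}

/-- The weight of `GL_{m²} = GL (MatIdx m) ℂ` attached to a partition `λ` (of `d·m`) in the
coordinate-ring convention of the companion file: the dual weight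
`(0,…,0,-λ_ℓ,…,-λ₁)` of `λ` for `GL_{m²}`, transported to the lexicographic matrix variables.
"`λ` occurs in `ℂ[Z]`" (BIP §1(a), §3(b)) is `HasHighestWeight ρ_Z (partitionWeightLex m λ)`.
[cite: BurgisserIkenmeyerPanovaJAMS2019, §3(b)] -/
abbrev partitionWeightLex (m : ℕ) (lam : Nat.Partition N) : Literature.NumberTheory.DiophantineGeometry.Weight (Literature.NumberTheory.DiophantineGeometry.MatIdx m) :=
  (Literature.NumberTheory.DiophantineGeometry.Weight.dualOfPartition (m * m) lam).toMatIdx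

/-- The second part `λ₂` of a partition (second largest part counted with multiplicity; `0` if
`λ` has fewer than two parts): the largest element of the multiset of parts with one copy of
`λ₁ = λ.parts.sup` removed. BIP §5(b)–(c), §6(a) (`λ₂`, `μ₂`, `ν₂`).
[cite: BurgisserIkenmeyerPanovaJAMS2019, Prop. 6.1 (λ₂)] -/
def secondPart (lam : Nat.Partition N) : ℕ :=
  (lam.parts.erase lam.parts.sup).sup

/-- The size `|λ̄| = |λ| - λ₁` of the *body* `λ̄` of a partition `λ ⊢ N` (`λ` with its first row
removed; BIP §2(a): "the body `λ̄` of a partition `λ` ... obtained by deleting the first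
component"). `ℕ`-subtraction is harmless: `λ₁ ≤ |λ|` (`sup_parts_le`).
[cite: BurgisserIkenmeyerPanovaJAMS2019, §2(a)] -/
def bodySize (lam : Nat.Partition N) : ℕ :=
  N - lam.parts.sup

/-- The largest part of a partition of `N` is at most `N`. [folklore] -/
theorem sup_parts_le (lam : Nat.Partition N) : lam.parts.sup ≤ N := by
  rw [Multiset.sup_le]
  intro b hb
  exact (Multiset.le_sum_of_mem hb).trans_eq lam.parts_sum

/-- A nonempty multiset of naturals contains its supremum (Multiset form of Mathlib's
`Finset.sup_mem_of_nonempty`, via `toFinset`). [folklore] -/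
theorem sup_mem_of_ne_zero {s : Multiset ℕ} (hs : s ≠ 0) : s.sup ∈ s := by
  classical
  have hne : s.toFinset.Nonempty := Multiset.toFinset_nonempty.mpr hs
  obtain ⟨a, ha, h⟩ := Finset.exists_mem_eq_sup s.toFinset hne id
  have hsup : s.toFinset.sup id = s.sup := by
    rw [Finset.sup_def, Multiset.map_id]
    exact Multiset.sup_dedup s
  rw [← hsup, h]
  exact Multiset.mem_toFinset.mp ha

/-- `λ₁ + λ₂ ≤ |λ|`. [folklore] -/
theorem secondPart_add_sup_le (lam : Nat.Partition N) :
    secondPart lam + lam.parts.sup ≤ N := by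
  unfold secondPart
  by_cases hs : lam.parts = 0
  · simp [hs]
  · have hmem := sup_mem_of_ne_zero hs
    have hsplit := Multiset.cons_erase hmem
    have hsum : lam.parts.sup + (lam.parts.erase lam.parts.sup).sum = N := by
      rw [← Multiset.sum_cons, hsplit, lam.parts_sum]
    have hle : (lam.parts.erase lam.parts.sup).sup ≤ (lam.parts.erase lam.parts.sup).sum :=
      Multiset.sup_le.mpr fun b hb => Multiset.le_sum_of_mem hb
    omega

/-- `λ₂ ≤ |λ̄|` (BIP, proof of Thm. 1.4: "`λ₂ ≤ |λ̄|`"). [cite: BurgisserIkenmeyerPanovaJAMS2019, §6 (Proof of Theorem 1.4)] -/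
theorem secondPart_le_bodySize (lam : Nat.Partition N) : secondPart lam ≤ bodySize lam := by
  have := secondPart_add_sup_le lam
  unfold bodySize
  omega

/-- A partition with at most one part has empty body: `|λ̄| = 0`. [folklore] -/
theorem bodySize_eq_zero_of_card_le_one (lam : Nat.Partition N) (h : lam.parts.card ≤ 1) :
    bodySize lam = 0 := by
  unfold bodySize
  rcases Nat.le_one_iff_eq_zero_or_eq_one.mp h with h0 | h1
  · have hp : lam.parts = 0 := Multiset.card_eq_zero.mp h0
    have hN : N = 0 := by simpa [hp] using lam.parts_sum.symm
    simp [hN]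
  · obtain ⟨a, ha⟩ := Multiset.card_eq_one.mp h1
    have hN : N = a := by simpa [ha] using lam.parts_sum.symm
    simp [ha, hN]

/-- A partition of `0` has no parts. [folklore] -/
theorem parts_eq_zero_of_eq_zero (lam : Nat.Partition N) (hN : N = 0) : lam.parts = 0 := by
  subst hN
  rw [Multiset.eq_zero_iff_forall_notMem]
  intro a ha
  have hpos := lam.parts_pos ha
  have hle : a ≤ 0 := (Multiset.le_sum_of_mem ha).trans_eq lam.parts_sum
  omega

/-- The weight of the empty partition (`d = 0`) is the trivial weight `0`. [folklore] -/
theorem partitionWeightLex_eq_zero (m : ℕ) (lam : Nat.Partition N) (hN : N = 0) :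
    partitionWeightLex m lam = 0 := by
  have hp := parts_eq_zero_of_eq_zero lam hN
  funext ij
  simp [partitionWeightLex, Literature.NumberTheory.DiophantineGeometry.Weight.toMatIdx, Literature.NumberTheory.DiophantineGeometry.Weight.dualOfPartition,
    Literature.NumberTheory.DiophantineGeometry.Weight.dual, Literature.NumberTheory.DiophantineGeometry.Weight.ofPartition, Nat.Partition.sortedParts, hp]

end Partitions

/-! ### The printed theorem (corrected form of `no_occurrence_obstructions`) -/

/-- **BIP Thm. 1.4, verbatim for BIP's own padded permanent** (corrected form of
`Literature.Computability.Complexity.no_occurrence_obstructions`, same cite; the module-form twin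
`Literature.CplxAlg.bip_no_occurrence_obstruction` of `BIPNoOccurrence.lean` is corrected likewise by
`CplxAlg.bip2019_not_hasOccurrenceObstruction` above). arXiv v3 Thm. 1.4: "Let `n, d, m` be
positive integers with `n ≥ m^25` and `λ ⊢ nd`. If `λ` occurs in `ℂ[Z_{n,m}]`, then `λ` also occurs
in `ℂ[Ω_n]`. In particular, Conjecture 1.3 is false", where
`Z_{n,m} = \overline{GL_{n²} · X_{11}^{n-m} per_m}` with `X_{11}` a variable of `per_m` ((1.2)).
In this file's letters (permanent `n`, determinant `m`): for `0 < n`, `n ^ 25 ≤ m`, every weight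
occurring in `ℂ[\overline{GL_{m²} · X₀₀^{m-n} per_n(top-left block)}]` (`bipPaddedPerOrbitRep`)
occurs in `ℂ[Ω_m]` (`detOrbitRep`). Weight form and Borel conventions exactly as in
`no_occurrence_obstructions` (design remarks 1–3 of the companion file).

**Discrepancy.** `no_occurrence_obstructions` (and `CplxAlg.bip_no_occurrence_obstruction`) assert
the same for G20's padded permanent `X₀₀^{m-n} per_n(bottom-right block)` whose padding variable
is NOT a variable of `per_n`; BIP's orbit closure is strictly contained in that one, so the tree's
statements are stronger than, and not implied by, the printed theorem (its Thm. 2.1 bound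
`ℓ(λ) ≤ n²` becomes `ℓ(λ) ≤ n² + 1`, Thm. 4.9(1)). BIP's proof run with `M = n + 1` yields the
fresh-variable statement at threshold `(n + 1) ^ 25 ≤ m` (`no_occurrence_obstructions_succ`,
assembled below). [cite: BurgisserIkenmeyerPanovaJAMS2019, Thm. 1.4] -/
def bip2019_no_occurrence_obstructions : Prop :=
  ∀ (n m : ℕ) [NeZero m] (_hn : 0 < n) (_hnm : n ^ 25 ≤ m)
    (χ : Literature.NumberTheory.DiophantineGeometry.Weight (Literature.NumberTheory.DiophantineGeometry.MatIdx m))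
    (_h : Literature.NumberTheory.DiophantineGeometry.HasHighestWeight (Complexity.bipPaddedPerOrbitRep ℂ n m) χ),
    Literature.NumberTheory.DiophantineGeometry.HasHighestWeight (Literature.NumberTheory.DiophantineGeometry.detOrbitRep ℂ m) χ

/-- The fresh-variable form of BIP's theorem at the threshold its proof delivers: for G20's
padded permanent `X₀₀^{m-n} per_n` (`X₀₀` not a variable of `per_n`, `n² + 1 ≤ (n+1)²`
variables) and `(n + 1) ^ 25 ≤ m`, every weight occurring in `ℂ[Z]` (`paddedPerOrbitRep`) occurs
in `ℂ[Ω_m]`. Not a printed statement: it is BIP's "Proof of Theorem 1.4" (end of §6) with their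
parameter `m := n + 1`, and is PROVED below from the vendored Thm. 4.9(1)/2.1, Props. 2.4, 6.1,
6.3 (`no_occurrence_obstructions_succ_of_parts`). No positivity of `n` is needed.
[cite: BurgisserIkenmeyerPanovaJAMS2019, §6 (Proof of Theorem 1.4), with M = n + 1] -/
def no_occurrence_obstructions_succ : Prop :=
  ∀ (n m : ℕ) [NeZero m] (_hnm : (n + 1) ^ 25 ≤ m) (χ : Literature.NumberTheory.DiophantineGeometry.Weight (Literature.NumberTheory.DiophantineGeometry.MatIdx m))
    (_h : Literature.NumberTheory.DiophantineGeometry.HasHighestWeight (Literature.NumberTheory.DiophantineGeometry.paddedPerOrbitRep ℂ n m) χ),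
    Literature.NumberTheory.DiophantineGeometry.HasHighestWeight (Literature.NumberTheory.DiophantineGeometry.detOrbitRep ℂ m) χ

/-! ### BIP's intermediate results, as named facts (weight form) -/

/-- **BIP Thm. 2.1 (Kadish–Landsberg), with the partition form of occurring weights.** BIP:
"If `λ ⊢ nd` occurs in `ℂ[Z_{n,m}]_d`, then `ℓ(λ) ≤ m²` and `|λ̄| ≤ m d`" for the padded permanent
`X_{11}^{n-m} per_m` in `m²` variables (`n > m`; proved as Thm. 4.9). In this file's letters and
weight form: for `0 < n ≤ m`, every weight `χ` occurring in `ℂ[Z]`, `Z` the orbit closure of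
`bipPaddedPerFormLex ℂ n m`, is `partitionWeightLex m λ` for a partition `λ ⊢ d·m` (BLMW 2011
(5.2.2): occurring weights of quotients of `ℂ[Sym^m V^*]` are duals of partitions of `d·m` with at
most `m²` parts — here `n² ≤ m²`) with `ℓ(λ) ≤ n²` and `|λ̄| ≤ n d`. The case `n = m`
(no padding, `per_m` in `m²` variables) is the trivial case of both bounds.
[cite: BurgisserIkenmeyerPanovaJAMS2019, Thm. 2.1] -/
def bip2019_thm_2_1 : Prop :=
  ∀ (n m : ℕ) [NeZero m] (_hn : 0 < n) (_hnm : n ≤ m) (χ : Literature.NumberTheory.DiophantineGeometry.Weight (Literature.NumberTheory.DiophantineGeometry.MatIdx m))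
    (_h : Literature.NumberTheory.DiophantineGeometry.HasHighestWeight (Complexity.bipPaddedPerOrbitRep ℂ n m) χ),
    ∃ (d : ℕ) (lam : Nat.Partition (d * m)),
      lam.parts.card ≤ n ^ 2 ∧ bodySize lam ≤ n * d ∧ χ = partitionWeightLex m lam

/-- **BIP Thm. 4.9(1) for the fresh-variable padding (length bound `n² + 1`), with the partition
form.** BIP Thm. 4.9(1): "Assume `π : V → W` is a projection, `p ∈ Sym^n W^*`, and let `Z` denote
the `GL(V)`-orbit closure of `π^*(p) ∈ Sym^n V^*`. If `λ ⊢ nd` occurs in `ℂ[Z]_d`, then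
`ℓ(λ) ≤ dim W`." G20's padded permanent `X₀₀^{m-n} per_n` (`n ≤ m`) is pulled back from the span
`W` of its `n² + 1` variables, so every weight occurring in `ℂ[Z]` (`paddedPerOrbitRep ℂ n m`) is
`partitionWeightLex m λ` for a partition `λ ⊢ d·m` with at most `m²` parts (BLMW 2011 (5.2.2))
and `ℓ(λ) ≤ n² + 1` (equivalently Landsberg 2017, Prop. 8.4.1.1: modules `S_π V^*` with
`ℓ(π) > k` lie in the ideal of the subspace variety `Sub_k`). The first-row bound
`λ₁ ≥ d (m - n)` for this padding (Thm. 4.9(2)) is the companion file's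
`kadish_landsberg_padding`. [cite: BurgisserIkenmeyerPanovaJAMS2019, Thm. 4.9(1)] -/
def exists_partition_of_hasHighestWeight_paddedPerOrbitRep : Prop :=
  ∀ (n m : ℕ) [NeZero m] (_hnm : n ≤ m) (χ : Literature.NumberTheory.DiophantineGeometry.Weight (Literature.NumberTheory.DiophantineGeometry.MatIdx m))
    (_h : Literature.NumberTheory.DiophantineGeometry.HasHighestWeight (Literature.NumberTheory.DiophantineGeometry.paddedPerOrbitRep ℂ n m) χ),
    ∃ (d : ℕ) (lam : Nat.Partition (d * m)),
      lam.parts.card ≤ n ^ 2 + 1 ∧ lam.parts.card ≤ m * m ∧ χ = partitionWeightLex m lam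

/-- **BIP Prop. 2.4 (small degrees).** "Let `λ ⊢ nd` be such that there exists a positive
integer `m` satisfying `|λ̄| ≤ m d` and `m d² ≤ n`. Then every highest weight vector of weight `λ`
in `Sym^d Sym^n V`, viewed as a degree `d` polynomial function on `Sym^n V^*`, does not vanish on
`Ω_n`. In particular, if `λ` occurs in `Sym^d Sym^n V`, then `λ` occurs in `ℂ[Ω_n]_d`." In this
file's letters (determinant `m`, auxiliary parameter `M`, `V = ℂ^{m²}`, `d ≥ 1` as in BIP's proof):
every nonzero vector of the highest-weight space of weight `partitionWeightLex m λ` in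
`coordRep (MatIdx m) ℂ m` lies outside the vanishing ideal of `GL_{m²} · det_m`.
Hypothesis `λ.parts.card ≤ m * m` (`ℓ(λ) ≤ dim V`, automatic in print) is required by the
truncating `Weight.dualOfPartition`. [cite: BurgisserIkenmeyerPanovaJAMS2019, Prop. 2.4] -/
def bip2019_prop_2_4 : Prop :=
  ∀ (m d M : ℕ) [NeZero m] (_hd : 0 < d) (_hM : 0 < M) (lam : Nat.Partition (d * m))
    (_hlam : lam.parts.card ≤ m * m) (_hbody : bodySize lam ≤ M * d) (_hMd : M * d ^ 2 ≤ m)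
    (v : MvPolynomial (AlgebraicComplexity.DegIdx (Literature.NumberTheory.DiophantineGeometry.MatIdx m) m) ℂ)
    (_hv : v ∈ Literature.NumberTheory.DiophantineGeometry.highestWeightSpace (AlgebraicComplexity.coordRep (Literature.NumberTheory.DiophantineGeometry.MatIdx m) ℂ m)
      (partitionWeightLex m lam))
    (_hv0 : v ≠ 0),
    v ∉ AlgebraicComplexity.orbitVanishingIdeal (Literature.NumberTheory.DiophantineGeometry.detFormLex ℂ m) m

/-- **BIP Prop. 6.1 (extremely long first rows).** "Let `λ ⊢ nd` and assume there exist positive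
integers `s, m` such that `ℓ(λ) ≤ m²`, `λ₂ ≤ s`, `m² s² ≤ n`, and `m² s ≤ d`. Then every highest
weight vector `h ∈ Sym^d Sym^n V` of weight `λ`, viewed as a degree `d` polynomial function on
`Sym^n V^*`, does not vanish on `Ω_n`." Letters: determinant `m`, parameters `s`, `M`; rendering
as in `bip2019_prop_2_4` (`ℓ(λ) ≤ M² ≤ m ≤ m²` makes the truncation side condition automatic).
[cite: BurgisserIkenmeyerPanovaJAMS2019, Prop. 6.1] -/
def bip2019_prop_6_1 : Prop :=
  ∀ (m d s M : ℕ) [NeZero m] (_hs : 0 < s) (_hM : 0 < M) (lam : Nat.Partition (d * m))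
    (_hℓ : lam.parts.card ≤ M ^ 2) (_h₂ : secondPart lam ≤ s) (_hsm : M ^ 2 * s ^ 2 ≤ m)
    (_hsd : M ^ 2 * s ≤ d)
    (v : MvPolynomial (AlgebraicComplexity.DegIdx (Literature.NumberTheory.DiophantineGeometry.MatIdx m) m) ℂ)
    (_hv : v ∈ Literature.NumberTheory.DiophantineGeometry.highestWeightSpace (AlgebraicComplexity.coordRep (Literature.NumberTheory.DiophantineGeometry.MatIdx m) ℂ m)
      (partitionWeightLex m lam))
    (_hv0 : v ≠ 0),
    v ∉ AlgebraicComplexity.orbitVanishingIdeal (Literature.NumberTheory.DiophantineGeometry.detFormLex ℂ m) m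

/-- **BIP Prop. 6.3 (splitting into building blocks; uses the semigroup property Lemma 2.2,
Prop. 2.3 and Thm. 6.2).** "Given a partition `λ` with `|λ| = nd` such that there exists `m ≥ 2`
with `ℓ(λ) ≤ m²`, `m^{10} ≤ |λ̄| ≤ m d`, `n ≥ 24 m^6`, and `d > 4 m^6`. Then `λ` occurs in
`ℂ[Ω_n]_d`." Letters: determinant `m`, parameter `M`; conclusion in weight form
(`ℓ(λ) ≤ M² ≤ 24 M^6 ≤ m` makes the truncation side condition automatic).
[cite: BurgisserIkenmeyerPanovaJAMS2019, Prop. 6.3] -/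
def bip2019_prop_6_3 : Prop :=
  ∀ (m d M : ℕ) [NeZero m] (_hM : 2 ≤ M) (lam : Nat.Partition (d * m))
    (_hℓ : lam.parts.card ≤ M ^ 2) (_hb₁ : M ^ 10 ≤ bodySize lam) (_hb₂ : bodySize lam ≤ M * d)
    (_hm : 24 * M ^ 6 ≤ m) (_hd : 4 * M ^ 6 < d),
    Literature.NumberTheory.DiophantineGeometry.HasHighestWeight (Literature.NumberTheory.DiophantineGeometry.detOrbitRep ℂ m) (partitionWeightLex m lam)

/-! ### Proved corollaries: "in particular, `λ` occurs in `ℂ[Ω_m]_d`" -/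

/-- The occurrence form of BIP Prop. 2.4 ("In particular, if `λ` occurs in `Sym^d Sym^n V`, then
`λ` occurs in `ℂ[Ω_n]_d`"), derived from the fact. [cite: BurgisserIkenmeyerPanovaJAMS2019, Prop. 2.4] -/
theorem hasHighestWeight_detOrbitRep_of_prop_2_4 (h24 : bip2019_prop_2_4) {m d M : ℕ} [NeZero m]
    (hd : 0 < d) (hM : 0 < M) (lam : Nat.Partition (d * m)) (hlam : lam.parts.card ≤ m * m)
    (hbody : bodySize lam ≤ M * d) (hMd : M * d ^ 2 ≤ m)
    (hocc : Literature.NumberTheory.DiophantineGeometry.HasHighestWeight (AlgebraicComplexity.coordRep (Literature.NumberTheory.DiophantineGeometry.MatIdx m) ℂ m)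
      (partitionWeightLex m lam)) :
    Literature.NumberTheory.DiophantineGeometry.HasHighestWeight (Literature.NumberTheory.DiophantineGeometry.detOrbitRep ℂ m) (partitionWeightLex m lam) :=
  Complexity.hasHighestWeight_orbitCoordRep_of_forall_not_mem _ m hocc
    fun v hv hv0 => h24 m d M hd hM lam hlam hbody hMd v hv hv0

/-- The occurrence form of BIP Prop. 6.1, derived from the fact. [cite: BurgisserIkenmeyerPanovaJAMS2019, Prop. 6.1] -/
theorem hasHighestWeight_detOrbitRep_of_prop_6_1 (h61 : bip2019_prop_6_1) {m d s M : ℕ}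
    [NeZero m] (hs : 0 < s) (hM : 0 < M) (lam : Nat.Partition (d * m))
    (hℓ : lam.parts.card ≤ M ^ 2) (h₂ : secondPart lam ≤ s) (hsm : M ^ 2 * s ^ 2 ≤ m)
    (hsd : M ^ 2 * s ≤ d)
    (hocc : Literature.NumberTheory.DiophantineGeometry.HasHighestWeight (AlgebraicComplexity.coordRep (Literature.NumberTheory.DiophantineGeometry.MatIdx m) ℂ m)
      (partitionWeightLex m lam)) :
    Literature.NumberTheory.DiophantineGeometry.HasHighestWeight (Literature.NumberTheory.DiophantineGeometry.detOrbitRep ℂ m) (partitionWeightLex m lam) :=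
  Complexity.hasHighestWeight_orbitCoordRep_of_forall_not_mem _ m hocc
    fun v hv hv0 => h61 m d s M hs hM lam hℓ h₂ hsm hsd v hv hv0

/-! ### The assembly: BIP §6, "Proof of Theorem 1.4" -/

/-- **The padding-free core of BIP's "Proof of Theorem 1.4"** (end of §6, v3 p. 22), proved from
Props. 2.4, 6.1, 6.3: let `M ≥ 1`, `M ^ 25 ≤ m`, and let `λ ⊢ d·m` satisfy `ℓ(λ) ≤ M²` and
`|λ̄| ≤ M d` (the output of Thm. 2.1) and occur in `Sym^d Sym^m V`; then `λ` occurs in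
`ℂ[Ω_m]_d`. Cases: `d = 0` (trivial weight, `hasHighestWeight_orbitCoordRep_zero`); `M d² ≤ m`
(2.4); else `d > M^{12}`, and `|λ̄| < M^{10}` (6.1 with `s = M^{10}`, `λ₂ ≤ |λ̄|`) or
`|λ̄| ≥ M^{10}` (6.3; here `M ≥ 2` since `ℓ(λ) ≤ 1` forces `|λ̄| = 0`).
[cite: BurgisserIkenmeyerPanovaJAMS2019, §6 (Proof of Theorem 1.4)] -/
theorem hasHighestWeight_detOrbitRep_of_parts (h24 : bip2019_prop_2_4) (h61 : bip2019_prop_6_1)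
    (h63 : bip2019_prop_6_3) {m d M : ℕ} [NeZero m] (hM : 0 < M) (hMm : M ^ 25 ≤ m)
    (lam : Nat.Partition (d * m)) (hℓ : lam.parts.card ≤ M ^ 2) (hbody : bodySize lam ≤ M * d)
    (hocc : Literature.NumberTheory.DiophantineGeometry.HasHighestWeight (AlgebraicComplexity.coordRep (Literature.NumberTheory.DiophantineGeometry.MatIdx m) ℂ m)
      (partitionWeightLex m lam)) :
    Literature.NumberTheory.DiophantineGeometry.HasHighestWeight (Literature.NumberTheory.DiophantineGeometry.detOrbitRep ℂ m) (partitionWeightLex m lam) := by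
  have hM1 : 1 ≤ M := hM
  have hM2m : M ^ 2 ≤ m :=
    (Nat.pow_le_pow_right hM (by norm_num : 2 ≤ 25)).trans hMm
  have hlam : lam.parts.card ≤ m * m := hℓ.trans (hM2m.trans (Nat.le_mul_self m))
  -- degree 0: the trivial weight
  rcases Nat.eq_zero_or_pos d with rfl | hd
  · rw [partitionWeightLex_eq_zero m lam (Nat.zero_mul m)]
    exact Complexity.hasHighestWeight_orbitCoordRep_zero _ m
  -- small degree: Prop. 2.4
  by_cases hA : M * d ^ 2 ≤ m
  · exact hasHighestWeight_detOrbitRep_of_prop_2_4 h24 hd hM lam hlam hbody hA hocc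
  -- large degree: `M ^ 12 < d`
  have hd12 : M ^ 12 < d := by
    have h1 : M * M ^ 24 < M * d ^ 2 := by
      calc M * M ^ 24 = M ^ 25 := by ring
        _ ≤ m := hMm
        _ < M * d ^ 2 := Nat.lt_of_not_le hA
    have h2 : (M ^ 12) ^ 2 < d ^ 2 := by
      have := Nat.lt_of_mul_lt_mul_left h1
      calc (M ^ 12) ^ 2 = M ^ 24 := by ring
        _ < d ^ 2 := this
    exact lt_of_pow_lt_pow_left₀ 2 (Nat.zero_le d) h2
  by_cases hB : bodySize lam < M ^ 10
  · -- extremely long first row: Prop. 6.1 with `s = M ^ 10`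
    have hs : 0 < M ^ 10 := pow_pos hM 10
    have h₂ : secondPart lam ≤ M ^ 10 := (secondPart_le_bodySize lam).trans hB.le
    have hsm : M ^ 2 * (M ^ 10) ^ 2 ≤ m := by
      calc M ^ 2 * (M ^ 10) ^ 2 = M ^ 22 := by ring
        _ ≤ M ^ 25 := Nat.pow_le_pow_right hM (by norm_num)
        _ ≤ m := hMm
    have hsd : M ^ 2 * M ^ 10 ≤ d := by
      calc M ^ 2 * M ^ 10 = M ^ 12 := by ring
        _ ≤ d := hd12.le
    exact hasHighestWeight_detOrbitRep_of_prop_6_1 h61 hs hM lam hℓ h₂ hsm hsd hocc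
  · -- large body: Prop. 6.3
    have hB' : M ^ 10 ≤ bodySize lam := Nat.le_of_not_lt hB
    have hM2 : 2 ≤ M := by
      by_contra hlt
      have hM1' : M = 1 := by omega
      subst hM1'
      have hcard : lam.parts.card ≤ 1 := by simpa using hℓ
      have h0 := bodySize_eq_zero_of_card_le_one lam hcard
      rw [h0] at hB'
      simp at hB'
    have h5 : 2 ^ 5 ≤ M ^ 5 := Nat.pow_le_pow_left hM2 5
    have h2' : 2 ^ 2 ≤ M ^ 2 := Nat.pow_le_pow_left hM2 2
    have hm24 : 24 * M ^ 6 ≤ m := by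
      calc 24 * M ^ 6 ≤ M ^ 5 * M ^ 6 := Nat.mul_le_mul_right _ (le_trans (by norm_num) h5)
        _ = M ^ 11 := by ring
        _ ≤ M ^ 25 := Nat.pow_le_pow_right hM (by norm_num)
        _ ≤ m := hMm
    have hd4 : 4 * M ^ 6 < d := by
      calc 4 * M ^ 6 ≤ M ^ 2 * M ^ 6 := Nat.mul_le_mul_right _ (le_trans (by norm_num) h2')
        _ = M ^ 8 := by ring
        _ ≤ M ^ 12 := Nat.pow_le_pow_right hM (by norm_num)
        _ < d := hd12
    exact h63 m d M hM2 lam hℓ hB' hbody hm24 hd4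

/-- **BIP Thm. 1.4 assembled from its parts**: Thm. 2.1, Props. 2.4/6.1/6.3 (through the
core `hasHighestWeight_detOrbitRep_of_parts` with `M = n`), and the BLMW lift of occurrence from
`ℂ[Z]` to `ℂ[Sym^m V^*]` (`CplxAlg.hasHighestWeight_coordRep_of_orbitCoordRep`, a named fact of the
tree; BIP §1(a): `ℂ[Sym^n V^*] ↠ ℂ[Z]` and complete reducibility). Once these facts are
discharged this is `bip2019_no_occurrence_obstructions_holds`.
[cite: BurgisserIkenmeyerPanovaJAMS2019, Thm. 1.4 and §6 (Proof of Theorem 1.4)] -/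
theorem bip2019_no_occurrence_obstructions_of_parts (h21 : bip2019_thm_2_1)
    (h24 : bip2019_prop_2_4) (h61 : bip2019_prop_6_1) (h63 : bip2019_prop_6_3)
    (hlift : ∀ m : ℕ,
      Literature.NumberTheory.DiophantineGeometry.hasHighestWeight_coordRep_of_orbitCoordRep (k := ℂ) (σ := Literature.NumberTheory.DiophantineGeometry.MatIdx m)) :
    bip2019_no_occurrence_obstructions := by
  intro n m _ hn hnm χ h
  have hnm' : n ≤ m := (Nat.le_self_pow (by norm_num) n).trans hnm
  obtain ⟨d, lam, hℓ, hbody, rfl⟩ := h21 n m hn hnm' χ h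
  have hocc : Literature.NumberTheory.DiophantineGeometry.HasHighestWeight (AlgebraicComplexity.coordRep (Literature.NumberTheory.DiophantineGeometry.MatIdx m) ℂ m)
      (partitionWeightLex m lam) :=
    hlift m (Complexity.bipPaddedPerFormLex ℂ n m) (NeZero.ne m)
      (Complexity.bipPaddedPerFormLex_isHomogeneous (k := ℂ) hnm') h
  exact hasHighestWeight_detOrbitRep_of_parts h24 h61 h63 hn hnm lam hℓ hbody hocc

/-- **The fresh-variable statement at threshold `(n+1)^25`, assembled from BIP's parts** with
`M = n + 1`: the partition form with `ℓ(λ) ≤ n² + 1 ≤ (n+1)²`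
(`exists_partition_of_hasHighestWeight_paddedPerOrbitRep`, Thm. 4.9(1)), the Kadish–Landsberg
first-row bound `λ₁ ≥ d(m-n)` i.e. `|λ̄| ≤ n d ≤ (n+1) d` (`kadish_landsberg_padding`, companion
file; Thm. 4.9(2)), the BLMW lift, and the core.
[cite: BurgisserIkenmeyerPanovaJAMS2019, §6 (Proof of Theorem 1.4), with M = n + 1] -/
theorem no_occurrence_obstructions_succ_of_parts
    (hpart : exists_partition_of_hasHighestWeight_paddedPerOrbitRep)
    (hKL : kadish_landsberg_padding)
    (h24 : bip2019_prop_2_4) (h61 : bip2019_prop_6_1) (h63 : bip2019_prop_6_3)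
    (hlift : ∀ m : ℕ,
      Literature.NumberTheory.DiophantineGeometry.hasHighestWeight_coordRep_of_orbitCoordRep (k := ℂ) (σ := Literature.NumberTheory.DiophantineGeometry.MatIdx m)) :
    no_occurrence_obstructions_succ := by
  intro n m _ hnm χ h
  have hnm' : n ≤ m :=
    (Nat.le_succ n).trans ((Nat.le_self_pow (by norm_num) (n + 1)).trans hnm)
  obtain ⟨d, lam, hℓ, hlam, rfl⟩ := hpart n m hnm' χ h
  have hsup : d * (m - n) ≤ lam.parts.sup := hKL n m d hnm' lam hlam h
  have hbody : bodySize lam ≤ (n + 1) * d := by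
    unfold bodySize
    have hsplit : d * (m - n) + d * n = d * m := by
      rw [← Nat.mul_add, Nat.sub_add_cancel hnm']
    have hdn : d * n ≤ (n + 1) * d := by nlinarith
    omega
  have hℓ' : lam.parts.card ≤ (n + 1) ^ 2 := hℓ.trans (by nlinarith)
  have hocc : Literature.NumberTheory.DiophantineGeometry.HasHighestWeight (AlgebraicComplexity.coordRep (Literature.NumberTheory.DiophantineGeometry.MatIdx m) ℂ m)
      (partitionWeightLex m lam) :=
    hlift m (Literature.NumberTheory.DiophantineGeometry.paddedPerFormLex ℂ n m) (NeZero.ne m)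
      (Literature.NumberTheory.DiophantineGeometry.paddedPerFormLex_isHomogeneous ℂ hnm') h
  exact hasHighestWeight_detOrbitRep_of_parts h24 h61 h63 (Nat.succ_pos n) hnm lam hℓ' hbody hocc

/-- **The fresh-variable statement at threshold `(n+1)^25` still kills the occurrence route.**
`no_occurrence_obstructions_succ` refutes `OccurrenceObstructionRoute` (companion file): with
`c = 50`, `n = max n₀ 2` and `m = (2n)^25` one has `n ≤ m ≤ n^50` and `(n+1)^25 ≤ m`, so no
occurrence obstruction exists at `(n, m)`. This re-derives the companion's
`not_occurrenceObstructionRoute` from the corrected threshold (BIP Thm. 1.4: "In particular,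
Conjecture 1.3 is false"). [cite: BurgisserIkenmeyerPanovaJAMS2019, Thm. 1.4] -/
theorem not_occurrenceObstructionRoute_of_succ (h : no_occurrence_obstructions_succ) :
    not_occurrenceObstructionRoute := by
  intro hroute
  obtain ⟨n₀, hn₀⟩ := hroute 50
  set n := max n₀ 2
  have hn2 : 2 ≤ n := le_max_right _ _
  have hpos : 0 < (2 * n) ^ 25 := pow_pos (by omega) 25
  haveI : NeZero ((2 * n) ^ 25) := NeZero.of_pos hpos
  have h1 : n ≤ (2 * n) ^ 25 :=
    (Nat.le_self_pow (by norm_num) n).trans (Nat.pow_le_pow_left (by omega) 25)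
  have h2 : (2 * n) ^ 25 ≤ n ^ 50 := by
    have h25 : 2 ^ 25 ≤ n ^ 25 := Nat.pow_le_pow_left hn2 25
    calc (2 * n) ^ 25 = 2 ^ 25 * n ^ 25 := by ring
      _ ≤ n ^ 25 * n ^ 25 := Nat.mul_le_mul_right _ h25
      _ = n ^ 50 := by ring
  have h3 : (n + 1) ^ 25 ≤ (2 * n) ^ 25 := Nat.pow_le_pow_left (by omega) 25
  obtain ⟨χ, hχ⟩ := hn₀ n (le_max_left _ _) ((2 * n) ^ 25) h1 h2
  exact hχ.2 (h n ((2 * n) ^ 25) h3 χ hχ.1)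

end Literature.Computability.Complexity

/-! ## 3. Leaves of BIP §2(a), stated and proved: the semigroup property (Lemma 2.2) and padded
power sums in `Ω_m` (Thm. 2.5) -/

namespace Literature.Computability.Complexity

section Semigroup

variable {k σ : Type*} [Field k] [Fintype σ] [LinearOrder σ]

/-- **Products of highest-weight vectors** in the coordinate ring `k[Δ[f]]` of an orbit closure
(on which `GL` acts by algebra automorphisms): a highest-weight vector of weight `χ` times one of
weight `μ` is a highest-weight vector of weight `χ + μ` (possibly zero). BIP, proof of Lemma 2.2
("it is immediate that the product ... is a highest weight vector of weight `λ + μ`"); the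
additivity of weight characters is `CplxAlg.weightChar_add` of `TensorWordModel.lean`.
[cite: BurgisserIkenmeyerPanovaJAMS2019, Lemma 2.2] -/
theorem mul_mem_highestWeightSpace_orbitCoordRep (f : MvPolynomial σ k) (m : ℕ) {χ μ : Literature.NumberTheory.DiophantineGeometry.Weight σ}
    {x y : AlgebraicComplexity.OrbitCoordRing f m} (hx : x ∈ Literature.NumberTheory.DiophantineGeometry.highestWeightSpace (AlgebraicComplexity.orbitCoordRep f m) χ)
    (hy : y ∈ Literature.NumberTheory.DiophantineGeometry.highestWeightSpace (AlgebraicComplexity.orbitCoordRep f m) μ) :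
    x * y ∈ Literature.NumberTheory.DiophantineGeometry.highestWeightSpace (AlgebraicComplexity.orbitCoordRep f m) (χ + μ) := by
  intro g hg
  rw [AlgebraicComplexity.orbitCoordRep_apply, map_mul, ← AlgebraicComplexity.orbitCoordRep_apply, ← AlgebraicComplexity.orbitCoordRep_apply, hx g hg,
    hy g hg, Literature.NumberTheory.DiophantineGeometry.weightChar_add χ μ hg, smul_mul_smul_comm]

/-- **The semigroup property of occurring weights (BIP Lemma 2.2), for any orbit closure over an
infinite field.** If the weights `χ` and `μ` occur in `k[Δ[f]]` (nonzero highest-weight vectors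
`x`, `y`), then so does `χ + μ`: `x y` is a highest-weight vector of weight `χ + μ`
(`mul_mem_highestWeightSpace_orbitCoordRep`) and is nonzero because `k[Δ[f]]` is an integral
domain (`isDomain_orbitCoordRing`: the orbit closure of the irreducible group `GL` is
irreducible). BIP Lemma 2.2 is the case `f = det_m` (`bip2019_lemma_2_2_holds` below).
[cite: BurgisserIkenmeyerPanovaJAMS2019, Lemma 2.2] -/
theorem _root_.Literature.NumberTheory.DiophantineGeometry.HasHighestWeight.add_of_orbitCoordRep [Infinite k] (f : MvPolynomial σ k) (m : ℕ)
    {χ μ : Literature.NumberTheory.DiophantineGeometry.Weight σ} (hχ : Literature.NumberTheory.DiophantineGeometry.HasHighestWeight (AlgebraicComplexity.orbitCoordRep f m) χ)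
    (hμ : Literature.NumberTheory.DiophantineGeometry.HasHighestWeight (AlgebraicComplexity.orbitCoordRep f m) μ) :
    Literature.NumberTheory.DiophantineGeometry.HasHighestWeight (AlgebraicComplexity.orbitCoordRep f m) (χ + μ) := by
  rw [Literature.NumberTheory.DiophantineGeometry.hasHighestWeight_iff_exists] at hχ hμ ⊢
  obtain ⟨x, hx0, hx⟩ := hχ
  obtain ⟨y, hy0, hy⟩ := hμ
  haveI := AlgebraicComplexity.isDomain_orbitCoordRing f m
  exact ⟨x * y, mul_ne_zero hx0 hy0, mul_mem_highestWeightSpace_orbitCoordRep f m hx hy⟩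

end Semigroup

end Literature.Computability.Complexity

namespace Literature.Computability.Complexity

/-- **BIP Lemma 2.2 (semigroup property), verbatim in weight form.** "If `λ` occurs in `ℂ[Ω_n]`
and `μ` occurs in `ℂ[Ω_n]`, then `λ + μ` occurs in `ℂ[Ω_n]`." (Proof in print: "`λ` occurs in
`ℂ[Ω_n]` iff `ℂ[Ω_n]` contains a highest weight vector of weight `λ` ... the product of a highest
weight vector of weight `λ` with a highest weight vector of weight `μ` is a highest weight vector
of weight `λ + μ`. Nonzeroness of this product follows from the irreducibility of the variety
`Ω_n`.") In this file's letters and weight form: for all weights `χ`, `μ` of `GL_{m²}` occurring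
in `ℂ[Ω_m]` (`detOrbitRep ℂ m`), `χ + μ` occurs; for the weights `partitionWeightLex m λ`,
`partitionWeightLex m μ` of partitions `λ ⊢ d m`, `μ ⊢ d' m` (whose sum is the weight of the
row-wise sum `λ + μ ⊢ (d + d') m`) this is the printed statement. PROVED below
(`bip2019_lemma_2_2_holds`), exactly as in print.
[cite: BurgisserIkenmeyerPanovaJAMS2019, Lemma 2.2] -/
def bip2019_lemma_2_2 : Prop :=
  ∀ (m : ℕ) (χ μ : Literature.NumberTheory.DiophantineGeometry.Weight (Literature.NumberTheory.DiophantineGeometry.MatIdx m))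
    (_hχ : Literature.NumberTheory.DiophantineGeometry.HasHighestWeight (Literature.NumberTheory.DiophantineGeometry.detOrbitRep ℂ m) χ)
    (_hμ : Literature.NumberTheory.DiophantineGeometry.HasHighestWeight (Literature.NumberTheory.DiophantineGeometry.detOrbitRep ℂ m) μ),
    Literature.NumberTheory.DiophantineGeometry.HasHighestWeight (Literature.NumberTheory.DiophantineGeometry.detOrbitRep ℂ m) (χ + μ)

/-- **Discharge of `bip2019_lemma_2_2`** from the general semigroup property of orbit closures
(`CplxAlg.HasHighestWeight.add_of_orbitCoordRep` with `f = det_m` in the lexicographic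
variables). [cite: BurgisserIkenmeyerPanovaJAMS2019, Lemma 2.2] -/
theorem bip2019_lemma_2_2_holds : bip2019_lemma_2_2 := fun m _ _ hχ hμ =>
  Literature.NumberTheory.DiophantineGeometry.HasHighestWeight.add_of_orbitCoordRep (Literature.NumberTheory.DiophantineGeometry.detFormLex ℂ m) m hχ hμ

/-- **BIP Thm. 2.5 (Valiant: padded power sums lie in `Ω_n`), verbatim.** "Let `X, φ_1, …, φ_k`
be linear forms on `ℂ^{n×n}` and assume `n ≥ sk`. Then the power sum
`X^{n-s} (φ_1^s + ⋯ + φ_k^s)` of `k` terms of degree `s`, padded to degree `n`, is contained in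
`Ω_n`." In this file's letters (determinant `m`, positive as throughout BIP; `r` terms): for
linear forms (forms of degree `1`) `X, φ_0, …, φ_{r-1}` in the `m²` matrix variables and
`s r ≤ m`, `X^{m-s} · ∑ φ_i^s ∈ Ω_m = \overline{GL_{m²} · det_m}`, the orbit closure
`CplxAlg.orbitClosure (CplxAlg.detPoly (Fin m) ℂ)` in G20's variables `Fin m × Fin m` (transport
to the lexicographic variables by `CplxAlg.rename_mem_orbitClosure_rename_iff` if needed). PROVED
below (`bip2019_thm_2_5_holds`). [cite: BurgisserIkenmeyerPanovaJAMS2019, Thm. 2.5] -/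
def bip2019_thm_2_5 : Prop :=
  ∀ (m s r : ℕ) [NeZero m] (_h : s * r ≤ m) (X : MvPolynomial (Fin m × Fin m) ℂ)
    (φ : Fin r → MvPolynomial (Fin m × Fin m) ℂ) (_hX : X.IsHomogeneous 1)
    (_hφ : ∀ i, (φ i).IsHomogeneous 1),
    X ^ (m - s) * ∑ i, φ i ^ s ∈ AlgebraicComplexity.orbitClosure (AlgebraicComplexity.detPoly (Fin m) ℂ)

/-- **Discharge of `bip2019_thm_2_5`**: the case `k = ℂ` of
`CplxAlg.X_pow_mul_sum_pow_mem_orbitClosure_detPoly` (`PaddedPowerSums.lean`: explicit affine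
determinantal representation of the power sum of size `m`, homogenised with `X`, the `φ_i`
substituted; a determinant of linear forms lies in `End · det_m ⊆ Ω_m`).
[cite: BurgisserIkenmeyerPanovaJAMS2019, Thm. 2.5] -/
theorem bip2019_thm_2_5_holds : bip2019_thm_2_5 := fun _ _ _ _ h _ φ hX hφ =>
  AlgebraicComplexity.X_pow_mul_sum_pow_mem_orbitClosure_detPoly h hX φ hφ

end Literature.Computability.Complexity

/-! ## 4. BIP §6(b): the building blocks (Prop. 2.3, Thm. 6.2, as named facts) and the
splitting technique (Prop. 6.3, proved from them) -/

/-! ### 4a. `(m)` occurs in `k[Ω_m]_1` (BIP §6(a)), over any field -/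

namespace Literature.Computability.Complexity

section RowOccurs

variable {k σ : Type*} [Field k]

/-- Evaluating a linear substitution instance: `(A · f)(x) = f(Aᵀ x)`, i.e.
`eval x (linSubst A f) = eval (fun i => ∑ j, A j i * x j) f`. Landsberg 2017 §1.2. [folklore] -/
theorem eval_linSubst [Fintype σ] (A : Matrix σ σ k) (x : σ → k) (f : MvPolynomial σ k) :
    eval x (AlgebraicComplexity.linSubst σ k A f) = eval (fun i => ∑ j, A j i * x j) f := by
  have h : (aeval x).comp (AlgebraicComplexity.linSubst σ k A) = aeval (R := k) fun i => ∑ j, A j i * x j := by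
    rw [AlgebraicComplexity.linSubst, comp_aeval]
    congr 1
    funext i
    simp [map_sum, smul_eq_mul]
  have := congrArg (fun φ : MvPolynomial σ k →ₐ[k] k => φ f) h
  exact this

/-- Evaluation of a form of degree `m` at the coordinate point `e_v` (`1` at `v`, `0` elsewhere)
returns the coefficient of `X_v^m`. [folklore] -/
theorem eval_pi_single_of_isHomogeneous [DecidableEq σ] {p : MvPolynomial σ k} {m : ℕ}
    (hp : p.IsHomogeneous m) (v : σ) :
    eval (Pi.single v 1) p = coeff (Finsupp.single v m) p := by
  classical
  rw [eval_eq]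
  have hterm : ∀ d ∈ p.support, coeff d p * ∏ i ∈ d.support, (Pi.single v (1 : k) : σ → k) i ^ d i =
      if d = Finsupp.single v m then coeff d p else 0 := by
    intro d hd
    by_cases hsub : d.support ⊆ {v}
    · have hd' : d = Finsupp.single v (d v) := Finsupp.support_subset_singleton.mp hsub
      have hdeg : d v = m := by
        have h1 := hp (mem_support_iff.mp hd)
        rw [Finsupp.weight_apply] at h1
        simp only [Pi.one_apply, smul_eq_mul, mul_one] at h1
        rw [hd', Finsupp.sum_single_index rfl] at h1
        -- h1 : d v = m, but stated for `single v (d v)`; massage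
        simpa using h1
      have hdv : d = Finsupp.single v m := by rw [← hdeg]; exact hd'
      rw [if_pos hdv]
      have : ∏ i ∈ d.support, (Pi.single v (1 : k) : σ → k) i ^ d i = 1 := by
        refine Finset.prod_eq_one fun i hi => ?_
        have hi' : i = v := Finset.mem_singleton.mp (hsub hi)
        subst hi'
        simp
      rw [this, mul_one]
    · have hne : d ≠ Finsupp.single v m := by
        rintro rfl
        exact hsub Finsupp.support_single_subset
      rw [if_neg hne]
      obtain ⟨i, hi, hiv⟩ : ∃ i ∈ d.support, i ≠ v := by
        by_contra hcon
        exact hsub fun i hi => Finset.mem_singleton.mpr (by_contra fun hiv => hcon ⟨i, hi, hiv⟩)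
      have hzero : (Pi.single v (1 : k) : σ → k) i ^ d i = 0 := by
        rw [Pi.single_eq_of_ne hiv, zero_pow (Finsupp.mem_support_iff.mp hi)]
      rw [Finset.prod_eq_zero hi hzero, mul_zero]
  rw [Finset.sum_congr rfl hterm, Finset.sum_ite_eq']
  split_ifs with h
  · rfl
  · exact (notMem_support_iff.mp h).symm

/-- For an upper triangular `g` and the greatest index `iₘ`, the coefficient of `X_{iₘ}^m` in
`g · X^e` (`|e| = m`) is `g_{iₘ iₘ}^m` if `X^e = X_{iₘ}^m` and `0` otherwise: with the column
convention `X_i ↦ ∑_{j ≤ i} g_{ji} X_j` the variable `X_{iₘ}` only arises from `X_{iₘ}` itself.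
Fulton–Harris §15.3, §15.5 (weights of `Sym^m V^*`). [folklore] -/
theorem coeff_single_linSubst_monomial_of_isUpperTriangular [Fintype σ] [LinearOrder σ]
    {g : GL σ k} (hg : Literature.NumberTheory.DiophantineGeometry.IsUpperTriangular g) (iₘ : σ) (hiₘ : ∀ i, i ≤ iₘ) {m : ℕ} (e : σ →₀ ℕ)
    (he : e.degree = m) :
    coeff (Finsupp.single iₘ m) (AlgebraicComplexity.linSubst σ k (g : Matrix σ σ k) (monomial e 1)) =
      if e = Finsupp.single iₘ m then (g : Matrix σ σ k) iₘ iₘ ^ m else 0 := by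
  classical
  rw [← eval_pi_single_of_isHomogeneous
    (AlgebraicComplexity.linSubst_isHomogeneous (g : Matrix σ σ k) (isHomogeneous_monomial (1 : k) he)) iₘ,
    eval_linSubst, eval_monomial, one_mul]
  have hpt : ∀ i, ∑ j, (g : Matrix σ σ k) j i * (Pi.single iₘ (1 : k) : σ → k) j =
      (g : Matrix σ σ k) iₘ i := by
    intro i
    rw [Finset.sum_eq_single iₘ (fun j _ hj => by rw [Pi.single_eq_of_ne hj, mul_zero])
      (fun h => absurd (Finset.mem_univ iₘ) h), Pi.single_eq_same, mul_one]
  simp only [hpt]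
  by_cases hsub : e.support ⊆ {iₘ}
  · have he' : e = Finsupp.single iₘ (e iₘ) := Finsupp.support_subset_singleton.mp hsub
    have hdeg : e iₘ = m := by
      rw [← he, he', Finsupp.degree_single, Finsupp.single_eq_same]
    have heq : e = Finsupp.single iₘ m := hdeg ▸ he'
    rw [if_pos heq, heq, Finsupp.prod_single_index (by simp)]
  · have hne : e ≠ Finsupp.single iₘ m := by
      rintro rfl
      exact hsub Finsupp.support_single_subset
    rw [if_neg hne]
    obtain ⟨i, hi, hiv⟩ : ∃ i ∈ e.support, i ≠ iₘ := by
      by_contra hcon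
      exact hsub fun i hi => Finset.mem_singleton.mpr (by_contra fun hiv => hcon ⟨i, hi, hiv⟩)
    rw [Finsupp.prod, Finset.prod_eq_zero hi]
    rw [hg.apply_eq_zero ((hiₘ i).lt_of_ne hiv), zero_pow (Finsupp.mem_support_iff.mp hi)]

/-- **The coordinate function `X_{iₘ}^m ↦` coefficient of `X_{iₘ}^m` is a highest-weight vector
of weight `-m ε_{iₘ}` in `k[Sym^m k^σ]`** (`iₘ` the greatest index): for upper triangular `g`,
`g · X_d = g_{iₘ iₘ}^{-m} X_d` where `d = X_{iₘ}^m`. This is BIP's "`e_{11}^n ∈ Sym^n V` is a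
highest weight vector of weight `(n)`" (§6(a)) in the dual coordinate-ring convention of
`coordRep` (weights of coordinate rings are duals, BLMW 2011 (5.2.2)).
[cite: BurgisserIkenmeyerPanovaJAMS2019, §6(a)] -/
theorem X_mem_highestWeightSpace_coordRep [Fintype σ] [LinearOrder σ] (m : ℕ) (iₘ : σ)
    (hiₘ : ∀ i, i ≤ iₘ) (d : AlgebraicComplexity.DegIdx σ m) (hd : d.1 = Finsupp.single iₘ m) :
    (X d : MvPolynomial (AlgebraicComplexity.DegIdx σ m) k) ∈
      Literature.NumberTheory.DiophantineGeometry.highestWeightSpace (AlgebraicComplexity.coordRep σ k m) (Pi.single iₘ (-(m : ℤ))) := by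
  intro g hg
  have hg' : Literature.NumberTheory.DiophantineGeometry.IsUpperTriangular g⁻¹ := (Literature.NumberTheory.DiophantineGeometry.borelSubgroup σ k).inv_mem hg
  rw [AlgebraicComplexity.coordRep_apply, AlgebraicComplexity.coordSubst_X]
  have hcoeff : ∀ e : AlgebraicComplexity.DegIdx σ m,
      coeff d.1 (AlgebraicComplexity.linSubstRep σ k g⁻¹ (monomial e.1 1)) =
        if e = d then ((g : Matrix σ σ k) iₘ iₘ)⁻¹ ^ m else 0 := by
    intro e
    rw [AlgebraicComplexity.linSubstRep_apply, hd,
      coeff_single_linSubst_monomial_of_isUpperTriangular hg' iₘ hiₘ e.1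
        (AlgebraicComplexity.mem_degMonomials_iff.mp e.2), AlgebraicComplexity.inv_apply_diag_of_isUpperTriangular' hg]
    congr 1
    rw [← hd]
    exact propext Subtype.ext_iff.symm
  simp only [hcoeff, ite_smul, zero_smul, Finset.sum_ite_eq', Finset.mem_univ, if_true]
  congr 1
  rw [Literature.NumberTheory.DiophantineGeometry.weightChar, Finset.prod_eq_single iₘ (fun j _ hj => by rw [Pi.single_eq_of_ne hj, zpow_zero])
    (fun h => absurd (Finset.mem_univ iₘ) h), Pi.single_eq_same, zpow_neg, zpow_natCast, inv_pow]

/-- Occurrence in `k[Δ_m[f]]` from ONE highest-weight vector of `k[Sym^m]` not vanishing on the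
orbit `GL · f` (single-vector form of `hasHighestWeight_orbitCoordRep_of_forall_not_mem`).
BIP §3(b) (definition of occurrence) / §6(a). [cite: BurgisserIkenmeyerPanovaJAMS2019, §6(a)] -/
theorem hasHighestWeight_orbitCoordRep_of_not_mem [Fintype σ] [LinearOrder σ]
    (f : MvPolynomial σ k) (m : ℕ) {χ : Literature.NumberTheory.DiophantineGeometry.Weight σ} {v : MvPolynomial (AlgebraicComplexity.DegIdx σ m) k}
    (hv : v ∈ Literature.NumberTheory.DiophantineGeometry.highestWeightSpace (AlgebraicComplexity.coordRep σ k m) χ) (hvI : v ∉ AlgebraicComplexity.orbitVanishingIdeal f m) :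
    Literature.NumberTheory.DiophantineGeometry.HasHighestWeight (AlgebraicComplexity.orbitCoordRep f m) χ := by
  rw [Literature.NumberTheory.DiophantineGeometry.hasHighestWeight_iff_exists]
  refine ⟨mkIntertwiningMap f m v, ?_,
    Literature.NumberTheory.DiophantineGeometry.highestWeightSpace_le_comap_intertwiningMap (mkIntertwiningMap f m) χ hv⟩
  rwa [mkIntertwiningMap_apply, Ne, Ideal.Quotient.eq_zero_iff_mem]

/-- **`(m)` occurs in `k[Ω_m]_1` (BIP §6(a), first paragraph), weight form.** "We first show that
`(n)` occurs in `ℂ[Ω_n]_1`. Indeed, we have `X_1^n ∈ Ω_n` and `e_{11}^n ∈ Sym^n V` is a highest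
weight vector of weight `(n)` such that `⟨e_{11}^n, X_1^n⟩ = 1`." Here: the coordinate function
of `X_{iₘ}^m` (`iₘ = (m-1, m-1)` the greatest matrix index) is a highest-weight vector of weight
`-m ε_{iₘ}` (`X_mem_highestWeightSpace_coordRep`) and takes the value `det 1 = 1` at the point
`g · det_m`, `g` the unipotent substitution `X_{aa} ↦ X_{aa} + X_{iₘ}` (`a < m - 1`), of the
orbit; over any field. [cite: BurgisserIkenmeyerPanovaJAMS2019, §6(a)] -/
theorem hasHighestWeight_detOrbitRep_single_top (m : ℕ) [NeZero m] (iₘ : Literature.NumberTheory.DiophantineGeometry.MatIdx m)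
    (hiₘ : ∀ i, i ≤ iₘ) :
    Literature.NumberTheory.DiophantineGeometry.HasHighestWeight (Literature.NumberTheory.DiophantineGeometry.detOrbitRep k m) (Pi.single iₘ (-(m : ℤ))) := by
  classical
  -- the greatest index is the diagonal position `(m-1, m-1)`
  set a₀ : Fin m := Fin.rev 0 with ha₀
  have htop : iₘ = toLex (a₀, a₀) := by
    refine le_antisymm ?_ (hiₘ _)
    rcases h : ofLex iₘ with ⟨a, b⟩
    have hiₘ' : iₘ = toLex (a, b) := by rw [← h, toLex_ofLex]
    rw [hiₘ', Prod.Lex.toLex_le_toLex]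
    rcases (Fin.le_rev_iff.mpr (Fin.zero_le _) : a ≤ a₀).lt_or_eq with hlt | heq
    · exact Or.inl hlt
    · exact Or.inr ⟨heq, Fin.le_rev_iff.mpr (Fin.zero_le _)⟩
  -- the degree-`m` index of the monomial `X_{iₘ}^m`
  have hdeg : (Finsupp.single iₘ m : Literature.NumberTheory.DiophantineGeometry.MatIdx m →₀ ℕ) ∈ AlgebraicComplexity.degMonomials (Literature.NumberTheory.DiophantineGeometry.MatIdx m) m := by
    rw [AlgebraicComplexity.mem_degMonomials_iff, Finsupp.degree_single]
  set d : AlgebraicComplexity.DegIdx (Literature.NumberTheory.DiophantineGeometry.MatIdx m) m := ⟨Finsupp.single iₘ m, hdeg⟩ with hd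
  refine hasHighestWeight_orbitCoordRep_of_not_mem (Literature.NumberTheory.DiophantineGeometry.detFormLex k m) m
    (X_mem_highestWeightSpace_coordRep m iₘ hiₘ d rfl) ?_
  -- the unipotent substitution `X_{aa} ↦ X_{aa} + X_{iₘ}` for `(a, a) ≠ iₘ`
  set E : Matrix (Literature.NumberTheory.DiophantineGeometry.MatIdx m) (Literature.NumberTheory.DiophantineGeometry.MatIdx m) k := Matrix.of fun j i =>
    if j = iₘ ∧ i ≠ iₘ ∧ (ofLex i).1 = (ofLex i).2 then 1 else 0 with hE
  have hE2 : E * E = 0 := by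
    ext j i
    rw [Matrix.mul_apply, Matrix.zero_apply]
    refine Finset.sum_eq_zero fun l _ => ?_
    by_cases hl : l = iₘ
    · have : E j l = 0 := by
        rw [hE, Matrix.of_apply, if_neg]
        exact fun h => h.2.1 hl
      rw [this, zero_mul]
    · have : E l i = 0 := by
        rw [hE, Matrix.of_apply, if_neg]
        exact fun h => hl h.1
      rw [this, mul_zero]
  set g : GL (Literature.NumberTheory.DiophantineGeometry.MatIdx m) k := ⟨1 + E, 1 - E,
    by rw [add_mul, mul_sub, mul_sub, one_mul, one_mul, mul_one, hE2]; abel,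
    by rw [sub_mul, mul_add, mul_add, one_mul, one_mul, mul_one, hE2]; abel⟩ with hg
  rw [AlgebraicComplexity.mem_orbitVanishingIdeal_iff, not_forall]
  refine ⟨g, ?_⟩
  rw [aeval_X, AlgebraicComplexity.formCoeff_apply, AlgebraicComplexity.linSubstRep_apply]
  change coeff (Finsupp.single iₘ m) (AlgebraicComplexity.linSubst _ k (1 + E) (Literature.NumberTheory.DiophantineGeometry.detFormLex k m)) ≠ 0
  rw [← eval_pi_single_of_isHomogeneous
    (AlgebraicComplexity.linSubst_isHomogeneous _ (Literature.NumberTheory.DiophantineGeometry.detFormLex_isHomogeneous k m)) iₘ, eval_linSubst, Literature.NumberTheory.DiophantineGeometry.detFormLex,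
    eval_rename, AlgebraicComplexity.eval_detPoly]
  -- the evaluated matrix is the identity
  have hmat : (Matrix.of fun a b : Fin m =>
      ((fun i => ∑ j, (1 + E) j i * (Pi.single iₘ (1 : k) : Literature.NumberTheory.DiophantineGeometry.MatIdx m → k) j) ∘ toLex) (a, b)) =
      1 := by
    ext a b
    simp only [Matrix.of_apply, Function.comp_apply]
    rw [Finset.sum_eq_single iₘ (fun j _ hj => by rw [Pi.single_eq_of_ne hj, mul_zero])
      (fun h => absurd (Finset.mem_univ iₘ) h), Pi.single_eq_same, mul_one, Matrix.add_apply,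
      hE, Matrix.of_apply, Matrix.one_apply, Matrix.one_apply, htop]
    by_cases hab : a = b
    · subst hab
      by_cases ha : a = a₀
      · subst ha
        simp
      · have hne : toLex (a, a) ≠ toLex (a₀, a₀) := fun h => ha (congrArg Prod.fst (toLex_inj.mp h))
        simp [hne, Ne.symm hne]
    · have hne : toLex (a₀, a₀) ≠ toLex (a, b) := fun h => hab
        ((congrArg Prod.fst (toLex_inj.mp h)).symm.trans (congrArg Prod.snd (toLex_inj.mp h)))
      simp [hne, hab]
  rw [hmat, Matrix.det_one]
  exact one_ne_zero

end RowOccurs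

end Literature.Computability.Complexity

/-! ### 4b. Partitions with prescribed rows -/

namespace Literature.Computability.Complexity

open Finset

/-- The partition with prescribed rows: for a row-length function `w : ℕ → ℕ` and a number of
rows `L` with `∑_{r < L} w r = D`, the partition of `D` whose parts are the nonzero `w r`,
`r < L` (junk: the one-row partition `(D)` if the row sum is not `D`). Used with `w` weakly
decreasing, when its Young diagram has rows `w 0 ≥ w 1 ≥ ⋯` (Fulton, *Young Tableaux*, §0;
BIP write partitions by their rows, `k × ℓ` = `k` rows of length `ℓ`). [folklore] -/
def partitionOfRows (w : ℕ → ℕ) (L D : ℕ) : Nat.Partition D :=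
  if h : ∑ r ∈ range L, w r = D then
    Nat.Partition.ofSums D ((range L).val.map w) (by rwa [← Finset.sum_eq_multiset_sum])
  else Nat.Partition.indiscrete D

/-- The sorted parts of `partitionOfRows w L D` for weakly decreasing `w` with row sum `D` are
the nonzero values `w 0, w 1, …` in this order. [folklore] -/
theorem sortedParts_partitionOfRows {w : ℕ → ℕ} (hw : Antitone w) {L D : ℕ}
    (h : ∑ r ∈ range L, w r = D) :
    (partitionOfRows w L D).sortedParts = ((List.range L).map w).filter (0 < ·) := by
  have hsorted : ((List.range L).map w).Pairwise (· ≥ ·) := by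
    rw [List.pairwise_map]
    exact List.pairwise_lt_range.imp fun hab => hw hab.le
  have hparts : (partitionOfRows w L D).parts = (((List.range L).map w).filter (0 < ·) : List ℕ) := by
    rw [partitionOfRows, dif_pos h, Nat.Partition.ofSums_parts, Finset.range_val,
      ← Multiset.coe_range, Multiset.map_coe, Multiset.filter_coe]
    congr 1
    exact List.filter_congr fun x _ => by simp [Nat.pos_iff_ne_zero]
  change (partitionOfRows w L D).parts.sort (· ≥ ·) = _
  rw [hparts, Multiset.coe_sort]
  exact List.mergeSort_eq_self (r := (· ≥ ·)) (hsorted.filter _)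

/-- The rows of `partitionOfRows w L D` (weakly decreasing `w`, row sum `D`): the `i`-th
sorted part (zero-padded) is `w i` for `i < L` and `0` beyond. [folklore] -/
theorem getD_sortedParts_partitionOfRows {w : ℕ → ℕ} (hw : Antitone w) {L D : ℕ}
    (h : ∑ r ∈ range L, w r = D) (i : ℕ) :
    (partitionOfRows w L D).sortedParts.getD i 0 = if i < L then w i else 0 := by
  have hsorted : ((List.range L).map w).Pairwise (· ≥ ·) := by
    rw [List.pairwise_map]
    exact List.pairwise_lt_range.imp fun hab => hw hab.le
  rw [sortedParts_partitionOfRows hw h, Literature.NumberTheory.DiophantineGeometry.Weight.getD_filter_pos_of_pairwise hsorted]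
  split_ifs with hi
  · rw [List.getD_eq_getElem _ _ (by simpa using hi), List.getElem_map, List.getElem_range]
  · exact List.getD_eq_default _ _ (by simpa using hi)

/-- The weight of `partitionOfRows w L D` in `GL_N` (weakly decreasing `w`, row sum `D`) is
`(w 0, w 1, …)` truncated at row `L`. [folklore] -/
theorem ofPartition_partitionOfRows {w : ℕ → ℕ} (hw : Antitone w) {L D : ℕ}
    (h : ∑ r ∈ range L, w r = D) (N : ℕ) :
    Literature.NumberTheory.DiophantineGeometry.Weight.ofPartition N (partitionOfRows w L D) =
      fun i : Fin N => ((if (i : ℕ) < L then w i else 0 : ℕ) : ℤ) := by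
  funext i
  rw [Literature.NumberTheory.DiophantineGeometry.Weight.ofPartition_apply, getD_sortedParts_partitionOfRows hw h]

/-- `partitionOfRows w L D` has at most `L` parts. [folklore] -/
theorem card_parts_partitionOfRows_le {w : ℕ → ℕ} (hw : Antitone w) {L D : ℕ}
    (h : ∑ r ∈ range L, w r = D) : (partitionOfRows w L D).parts.card ≤ L := by
  rw [← Nat.Partition.length_sortedParts, sortedParts_partitionOfRows hw h]
  exact (List.length_filter_le _ _).trans (by simp)

/-! ### Rows, first row and body of an arbitrary partition -/

/-- The largest part `λ₁` of a partition is the head of its sorted parts. [folklore] -/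
theorem sup_parts_eq_getD_sortedParts {N : ℕ} (lam : Nat.Partition N) :
    lam.parts.sup = lam.sortedParts.getD 0 0 := by
  have hperm : ∀ a, a ∈ lam.parts ↔ a ∈ lam.sortedParts := fun a =>
    (Multiset.mem_sort _).symm
  by_cases h0 : lam.sortedParts.length = 0
  · have hnil : lam.sortedParts = [] := List.eq_nil_of_length_eq_zero h0
    have hp : lam.parts = 0 := by
      rw [Multiset.eq_zero_iff_forall_notMem]
      intro a ha
      rw [hperm, hnil] at ha
      exact List.not_mem_nil ha
    simp [hp, hnil]
  · have hlen : 0 < lam.sortedParts.length := Nat.pos_of_ne_zero h0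
    rw [List.getD_eq_getElem _ _ hlen]
    refine le_antisymm (Multiset.sup_le.mpr fun a ha => ?_) (Multiset.le_sup ?_)
    · obtain ⟨j, hj, rfl⟩ := List.getElem_of_mem ((hperm a).mp ha)
      rcases Nat.eq_zero_or_pos j with rfl | hjpos
      · exact le_rfl
      · exact List.sortedGE_iff_getElem_ge_getElem_of_le.mp lam.sortedGE_sortedParts
          (Nat.zero_le j)
    · exact (hperm _).mpr (List.getElem_mem hlen)

/-- The zero-padded rows `r ↦ λ_{r+1}` of a partition are weakly decreasing. [folklore] -/
theorem antitone_getD_sortedParts {N : ℕ} (lam : Nat.Partition N) :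
    Antitone fun r => lam.sortedParts.getD r 0 := by
  intro i j hij
  dsimp only
  by_cases hj : j < lam.sortedParts.length
  · rw [List.getD_eq_getElem _ _ hj, List.getD_eq_getElem _ _ (lt_of_le_of_lt hij hj)]
    exact List.sortedGE_iff_getElem_ge_getElem_of_le.mp lam.sortedGE_sortedParts hij
  · rw [List.getD_eq_default _ _ (not_lt.mp hj)]
    exact Nat.zero_le _

/-- The rows of a partition of `N` sum to `N`: `∑_{r < ℓ(λ)} λ_{r+1} = N`. [folklore] -/
theorem sum_range_getD_sortedParts {N : ℕ} (lam : Nat.Partition N) :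
    ∑ r ∈ range lam.parts.card, lam.sortedParts.getD r 0 = N := by
  rw [← Nat.Partition.length_sortedParts, ← Fin.sum_univ_eq_sum_range
    (fun r => lam.sortedParts.getD r 0)]
  have h := Fin.sum_univ_fun_getElem lam.sortedParts id
  rw [List.map_id, lam.sum_sortedParts] at h
  refine Eq.trans (Finset.sum_congr rfl fun i _ => ?_) h
  rw [List.getD_eq_getElem _ _ i.2]
  rfl

end Literature.Computability.Complexity

/-! ### Weights from bodies and degrees (`λ ↦ λ♯D` in coordinates) -/

namespace Literature.Computability.Complexity

open Finset

section Sharp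

/-- BIP's "lifted shape" operation `λ ↦ λ♯D` (§2(a): "the partition `λ + (D - |λ|)` that arises
from `λ` by extending the first row so that `λ♯D` has `D` boxes") in weight coordinates
`Fin N → ℤ`, as an additive homomorphism of the pair (body, degree): `sharpAddHom m N (β, D)`
agrees with `β` off row `0` and has entry `D·m - ∑ β` in row `0` (so its entries sum to `D·m`
when `β 0 = 0`). Additivity in `(β, D)` is the bookkeeping behind "the semigroup property
implies that `μ` occurs" in the proof of Prop. 6.3. [cite: BurgisserIkenmeyerPanovaJAMS2019, §2(a) (λ♯D)] -/
def sharpAddHom (m N : ℕ) : (Fin N → ℤ) × ℕ →+ (Fin N → ℤ) where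
  toFun p := fun r => p.1 r + if (r : ℕ) = 0 then (p.2 : ℤ) * m - ∑ i, p.1 i else 0
  map_zero' := by
    funext r
    simp
  map_add' p q := by
    funext r
    simp only [Prod.fst_add, Prod.snd_add, Pi.add_apply, Finset.sum_add_distrib, Nat.cast_add]
    split_ifs <;> ring

/-- Unfolding lemma for `sharpAddHom`. [cite: BurgisserIkenmeyerPanovaJAMS2019, §2(a) (λ♯D)] -/
theorem sharpAddHom_apply (m N : ℕ) (p : (Fin N → ℤ) × ℕ) (r : Fin N) :
    sharpAddHom m N p r = p.1 r + if (r : ℕ) = 0 then (p.2 : ℤ) * m - ∑ i, p.1 i else 0 :=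
  rfl

/-- The body of a single column of length `k` in weight coordinates: `1` in rows `1, …, k-1`,
`0` in row `0` and in rows `≥ k` (BIP, proof of Prop. 6.3: "`c_k` denote the number of columns
of length `k` in `λ`", `λ = ∑_k k × c_k`). [cite: BurgisserIkenmeyerPanovaJAMS2019, Prop. 6.3 (proof)] -/
def colBody (N k : ℕ) : Fin N → ℤ :=
  fun r => if 1 ≤ (r : ℕ) ∧ (r : ℕ) < k then 1 else 0

/-- Unfolding lemma for `colBody`. [cite: BurgisserIkenmeyerPanovaJAMS2019, Prop. 6.3 (proof)] -/
theorem colBody_apply (N k : ℕ) (r : Fin N) :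
    colBody N k r = if 1 ≤ (r : ℕ) ∧ (r : ℕ) < k then 1 else 0 :=
  rfl

/-- A column of length `k ≤ N` has `k - 1` boxes below the first row. [folklore] -/
theorem sum_colBody {N k : ℕ} (hk : k ≤ N) : ∑ r, colBody N k r = ((k - 1 : ℕ) : ℤ) := by
  have h1 : ∑ r : Fin N, colBody N k r =
      ∑ n ∈ range N, (if 1 ≤ n ∧ n < k then (1 : ℤ) else 0) :=
    Fin.sum_univ_eq_sum_range (fun n => if 1 ≤ n ∧ n < k then (1 : ℤ) else 0) N
  rw [h1, ← Finset.sum_filter]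
  have h2 : (range N).filter (fun n => 1 ≤ n ∧ n < k) = Ico 1 k := by
    ext n
    simp only [mem_filter, mem_range, mem_Ico]
    omega
  rw [h2, sum_const, Nat.card_Ico, nsmul_eq_mul, mul_one]

end Sharp

/-! ### Column counts and telescoping -/

section Columns

/-- Telescoping of column counts: for weakly decreasing row lengths `W`,
`∑_{r < k ≤ n} (W_{k-1} - W_k) = W_r - W_n`. [folklore] -/
theorem sum_Ioc_sub_eq {W : ℕ → ℕ} (hW : Antitone W) {r n : ℕ} (h : r ≤ n) :
    ∑ k ∈ Ioc r n, (W (k - 1) - W k) = W r - W n := by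
  induction n, h using Nat.le_induction with
  | base => simp
  | succ n hrn ih =>
    rw [Finset.sum_Ioc_succ_top (by omega), ih, Nat.add_sub_cancel]
    have h1 : W n ≤ W r := hW hrn
    have h2 : W (n + 1) ≤ W n := hW (Nat.le_succ n)
    omega

/-- Summation by parts for column counts: for weakly decreasing `W` and `n ≥ 1`,
`∑_{1 < k ≤ n} k (W_{k-1} - W_k) + n W_n = W_1 + ∑_{1 ≤ r < n} W_r`. [folklore] -/
theorem sum_Ioc_mul_sub_eq {W : ℕ → ℕ} (hW : Antitone W) {n : ℕ} (hn : 1 ≤ n) :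
    ∑ k ∈ Ioc 1 n, k * (W (k - 1) - W k) + n * W n = W 1 + ∑ r ∈ Ico 1 n, W r := by
  induction n, hn using Nat.le_induction with
  | base => simp
  | succ n hn ih =>
    rw [Finset.sum_Ioc_succ_top (by omega), Finset.sum_Ico_succ_top hn, Nat.add_sub_cancel]
    have h2 : W (n + 1) ≤ W n := hW (Nat.le_succ n)
    have key : (n + 1) * (W n - W (n + 1)) + (n + 1) * W (n + 1) = n * W n + W n := by
      rw [← Nat.mul_add, Nat.sub_add_cancel h2]
      ring
    omega

/-- The body of a shape as a sum of column bodies: if `W` (row lengths) is weakly decreasing and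
vanishes from row `L` on, then off row `0` the weight `(W_r)_r` is
`∑_{1 < k ≤ L} c_k · colBody k` with `c_k = W_{k-1} - W_k` the number of columns of length `k`
(BIP, proof of Prop. 6.3, `λ = ∑_k k × c_k`). [cite: BurgisserIkenmeyerPanovaJAMS2019, Prop. 6.3 (proof)] -/
theorem body_eq_sum_colBody {W : ℕ → ℕ} (hW : Antitone W) {L N : ℕ} (hWL : ∀ r, L ≤ r → W r = 0) :
    (fun r : Fin N => if (r : ℕ) = 0 then (0 : ℤ) else (W r : ℤ)) =
      ∑ k ∈ Ioc 1 L, (W (k - 1) - W k) • colBody N k := by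
  funext r
  rw [Finset.sum_apply]
  simp only [Pi.smul_apply, colBody_apply, smul_ite, smul_zero, nsmul_eq_mul, mul_one]
  rw [← Finset.sum_filter]
  by_cases hr : (r : ℕ) = 0
  · rw [if_pos hr]
    symm
    refine Finset.sum_eq_zero fun k hk => ?_
    simp only [mem_filter] at hk
    omega
  · rw [if_neg hr]
    rcases le_or_gt L r with hLr | hrL
    · rw [hWL r hLr, Nat.cast_zero]
      symm
      refine Finset.sum_eq_zero fun k hk => ?_
      simp only [mem_filter, mem_Ioc] at hk
      have h1 : W (k - 1) = 0 := hWL _ (by omega)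
      have h2 : W k = 0 := hWL _ (by omega)
      simp [h1, h2]
    · have hfilter : (Ioc 1 L).filter (fun k => 1 ≤ (r : ℕ) ∧ (r : ℕ) < k) = Ioc (r : ℕ) L := by
        ext k
        simp only [mem_filter, mem_Ioc]
        omega
      rw [hfilter, ← Nat.cast_sum, sum_Ioc_sub_eq hW hrL.le, hWL L le_rfl, Nat.sub_zero]

end Columns

end Literature.Computability.Complexity

/-! ### 4c. The splitting technique, abstractly -/

namespace Literature.Computability.Complexity

open Finset

/-- Gauss: `2 ∑_{1 < k ≤ L} (k - 1) = L (L - 1)`. [folklore] -/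
theorem two_mul_sum_Ioc_sub_one (L : ℕ) : 2 * ∑ k ∈ Ioc 1 L, (k - 1) = L * (L - 1) := by
  induction L with
  | zero => simp
  | succ L ih =>
    rcases Nat.eq_zero_or_pos L with rfl | hL
    · simp
    · rw [Finset.sum_Ioc_succ_top (by omega : 1 ≤ L), Nat.mul_add, ih, Nat.add_sub_cancel]
      obtain ⟨L', rfl⟩ := Nat.exists_eq_add_of_le' hL
      rw [Nat.add_sub_cancel]
      ring

/-- Gauss: `2 ∑_{1 < k ≤ L} k + 2 = L (L + 1)` for `L ≥ 1`. [folklore] -/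
theorem two_mul_sum_Ioc (L : ℕ) (hL : 1 ≤ L) : 2 * ∑ k ∈ Ioc 1 L, k + 2 = L * (L + 1) := by
  induction L, hL using Nat.le_induction with
  | base => simp
  | succ L hL ih =>
    rw [Finset.sum_Ioc_succ_top hL, Nat.mul_add]
    nlinarith [ih]

/-- The difference of two even naturals (truncated subtraction) is even. [folklore] -/
theorem even_tsub_of_even {a b : ℕ} (ha : Even a) (hb : Even b) : Even (a - b) := by
  by_cases hle : b ≤ a
  · exact (Nat.even_sub hle).mpr ⟨fun _ => hb, fun _ => ha⟩
  · rw [Nat.sub_eq_zero_of_le (not_le.mp hle).le]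
    exact Even.zero

/-- **The splitting technique of BIP Prop. 6.3, abstract form.** Let `T` be an additive
submonoid of `A × ℕ` ("(body, degree) pairs of occurring partitions", closed under addition by
the semigroup property Lemma 2.2) containing `(0, 1)` ("`(n)` occurs in degree `1`", §6(a)), the
row-extended even rectangles `(ℓ • v_k, k)` for `1 < k ≤ L`, `ℓ > 0` even, `k ℓ ≤ n`
(Prop. 2.3; `v_k` the body of a column of length `k`) and, for all `1 < b, c ≤ L`, some hook
block `(v_b + i • v_c, 3 M⁴)` with `i ≤ 2 M⁴` even (Thm. 6.2). If `2 ≤ M`, `L ≤ M²`,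
`n ≥ 24 M⁶`, `d > 4 M⁶`, and the column counts `c_k` satisfy `M^{10} ≤ ∑ (k-1) c_k` (`= |λ̄|`)
and `∑ k c_k ≤ 2 M d` (`= |λ̄| + λ₂ ≤ 2|λ̄| ≤ 2 M d`), then `(∑_k c_k • v_k, d) ∈ T`. This is
exactly the printed proof ((6.1), (6.2) and the Claim `|μ| ≤ dn`), with the bookkeeping of
first rows replaced by degrees. [cite: BurgisserIkenmeyerPanovaJAMS2019, Prop. 6.3 (proof)] -/
theorem mem_of_splitting {A : Type*} [AddCommMonoid A] (T : AddSubmonoid (A × ℕ)) (v : ℕ → A)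
    {n M L d : ℕ} (c : ℕ → ℕ) (hM : 2 ≤ M) (hL : L ≤ M ^ 2) (hn : 24 * M ^ 6 ≤ n)
    (hd : 4 * M ^ 6 < d) (hb₁ : M ^ 10 ≤ ∑ k ∈ Ioc 1 L, (k - 1) * c k)
    (hb₂ : ∑ k ∈ Ioc 1 L, k * c k ≤ 2 * M * d) (h1 : ((0 : A), 1) ∈ T)
    (h23 : ∀ k ∈ Ioc 1 L, ∀ ℓ, 0 < ℓ → Even ℓ → k * ℓ ≤ n → (ℓ • v k, k) ∈ T)
    (h62 : ∀ b ∈ Ioc 1 L, ∀ c ∈ Ioc 1 L,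
      ∃ i, Even i ∧ i ≤ 2 * M ^ 4 ∧ (v b + i • v c, 3 * M ^ 4) ∈ T) :
    (∑ k ∈ Ioc 1 L, c k • v k, d) ∈ T := by
  classical
  set I := Ioc 1 L with hI
  have hmemI : ∀ {k}, k ∈ I → 2 ≤ k ∧ k ≤ L := fun hk => by
    rw [hI, Finset.mem_Ioc] at hk; omega
  have hMpos : 0 < M := by omega
  have hM2 : 1 ≤ M ^ 2 := Nat.one_le_pow _ _ hMpos
  have hM4 : M ^ 4 = M ^ 2 * M ^ 2 := by ring
  have hM6 : M ^ 6 = M ^ 2 * M ^ 4 := by ring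
  have hM10 : M ^ 10 = M ^ 6 * M ^ 4 := by ring
  -- `I` is nonempty (else `|λ̄| = 0 < M¹⁰`)
  have hIne : I.Nonempty := by
    rw [Finset.nonempty_iff_ne_empty]
    rintro hIe
    rw [hIe, Finset.sum_empty] at hb₁
    have : 0 < M ^ 10 := pow_pos hMpos 10
    omega
  -- `K`: a column length `≥ 2` with the maximal count
  obtain ⟨K, hKI, hKmax⟩ := Finset.exists_max_image I c hIne
  -- `c K ≥ 2 M⁶`
  have hcK : 2 * M ^ 6 ≤ c K := by
    have h1 : ∑ k ∈ I, (k - 1) * c k ≤ (∑ k ∈ I, (k - 1)) * c K := by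
      rw [Finset.sum_mul]
      exact Finset.sum_le_sum fun k hk => Nat.mul_le_mul_left _ (hKmax k hk)
    have h2 : 2 * ∑ k ∈ I, (k - 1) = L * (L - 1) := two_mul_sum_Ioc_sub_one L
    have h3 : L * (L - 1) + 1 ≤ M ^ 4 := by
      rw [hM4]
      rcases Nat.eq_zero_or_pos L with rfl | hLpos
      · simp; exact hM2
      · calc L * (L - 1) + 1 ≤ L * (L - 1) + L := by omega
          _ = L * L := by
            obtain ⟨L', rfl⟩ := Nat.exists_eq_add_of_le' hLpos
            rw [Nat.add_sub_cancel]; ring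
          _ ≤ M ^ 2 * M ^ 2 := Nat.mul_le_mul hL hL
    -- 2 M¹⁰ ≤ 2 ∑ (k-1) c_k ≤ L(L-1) c_K < M⁴ c_K, and M¹⁰ = M⁶ M⁴
    have h4 : 2 * M ^ 10 ≤ L * (L - 1) * c K := by
      calc 2 * M ^ 10 ≤ 2 * ((∑ k ∈ I, (k - 1)) * c K) := by omega
        _ = L * (L - 1) * c K := by rw [← mul_assoc, h2]
    by_contra hlt
    rw [not_le] at hlt
    have h5 : L * (L - 1) * c K ≤ L * (L - 1) * (2 * M ^ 6) := Nat.mul_le_mul_left _ hlt.le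
    have h6 : L * (L - 1) * (2 * M ^ 6) < 2 * (M ^ 6 * M ^ 4) := by
      have hpos : 0 < M ^ 6 := pow_pos hMpos 6
      nlinarith [h3, hpos]
    rw [hM10] at h4
    omega
  -- the odd columns and their hook blocks `ω_k = (v k + i k • v K, 3 M⁴)`
  set S := I.filter fun k => Odd (c k) with hS
  have hSI : S ⊆ I := Finset.filter_subset _ _
  choose! i hi using fun k (hk : k ∈ I) => h62 k hk K hKI
  set σ := ∑ k ∈ S, i k with hσ
  have hσeven : Even σ := Finset.even_sum _ fun k hk => (hi k (hSI hk)).1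
  have hScard : S.card ≤ L - 1 := (Finset.card_filter_le _ _).trans (by simp [hI])
  have hσle : σ + 2 * M ^ 4 ≤ 2 * M ^ 6 := by
    have h1 : σ ≤ S.card * (2 * M ^ 4) := by
      calc σ ≤ ∑ k ∈ S, 2 * M ^ 4 := Finset.sum_le_sum fun k hk => (hi k (hSI hk)).2.1
        _ = S.card * (2 * M ^ 4) := by rw [Finset.sum_const, smul_eq_mul]
    have h2 : S.card + 1 ≤ M ^ 2 := by omega
    calc σ + 2 * M ^ 4 ≤ S.card * (2 * M ^ 4) + 2 * M ^ 4 := by omega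
      _ = (S.card + 1) * (2 * M ^ 4) := by ring
      _ ≤ M ^ 2 * (2 * M ^ 4) := Nat.mul_le_mul_right _ h2
      _ = 2 * M ^ 6 := by rw [hM6]; ring
  have hσcK : σ + 1 ≤ c K := by
    have : 1 ≤ 2 * M ^ 4 := Nat.succ_le_of_lt (Nat.mul_pos two_pos (pow_pos hMpos 4))
    omega
  -- the even counts `d' k` of (6.1)
  set d' : ℕ → ℕ := fun k => c k - (if Odd (c k) then 1 else 0) - (if k = K then σ else 0)
    with hd'
  have hcd' : ∀ k ∈ I, c k = d' k + (if Odd (c k) then 1 else 0) + (if k = K then σ else 0) := by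
    intro k hk
    simp only [hd']
    by_cases hkK : k = K
    · subst hkK
      simp only [if_true]
      split_ifs with ho <;> omega
    · simp only [hkK, if_false]
      split_ifs with ho
      · have := ho.pos; omega
      · omega
  have hd'even : ∀ k ∈ I, Even (d' k) := by
    intro k hk
    have h1 : Even (c k - (if Odd (c k) then 1 else 0)) := by
      by_cases ho : Odd (c k)
      · rw [if_pos ho]
        exact Nat.Odd.sub_odd ho odd_one
      · rw [if_neg ho, Nat.sub_zero]
        exact Nat.not_odd_iff_even.mp ho
    have h2 : Even (if k = K then σ else 0) := by
      by_cases hkK : k = K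
      · rw [if_pos hkK]
        exact hσeven
      · rw [if_neg hkK]
        exact Even.zero
    simp only [hd']
    exact even_tsub_of_even h1 h2
  have hd'le : ∀ k, d' k ≤ c k := fun k => by
    simp only [hd']; omega
  -- division by the even part `E k = 2 ⌊n / 2k⌋` of `n / k`
  set E : ℕ → ℕ := fun k => 2 * (n / (2 * k)) with hE
  have hEk : ∀ k ∈ I, k * E k ≤ n ∧ n < k * E k + 2 * k ∧ 0 < E k ∧ Even (E k) := by
    intro k hk
    obtain ⟨hk2, hkL⟩ := hmemI hk
    have hdm := Nat.div_add_mod n (2 * k)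
    have hml := Nat.mod_lt n (show 0 < 2 * k by omega)
    have hkE : k * E k = 2 * k * (n / (2 * k)) := by simp only [hE]; ring
    refine ⟨by omega, by omega, ?_, ⟨n / (2 * k), by simp only [hE]; ring⟩⟩
    -- `n ≥ 2k` since `k ≤ L ≤ M² ≤ M⁶ ≤ n / 24`
    have h2k : 2 * k ≤ n := by
      have : M ^ 2 ≤ M ^ 6 := Nat.pow_le_pow_right hMpos (by norm_num)
      omega
    simp only [hE]
    exact Nat.mul_pos two_pos (Nat.div_pos h2k (by omega))
  set q : ℕ → ℕ := fun k => d' k / E k with hq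
  set r : ℕ → ℕ := fun k => d' k % E k with hr
  have hqr : ∀ k, E k * q k + r k = d' k := fun k => Nat.div_add_mod _ _
  have hreven : ∀ k ∈ I, Even (r k) := by
    intro k hk
    have h := hqr k
    have hle : E k * q k ≤ d' k := by omega
    have : r k = d' k - E k * q k := by omega
    rw [this, Nat.even_sub hle]
    exact ⟨fun _ => (hEk k hk).2.2.2.mul_right _, fun _ => hd'even k hk⟩
  have hrlt : ∀ k ∈ I, r k < E k := fun k hk => Nat.mod_lt _ (hEk k hk).2.2.1
  -- the total degree `D₀` of the blocks, and the Claim `D₀ ≤ d`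
  set D₀ := ∑ k ∈ I, (q k * k + (if r k = 0 then 0 else k)) + S.card * (3 * M ^ 4) with hD₀
  have hQ : 11 * M ^ 3 * ∑ k ∈ I, q k * k ≤ d := by
    -- `n (q_k k) ≤ (k E_k + 2k) q_k k ≤ k² c_k + 2 M² q_k k ≤ M² (k c_k) + 2 M² (q_k k)`
    have hterm : ∀ k ∈ I, n * (q k * k) ≤ M ^ 2 * (k * c k) + 2 * M ^ 2 * (q k * k) := by
      intro k hk
      obtain ⟨hk2, hkL⟩ := hmemI hk
      have hkM : k ≤ M ^ 2 := hkL.trans hL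
      have h1 : n * (q k * k) ≤ (k * E k + 2 * k) * (q k * k) :=
        Nat.mul_le_mul_right _ (hEk k hk).2.1.le
      have h2 : E k * q k ≤ c k := by have := hqr k; have := hd'le k; omega
      have h3 : (k * E k + 2 * k) * (q k * k) = k * k * (E k * q k) + 2 * k * (q k * k) := by
        ring
      have h4 : k * k * (E k * q k) ≤ M ^ 2 * (k * c k) := by
        calc k * k * (E k * q k) ≤ M ^ 2 * k * c k :=
            Nat.mul_le_mul (Nat.mul_le_mul_right _ hkM) h2
          _ = M ^ 2 * (k * c k) := by ring
      have h5 : 2 * k * (q k * k) ≤ 2 * M ^ 2 * (q k * k) :=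
        Nat.mul_le_mul_right _ (by omega)
      omega
    have hsum : n * ∑ k ∈ I, q k * k ≤
        M ^ 2 * ∑ k ∈ I, k * c k + 2 * M ^ 2 * ∑ k ∈ I, q k * k := by
      rw [Finset.mul_sum, Finset.mul_sum, Finset.mul_sum, ← Finset.sum_add_distrib]
      exact Finset.sum_le_sum hterm
    -- with `n ≥ 24 M⁶ = 22 M⁶ + 2 M⁶ ≥ 22 M⁶ + 2 M²` and `∑ k c_k ≤ 2 M d`
    set Q := ∑ k ∈ I, q k * k
    have h1 : M ^ 2 * ∑ k ∈ I, k * c k ≤ M ^ 2 * (2 * M * d) := Nat.mul_le_mul_left _ hb₂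
    have h2 : 24 * M ^ 6 * Q ≤ n * Q := Nat.mul_le_mul_right _ hn
    have h3 : 2 * M ^ 2 * Q ≤ 2 * M ^ 6 * Q :=
      Nat.mul_le_mul_right _ (Nat.mul_le_mul_left _ (Nat.pow_le_pow_right hMpos (by norm_num)))
    have h4 : 22 * M ^ 6 * Q ≤ M ^ 2 * (2 * M * d) := by
      have : 24 * M ^ 6 * Q = 22 * M ^ 6 * Q + 2 * M ^ 6 * Q := by ring
      omega
    have h5 : 22 * M ^ 6 * Q = 2 * M ^ 3 * (11 * M ^ 3 * Q) := by ring
    have h6 : M ^ 2 * (2 * M * d) = 2 * M ^ 3 * d := by ring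
    rw [h5, h6] at h4
    exact Nat.le_of_mul_le_mul_left h4 (by positivity)
  have hD₀d : D₀ ≤ d := by
    have h1 : ∑ k ∈ I, (q k * k + (if r k = 0 then 0 else k)) ≤
        ∑ k ∈ I, q k * k + ∑ k ∈ I, k := by
      rw [← Finset.sum_add_distrib]
      exact Finset.sum_le_sum fun k _ => by split_ifs <;> omega
    have h2 : ∑ k ∈ I, k + 1 ≤ M ^ 4 := by
      rcases Nat.eq_zero_or_pos L with hL0 | hLpos
      · rw [hI, hL0]; simp; exact Nat.one_le_pow _ _ hMpos
      · have h := two_mul_sum_Ioc L hLpos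
        have h' : L * (L + 1) ≤ M ^ 2 * (M ^ 2 + 1) := Nat.mul_le_mul hL (by omega)
        rw [hM4]
        nlinarith
    have h3 : S.card * (3 * M ^ 4) + 3 * M ^ 4 ≤ 3 * M ^ 6 := by
      calc S.card * (3 * M ^ 4) + 3 * M ^ 4 = (S.card + 1) * (3 * M ^ 4) := by ring
        _ ≤ M ^ 2 * (3 * M ^ 4) := Nat.mul_le_mul_right _ (by omega)
        _ = 3 * M ^ 6 := by rw [hM6]; ring
    have h4 : 88 * ∑ k ∈ I, q k * k ≤ d := by
      have : 8 ≤ M ^ 3 := by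
        calc 8 = 2 ^ 3 := by norm_num
          _ ≤ M ^ 3 := Nat.pow_le_pow_left hM 3
      calc 88 * ∑ k ∈ I, q k * k ≤ 11 * M ^ 3 * ∑ k ∈ I, q k * k := by
            rw [show 88 = 11 * 8 by rfl]
            exact Nat.mul_le_mul_right _ (Nat.mul_le_mul_left _ this)
        _ ≤ d := hQ
    simp only [hD₀]
    omega
  -- membership of the three groups of blocks
  have H1 : (∑ k ∈ I, d' k • v k, ∑ k ∈ I, (q k * k + (if r k = 0 then 0 else k))) ∈ T := by
    have : (∑ k ∈ I, d' k • v k, ∑ k ∈ I, (q k * k + (if r k = 0 then 0 else k))) =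
        ∑ k ∈ I, (d' k • v k, q k * k + (if r k = 0 then 0 else k)) :=
      Prod.ext (by rw [Prod.fst_sum]) (by rw [Prod.snd_sum])
    rw [this]
    refine T.sum_mem fun k hk => ?_
    have hsplit : (d' k • v k, q k * k + (if r k = 0 then 0 else k)) =
        q k • (E k • v k, k) + (r k • v k, if r k = 0 then 0 else k) := by
      refine Prod.ext ?_ ?_
      · simp only [Prod.fst_add, Prod.smul_fst]
        rw [← hqr k, add_nsmul, mul_comm, mul_nsmul']
      · simp only [Prod.snd_add, Prod.smul_snd, smul_eq_mul]
    rw [hsplit]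
    refine T.add_mem (T.nsmul_mem (h23 k hk (E k) (hEk k hk).2.2.1 (hEk k hk).2.2.2
      (hEk k hk).1) _) ?_
    by_cases hr0 : r k = 0
    · rw [hr0, zero_nsmul, if_pos rfl]
      exact T.zero_mem
    · rw [if_neg hr0]
      refine h23 k hk (r k) (Nat.pos_of_ne_zero hr0) (hreven k hk) ?_
      exact (Nat.mul_le_mul_left k (hrlt k hk).le).trans (hEk k hk).1
  have H2 : (∑ k ∈ S, (v k + i k • v K), S.card * (3 * M ^ 4)) ∈ T := by
    have : (∑ k ∈ S, (v k + i k • v K), S.card * (3 * M ^ 4)) =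
        ∑ k ∈ S, (v k + i k • v K, 3 * M ^ 4) :=
      Prod.ext (by rw [Prod.fst_sum]) (by rw [Prod.snd_sum, Finset.sum_const, smul_eq_mul])
    rw [this]
    exact T.sum_mem fun k hk => (hi k (hSI hk)).2.2
  have H3 : ((0 : A), d - D₀) ∈ T := by
    have := T.nsmul_mem h1 (d - D₀)
    rwa [Prod.smul_mk, nsmul_zero, smul_eq_mul, mul_one] at this
  -- (6.1): `∑ c_k • v_k = ∑ d'_k • v_k + ∑_{k ∈ S} (v_k + i_k • v_K)`
  have hbody : ∑ k ∈ I, c k • v k = ∑ k ∈ I, d' k • v k + ∑ k ∈ S, (v k + i k • v K) := by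
    calc ∑ k ∈ I, c k • v k
        = ∑ k ∈ I, (d' k • v k + (if Odd (c k) then 1 else 0) • v k +
            (if k = K then σ else 0) • v k) :=
          Finset.sum_congr rfl fun k hk => by
            rw [← add_nsmul, ← add_nsmul, ← hcd' k hk]
      _ = ∑ k ∈ I, d' k • v k + ∑ k ∈ I, (if Odd (c k) then 1 else 0) • v k +
            ∑ k ∈ I, (if k = K then σ else 0) • v k := by
          rw [Finset.sum_add_distrib, Finset.sum_add_distrib]
      _ = ∑ k ∈ I, d' k • v k + ∑ k ∈ S, v k + σ • v K := by
          congr 2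
          · rw [hS, Finset.sum_filter]
            exact Finset.sum_congr rfl fun k _ => by split_ifs <;> simp
          · simp only [ite_smul, zero_nsmul, Finset.sum_ite_eq', if_pos hKI]
      _ = ∑ k ∈ I, d' k • v k + ∑ k ∈ S, (v k + i k • v K) := by
          rw [add_assoc, Finset.sum_add_distrib, hσ, Finset.sum_smul]
  -- assemble
  have key : (∑ k ∈ I, c k • v k, d) =
      (∑ k ∈ I, d' k • v k, ∑ k ∈ I, (q k * k + (if r k = 0 then 0 else k))) +
        (∑ k ∈ S, (v k + i k • v K), S.card * (3 * M ^ 4)) + ((0 : A), d - D₀) := by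
    refine Prod.ext ?_ ?_
    · simp only [Prod.fst_add, add_zero]
      exact hbody
    · simp only [Prod.snd_add]
      simp only [hD₀] at hD₀d ⊢
      omega
  rw [key]
  exact T.add_mem (T.add_mem H1 H2) H3

end Literature.Computability.Complexity

/-! ### 4d. The building blocks, the monoid of occurring weights, and Prop. 6.3 -/

namespace Literature.Computability.Complexity

open Finset

/-! ### The building blocks as partitions -/

section Blocks

/-- The rows of the row-extended rectangle `(k × ℓ)♯D` (BIP §2(a): "`λ♯D` for the partition
of the 'lifted shape' `λ + (D - |λ|)`, that arises from `λ` by extending the first row so that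
`λ♯D` has `D` boxes"; `k × ℓ` the rectangle with `k` rows of length `ℓ`): first row
`D - (k-1)ℓ`, then `k - 1` rows of length `ℓ`. [cite: BurgisserIkenmeyerPanovaJAMS2019, §2(a)] -/
def rowExtRectRows (k ℓ D : ℕ) : ℕ → ℕ :=
  fun r => if r = 0 then D - (k - 1) * ℓ else if r < k then ℓ else 0

/-- The row-extended rectangle `(k × ℓ)♯D ⊢ D` of BIP Prop. 2.3 (meaningful for `k ℓ ≤ D`; for
`k ℓ > D` the value is junk). [cite: BurgisserIkenmeyerPanovaJAMS2019, §2(a), Prop. 2.3] -/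
def rowExtendedRectangle (k ℓ D : ℕ) : Nat.Partition D :=
  partitionOfRows (rowExtRectRows k ℓ D) k D

/-- The rows of the shape `b × 1 + c × i + 1 × j` with `D` boxes (`j = D - b - ic`) of BIP
Thm. 6.2 (row-wise sum of a column of length `b`, of `c` rows of length `i` and of one row of
length `j`): first row `1 + i + j = D - (b-1) - (c-1)i`, and row `r ≥ 1` of length
`[r < b] + i·[r < c]`. [cite: BurgisserIkenmeyerPanovaJAMS2019, Thm. 6.2] -/
def hookRows (b c i D : ℕ) : ℕ → ℕ :=
  fun r => if r = 0 then D - (b - 1) - (c - 1) * i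
    else (if r < b then 1 else 0) + (if r < c then i else 0)

/-- The partition `b × 1 + c × i + 1 × j ⊢ D`, `j = D - b - ic`, of BIP Thm. 6.2 (meaningful
for `1 ≤ b`, `1 ≤ c`, `b + c i ≤ D`; junk otherwise). [cite: BurgisserIkenmeyerPanovaJAMS2019, Thm. 6.2] -/
def hookPartition (b c i D : ℕ) : Nat.Partition D :=
  partitionOfRows (hookRows b c i D) (max b c) D

variable {k ℓ D : ℕ}

/-- Row sum of `(k × ℓ)♯D`. [cite: BurgisserIkenmeyerPanovaJAMS2019, §2(a)] -/
theorem sum_range_rowExtRectRows (hk : 0 < k) (h : k * ℓ ≤ D) :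
    ∑ r ∈ range k, rowExtRectRows k ℓ D r = D := by
  obtain ⟨k', rfl⟩ : ∃ k', k = k' + 1 := ⟨k - 1, by omega⟩
  rw [Finset.range_eq_Ico, Finset.sum_eq_sum_Ico_succ_bot hk, zero_add]
  have h1 : ∑ r ∈ Ico 1 (k' + 1), rowExtRectRows (k' + 1) ℓ D r = ∑ r ∈ Ico 1 (k' + 1), ℓ :=
    Finset.sum_congr rfl fun r hr => by
      rw [mem_Ico] at hr
      simp only [rowExtRectRows]
      rw [if_neg (by omega), if_pos hr.2]
  rw [h1, sum_const, Nat.card_Ico, smul_eq_mul, Nat.add_sub_cancel]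
  simp only [rowExtRectRows, if_true, Nat.add_sub_cancel]
  have : k' * ℓ ≤ D := le_trans (Nat.mul_le_mul_right ℓ (Nat.le_succ k')) h
  omega

/-- The rows of `(k × ℓ)♯D` are weakly decreasing when `k ℓ ≤ D`. [cite: BurgisserIkenmeyerPanovaJAMS2019, §2(a)] -/
theorem antitone_rowExtRectRows (h : k * ℓ ≤ D) : Antitone (rowExtRectRows k ℓ D) := by
  intro a b hab
  simp only [rowExtRectRows]
  rcases Nat.eq_zero_or_pos k with rfl | hk
  · split_ifs <;> omega
  · obtain ⟨k', rfl⟩ : ∃ k', k = k' + 1 := ⟨k - 1, by omega⟩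
    have h' : k' * ℓ + ℓ ≤ D := by rw [← Nat.succ_mul]; exact h
    simp only [Nat.add_sub_cancel]
    split_ifs <;> omega

/-- Row sum of `b × 1 + c × i + 1 × j`. [cite: BurgisserIkenmeyerPanovaJAMS2019, Thm. 6.2] -/
theorem sum_range_hookRows {b c i D : ℕ} (hb : 0 < b) (hc : 0 < c) (h : b + c * i ≤ D) :
    ∑ r ∈ range (max b c), hookRows b c i D r = D := by
  have hmax : 0 < max b c := lt_max_of_lt_left hb
  rw [Finset.range_eq_Ico, Finset.sum_eq_sum_Ico_succ_bot hmax, zero_add]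
  have h1 : ∑ r ∈ Ico 1 (max b c), hookRows b c i D r =
      ∑ r ∈ Ico 1 (max b c), ((if r < b then 1 else 0) + (if r < c then i else 0)) :=
    Finset.sum_congr rfl fun r hr => by
      rw [mem_Ico] at hr
      simp only [hookRows]
      rw [if_neg (by omega)]
  have h2 : ∑ r ∈ Ico 1 (max b c), (if r < b then 1 else 0) = b - 1 := by
    rw [← Finset.sum_filter]
    have : (Ico 1 (max b c)).filter (fun r => r < b) = Ico 1 b := by
      ext r; simp only [mem_filter, mem_Ico]; omega
    rw [this, sum_const, Nat.card_Ico, smul_eq_mul, mul_one]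
  have h3 : ∑ r ∈ Ico 1 (max b c), (if r < c then i else 0) = (c - 1) * i := by
    rw [← Finset.sum_filter]
    have : (Ico 1 (max b c)).filter (fun r => r < c) = Ico 1 c := by
      ext r; simp only [mem_filter, mem_Ico]; omega
    rw [this, sum_const, Nat.card_Ico, smul_eq_mul]
  rw [h1, Finset.sum_add_distrib, h2, h3]
  simp only [hookRows, if_true]
  obtain ⟨b', rfl⟩ : ∃ b', b = b' + 1 := ⟨b - 1, by omega⟩
  obtain ⟨c', rfl⟩ : ∃ c', c = c' + 1 := ⟨c - 1, by omega⟩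
  simp only [Nat.add_sub_cancel]
  have h' : b' + 1 + (c' * i + i) ≤ D := by rw [← Nat.succ_mul]; exact h
  omega

/-- The rows of `b × 1 + c × i + 1 × j` are weakly decreasing when `b + c i ≤ D`. [cite: BurgisserIkenmeyerPanovaJAMS2019, Thm. 6.2] -/
theorem antitone_hookRows {b c i D : ℕ} (hb : 0 < b) (hc : 0 < c) (h : b + c * i ≤ D) :
    Antitone (hookRows b c i D) := by
  obtain ⟨b', rfl⟩ : ∃ b', b = b' + 1 := ⟨b - 1, by omega⟩
  obtain ⟨c', rfl⟩ : ∃ c', c = c' + 1 := ⟨c - 1, by omega⟩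
  have h' : b' + 1 + (c' * i + i) ≤ D := by rw [← Nat.succ_mul]; exact h
  intro x y hxy
  simp only [hookRows, Nat.add_sub_cancel]
  split_ifs <;> omega

/-- Rows of `(k × ℓ)♯D` beyond the `k`-th vanish. [cite: BurgisserIkenmeyerPanovaJAMS2019, §2(a)] -/
theorem rowExtRectRows_eq_zero (hk : 0 < k) {r : ℕ} (hr : k ≤ r) : rowExtRectRows k ℓ D r = 0 := by
  simp only [rowExtRectRows]
  rw [if_neg (by omega), if_neg (by omega)]

/-- Rows of `b × 1 + c × i + 1 × j` beyond the `max b c`-th vanish. [cite: BurgisserIkenmeyerPanovaJAMS2019, Thm. 6.2] -/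
theorem hookRows_eq_zero {b c i D : ℕ} (hb : 0 < b) {r : ℕ} (hr : max b c ≤ r) :
    hookRows b c i D r = 0 := by
  simp only [hookRows]
  rw [if_neg (by omega), if_neg (by omega), if_neg (by omega)]

/-- **The weight of `(k × ℓ)♯(k m)` is the `♯`-lift of the body `ℓ · colBody k` in degree `k`**:
`ofPartition N ((k × ℓ)♯(km)) = sharpAddHom m N (ℓ • colBody N k, k)` for `1 ≤ k ≤ N`,
`ℓ ≤ m`. [cite: BurgisserIkenmeyerPanovaJAMS2019, §2(a), Prop. 2.3] -/
theorem ofPartition_rowExtendedRectangle {m N : ℕ} (hk : 0 < k) (hℓ : ℓ ≤ m) (hkN : k ≤ N) :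
    Literature.NumberTheory.DiophantineGeometry.Weight.ofPartition N (rowExtendedRectangle k ℓ (k * m)) =
      sharpAddHom m N (ℓ • colBody N k, k) := by
  have h : k * ℓ ≤ k * m := Nat.mul_le_mul_left k hℓ
  rw [rowExtendedRectangle, ofPartition_partitionOfRows (antitone_rowExtRectRows h)
    (sum_range_rowExtRectRows hk h)]
  funext r
  rw [sharpAddHom_apply]
  simp only [Pi.smul_apply]
  rw [← Finset.smul_sum, sum_colBody hkN, colBody_apply]
  obtain ⟨k', rfl⟩ : ∃ k', k = k' + 1 := ⟨k - 1, by omega⟩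
  have h' : k' * ℓ ≤ (k' + 1) * m := by
    rw [Nat.succ_mul]; exact le_trans (Nat.mul_le_mul_left k' hℓ) (Nat.le_add_right _ _)
  simp only [rowExtRectRows, Nat.add_sub_cancel, nsmul_eq_mul]
  by_cases hr : (r : ℕ) = 0
  · rw [if_pos (show (r : ℕ) < k' + 1 by omega), if_pos hr, if_neg (by omega), if_pos hr]
    push_cast [h']
    ring
  · rw [if_neg hr]
    by_cases hrk : (r : ℕ) < k' + 1
    · rw [if_pos hrk, if_neg hr, if_pos hrk, if_pos ⟨Nat.pos_of_ne_zero hr, hrk⟩]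
      ring
    · rw [if_neg hrk, if_neg (fun h => hrk h.2), if_neg hr]
      push_cast
      ring

/-- **The weight of `b × 1 + c × i + 1 × j ⊢ 3M⁴·m` is the `♯`-lift of the body
`colBody b + i · colBody c` in degree `3M⁴`** (`1 ≤ b, c ≤ N`, `b + ci ≤ 3 M⁴ m`).
[cite: BurgisserIkenmeyerPanovaJAMS2019, Thm. 6.2] -/
theorem ofPartition_hookPartition {m M N b c i : ℕ} (hb : 0 < b) (hc : 0 < c) (hbN : b ≤ N)
    (hcN : c ≤ N) (h : b + c * i ≤ 3 * M ^ 4 * m) :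
    Literature.NumberTheory.DiophantineGeometry.Weight.ofPartition N (hookPartition b c i (3 * M ^ 4 * m)) =
      sharpAddHom m N (colBody N b + i • colBody N c, 3 * M ^ 4) := by
  rw [hookPartition, ofPartition_partitionOfRows (antitone_hookRows hb hc h)
    (sum_range_hookRows hb hc h)]
  funext r
  rw [sharpAddHom_apply]
  simp only [Pi.add_apply, Pi.smul_apply, Finset.sum_add_distrib]
  rw [← Finset.smul_sum, sum_colBody hbN, sum_colBody hcN, colBody_apply, colBody_apply]
  obtain ⟨b', rfl⟩ : ∃ b', b = b' + 1 := ⟨b - 1, by omega⟩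
  obtain ⟨c', rfl⟩ : ∃ c', c = c' + 1 := ⟨c - 1, by omega⟩
  have h' : b' + 1 + (c' * i + i) ≤ 3 * M ^ 4 * m := by rw [← Nat.succ_mul]; exact h
  simp only [hookRows, Nat.add_sub_cancel, nsmul_eq_mul]
  by_cases hr : (r : ℕ) = 0
  · have hpos : (r : ℕ) < max (b' + 1) (c' + 1) := by rw [hr]; exact lt_max_of_lt_left hb
    rw [if_pos hpos, if_pos hr, if_neg (by omega), if_neg (by omega), if_pos hr]
    have h'' : c' * i ≤ 3 * M ^ 4 * m - b' := by omega
    push_cast [h'', show b' ≤ 3 * M ^ 4 * m by omega]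
    ring
  · rw [if_neg hr]
    have h1 : (1 : ℕ) ≤ r := Nat.pos_of_ne_zero hr
    by_cases hrm : (r : ℕ) < max (b' + 1) (c' + 1)
    · rw [if_pos hrm, if_neg hr]
      simp only [h1, true_and]
      push_cast
      split_ifs <;> ring
    · rw [if_neg hrm, if_neg (fun h => hrm (lt_max_of_lt_left h.2)),
        if_neg (fun h => hrm (lt_max_of_lt_right h.2)), if_neg hr]
      push_cast
      ring

end Blocks

/-! ### The building blocks occur: BIP Prop. 2.3 and Thm. 6.2 as named facts -/

/-- **BIP Prop. 2.3 (row-extended even rectangles occur), verbatim.** "We write `λ♯D` for the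
partition of the 'lifted shape' `λ + (D − |λ|)`, that arises from `λ` by extending the first
row so that `λ♯D` has `D` boxes. 2.3. Proposition. Let `n ≥ kℓ` and `ℓ` be even. Then
`(k × ℓ)♯nk` occurs in `ℂ[Ω_n]_k`." (Proved in §6(b) from the tableau of shape `k × ℓ` of
Cor. 4.8, lifting Thm. 5.4 and Thm. 2.5.) Letters: determinant `m` (BIP's `n`), so the
partition is `rowExtendedRectangle k ℓ (k * m) = (km − (k−1)ℓ, ℓ^{k−1}) ⊢ km`; weight form as
throughout this file. The degenerate cases `k = 0`, `ℓ = 0` of the print (empty rectangle) are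
omitted. [cite: BurgisserIkenmeyerPanovaJAMS2019, Prop. 2.3] -/
def bip2019_prop_2_3 : Prop :=
  ∀ (m k ℓ : ℕ) [NeZero m] (_hk : 0 < k) (_hℓ : 0 < ℓ) (_he : Even ℓ) (_hkℓ : k * ℓ ≤ m),
    Literature.NumberTheory.DiophantineGeometry.HasHighestWeight (Literature.NumberTheory.DiophantineGeometry.detOrbitRep ℂ m)
      (partitionWeightLex m (rowExtendedRectangle k ℓ (k * m)))

/-- **BIP Thm. 6.2 (the hook-like building blocks occur), verbatim.** "Let `2 ≤ b, c ≤ m²` and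
let `n ≥ 24m⁶`. Then there exists an even `i ≤ 2m⁴`, such that `λ = b×1 + c×i + 1×j` occurs in
`ℂ[Ω_n]_{3m⁴}` for `j = 3m⁴n − b − ic`." (Proved in §7 by an explicit tableau construction,
Prop. 7.3.) Letters: determinant `m` (BIP's `n`), parameter `M` (BIP's `m`); the partition is
`hookPartition b c i (3 M⁴ m) ⊢ 3M⁴·m`; weight form as throughout this file.
[cite: BurgisserIkenmeyerPanovaJAMS2019, Thm. 6.2] -/
def bip2019_thm_6_2 : Prop :=
  ∀ (m M b c : ℕ) [NeZero m] (_hb : 2 ≤ b) (_hbM : b ≤ M ^ 2) (_hc : 2 ≤ c) (_hcM : c ≤ M ^ 2)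
    (_hm : 24 * M ^ 6 ≤ m),
    ∃ i, Even i ∧ i ≤ 2 * M ^ 4 ∧
      Literature.NumberTheory.DiophantineGeometry.HasHighestWeight (Literature.NumberTheory.DiophantineGeometry.detOrbitRep ℂ m)
        (partitionWeightLex m (hookPartition b c i (3 * M ^ 4 * m)))

/-! ### The monoid of occurring weights and the row `(m)` -/

/-- **The occurring weights of `ℂ[Ω_m]` form an additive monoid** (BIP Lemma 2.2, and the
trivial weight occurs), recorded in the `Fin (m²)`-coordinates of partitions, i.e. before
dualisation and transport to the matrix variables: the set of `χ : Fin (m²) → ℤ` such that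
`χ^*` (transported) occurs in `ℂ[Ω_m]`; for `χ = ofPartition (m²) λ` this is "`λ` occurs in
`ℂ[Ω_m]`" (`ofPartition_mem_detOccWeights_iff`). [cite: BurgisserIkenmeyerPanovaJAMS2019, Lemma 2.2] -/
def detOccWeights (m : ℕ) : AddSubmonoid (Literature.NumberTheory.DiophantineGeometry.Weight (Fin (m * m))) where
  carrier := {χ | Literature.NumberTheory.DiophantineGeometry.HasHighestWeight (Literature.NumberTheory.DiophantineGeometry.detOrbitRep ℂ m)
    (Literature.NumberTheory.DiophantineGeometry.Weight.dual χ).toMatIdx}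
  add_mem' {χ ψ} hχ hψ := by
    have h : (Literature.NumberTheory.DiophantineGeometry.Weight.dual (χ + ψ)).toMatIdx =
        (Literature.NumberTheory.DiophantineGeometry.Weight.dual χ).toMatIdx + (Literature.NumberTheory.DiophantineGeometry.Weight.dual ψ).toMatIdx := by
      funext ij
      simp [Literature.NumberTheory.DiophantineGeometry.Weight.toMatIdx, Literature.NumberTheory.DiophantineGeometry.Weight.dual, add_comm]
    simp only [Set.mem_setOf_eq] at hχ hψ ⊢
    rw [h]
    exact Literature.NumberTheory.DiophantineGeometry.HasHighestWeight.add_of_orbitCoordRep _ m hχ hψ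
  zero_mem' := by
    have h : (Literature.NumberTheory.DiophantineGeometry.Weight.dual (0 : Literature.NumberTheory.DiophantineGeometry.Weight (Fin (m * m)))).toMatIdx = 0 := by
      funext ij
      simp [Literature.NumberTheory.DiophantineGeometry.Weight.toMatIdx, Literature.NumberTheory.DiophantineGeometry.Weight.dual]
    simp only [Set.mem_setOf_eq]
    rw [h]
    exact Complexity.hasHighestWeight_orbitCoordRep_zero _ m

/-- Membership in `detOccWeights`, unfolded. [cite: BurgisserIkenmeyerPanovaJAMS2019, Lemma 2.2] -/
theorem mem_detOccWeights_iff (m : ℕ) (χ : Literature.NumberTheory.DiophantineGeometry.Weight (Fin (m * m))) :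
    χ ∈ detOccWeights m ↔
      Literature.NumberTheory.DiophantineGeometry.HasHighestWeight (Literature.NumberTheory.DiophantineGeometry.detOrbitRep ℂ m) (Literature.NumberTheory.DiophantineGeometry.Weight.dual χ).toMatIdx :=
  Iff.rfl

/-- For the weight of a partition, membership in `detOccWeights m` is occurrence in `ℂ[Ω_m]`
in the sense of this file (`partitionWeightLex`). [cite: BurgisserIkenmeyerPanovaJAMS2019, §3(b)] -/
theorem ofPartition_mem_detOccWeights_iff (m : ℕ) {D : ℕ} (lam : Nat.Partition D) :
    Literature.NumberTheory.DiophantineGeometry.Weight.ofPartition (m * m) lam ∈ detOccWeights m ↔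
      Literature.NumberTheory.DiophantineGeometry.HasHighestWeight (Literature.NumberTheory.DiophantineGeometry.detOrbitRep ℂ m) (partitionWeightLex m lam) :=
  Iff.rfl

/-- **`(m)` occurs in `ℂ[Ω_m]_1`** (BIP §6(a)), in `♯`-coordinates: the weight
`sharpAddHom m (m²) (0, 1) = (m, 0, …, 0)` lies in `detOccWeights m`; from
`CplxAlg.hasHighestWeight_detOrbitRep_single_top` (its dual is `-m ε_top`).
[cite: BurgisserIkenmeyerPanovaJAMS2019, §6(a)] -/
theorem sharpAddHom_zero_one_mem_detOccWeights (m : ℕ) [NeZero m] :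
    sharpAddHom m (m * m) (0, 1) ∈ detOccWeights m := by
  have hN : 0 < m * m := Nat.mul_pos (NeZero.pos m) (NeZero.pos m)
  set i₀ : Fin (m * m) := ⟨0, hN⟩ with hi₀
  set iₘ : Literature.NumberTheory.DiophantineGeometry.MatIdx m := Literature.NumberTheory.DiophantineGeometry.matIdxEquiv m (Fin.rev i₀) with hiₘ
  have htop : ∀ i, i ≤ iₘ := fun i => by
    rw [hiₘ, ← (Literature.NumberTheory.DiophantineGeometry.matIdxEquiv m).apply_symm_apply i, (Literature.NumberTheory.DiophantineGeometry.matIdxEquiv m).le_iff_le,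
      Fin.le_rev_iff]
    exact Fin.mk_le_mk.mpr (Nat.zero_le _)
  rw [mem_detOccWeights_iff]
  have h : (Literature.NumberTheory.DiophantineGeometry.Weight.dual (sharpAddHom m (m * m) (0, 1))).toMatIdx =
      Pi.single iₘ (-(m : ℤ)) := by
    funext ij
    simp only [Literature.NumberTheory.DiophantineGeometry.Weight.toMatIdx, Literature.NumberTheory.DiophantineGeometry.Weight.dual, sharpAddHom_apply,
      Pi.zero_apply, Finset.sum_const_zero, sub_zero, zero_add, Nat.cast_one, one_mul]
    have hiff : ((Fin.rev ((Literature.NumberTheory.DiophantineGeometry.matIdxEquiv m).symm ij) : Fin (m * m)) : ℕ) = 0 ↔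
        ij = iₘ := by
      constructor
      · intro h0
        have h1 : Fin.rev ((Literature.NumberTheory.DiophantineGeometry.matIdxEquiv m).symm ij) = i₀ := Fin.ext h0
        rw [hiₘ, ← h1, Fin.rev_rev, OrderIso.apply_symm_apply]
      · intro hij
        rw [hij, hiₘ, OrderIso.symm_apply_apply, Fin.rev_rev]
    by_cases hij : ij = iₘ
    · rw [if_pos (hiff.mpr hij), hij, Pi.single_eq_same]
    · rw [if_neg (fun h => hij (hiff.mp h)), Pi.single_eq_of_ne hij, neg_zero]
  rw [h]
  exact Complexity.hasHighestWeight_detOrbitRep_single_top m iₘ htop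

/-! ### BIP Prop. 6.3 from Prop. 2.3, Thm. 6.2 and the (proved) semigroup property -/

/-- **BIP Prop. 6.3, proved from its printed ingredients**: the splitting technique
(`mem_of_splitting`, the printed proof) applied to the monoid `detOccWeights m` of occurring
weights (closed under addition by the PROVED Lemma 2.2, `bip2019_lemma_2_2_holds`), the PROVED
occurrence of `(m)` (§6(a), `sharpAddHom_zero_one_mem_detOccWeights`), and the two families of
building blocks Prop. 2.3 (`bip2019_prop_2_3`) and Thm. 6.2 (`bip2019_thm_6_2`), which remain
named facts (explicit tableau constructions, §6(b), §7). [cite: BurgisserIkenmeyerPanovaJAMS2019, Prop. 6.3] -/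
theorem bip2019_prop_6_3_of_parts (h23 : bip2019_prop_2_3) (h62 : bip2019_thm_6_2) :
    bip2019_prop_6_3 := by
  intro m d M _ hM lam hℓ hb₁ hb₂ hm hd
  classical
  -- numerics
  have hMpos : 0 < M := by omega
  have hM2m : M ^ 2 ≤ m := by
    calc M ^ 2 ≤ M ^ 6 := Nat.pow_le_pow_right hMpos (by norm_num)
      _ ≤ 24 * M ^ 6 := Nat.le_mul_of_pos_left _ (by norm_num)
      _ ≤ m := hm
  have hmN : m ≤ m * m := Nat.le_mul_self m
  set N := m * m with hN
  -- rows `W r = λ_{r+1}`, number of rows `L`, column counts `c k`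
  set W : ℕ → ℕ := fun r => lam.sortedParts.getD r 0 with hW
  set L := lam.parts.card with hL
  have hWanti : Antitone W := antitone_getD_sortedParts lam
  have hWL : ∀ r, L ≤ r → W r = 0 := fun r hr =>
    List.getD_eq_default _ _ (by rwa [Nat.Partition.length_sortedParts])
  have hsumW : ∑ r ∈ range L, W r = d * m := sum_range_getD_sortedParts lam
  have hsup : lam.parts.sup = W 0 := sup_parts_eq_getD_sortedParts lam
  have hLM : L ≤ M ^ 2 := hℓ
  have hLN : L ≤ N := hLM.trans (hM2m.trans hmN)
  -- `L ≥ 1` (else `|λ̄| = 0`)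
  have hL1 : 1 ≤ L := by
    by_contra h0
    have hb0 : bodySize lam = 0 := bodySize_eq_zero_of_card_le_one lam (by omega)
    rw [hb0] at hb₁
    exact absurd hb₁ (not_le.mpr (pow_pos hMpos 10))
  -- `|λ̄| = ∑_{1 ≤ r < L} W r`
  have hbody : bodySize lam = ∑ r ∈ Ico 1 L, W r := by
    unfold bodySize
    rw [hsup, ← hsumW, Finset.range_eq_Ico, Finset.sum_eq_sum_Ico_succ_bot hL1, zero_add,
      Nat.add_sub_cancel_left]
  set c : ℕ → ℕ := fun k => W (k - 1) - W k with hc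
  have hkc : ∑ k ∈ Ioc 1 L, k * c k = W 1 + bodySize lam := by
    have h := sum_Ioc_mul_sub_eq hWanti hL1
    rw [hWL L le_rfl, Nat.mul_zero, Nat.add_zero] at h
    rw [hbody]
    exact h
  have hc₁ : ∑ k ∈ Ioc 1 L, (k - 1) * c k = bodySize lam := by
    have h1 : ∑ k ∈ Ioc 1 L, (k - 1) * c k + ∑ k ∈ Ioc 1 L, c k = ∑ k ∈ Ioc 1 L, k * c k := by
      rw [← Finset.sum_add_distrib]
      refine Finset.sum_congr rfl fun k hk => ?_
      rw [mem_Ioc] at hk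
      obtain ⟨k', rfl⟩ := Nat.exists_eq_add_of_le' (show 1 ≤ k by omega)
      rw [Nat.add_sub_cancel]
      ring
    have h2 : ∑ k ∈ Ioc 1 L, c k = W 1 := by
      have h := sum_Ioc_sub_eq hWanti hL1
      rw [hWL L le_rfl, Nat.sub_zero] at h
      exact h
    omega
  have hW1 : W 1 ≤ bodySize lam := by
    rw [hbody]
    by_cases h2 : 2 ≤ L
    · exact Finset.single_le_sum (f := W) (fun _ _ => Nat.zero_le _) (by rw [mem_Ico]; omega)
    · rw [hWL 1 (by omega)]
      exact Nat.zero_le _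
  have hc₂ : ∑ k ∈ Ioc 1 L, k * c k ≤ 2 * M * d := by
    rw [hkc]
    calc W 1 + bodySize lam ≤ bodySize lam + bodySize lam := by omega
      _ ≤ M * d + M * d := Nat.add_le_add hb₂ hb₂
      _ = 2 * M * d := by ring
  -- the weight of `λ` is the `♯`-lift of its body `∑ c_k • colBody k` in degree `d`
  have hof : Literature.NumberTheory.DiophantineGeometry.Weight.ofPartition N lam =
      sharpAddHom m N (∑ k ∈ Ioc 1 L, c k • colBody N k, d) := by
    rw [← body_eq_sum_colBody hWanti hWL]
    have hsumN : ∑ r ∈ range N, (W r : ℤ) = d * m := by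
      rw [← Finset.sum_subset (Finset.range_subset_range.mpr hLN) fun r _ hr => by
        rw [hWL r (by simpa using hr), Nat.cast_zero]]
      exact_mod_cast hsumW
    have hNpos : 0 < N := by rw [hN]; exact Nat.mul_pos (NeZero.pos m) (NeZero.pos m)
    have hsumβ : ∑ i : Fin N, (if ((i : Fin N) : ℕ) = 0 then (0 : ℤ) else (W i : ℤ)) =
        d * m - W 0 := by
      rw [Fin.sum_univ_eq_sum_range (fun n => if n = 0 then (0 : ℤ) else (W n : ℤ)) N,
        Finset.range_eq_Ico, Finset.sum_eq_sum_Ico_succ_bot hNpos, if_pos rfl, zero_add]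
      rw [Finset.range_eq_Ico, Finset.sum_eq_sum_Ico_succ_bot hNpos] at hsumN
      rw [Finset.sum_congr rfl fun r hr => if_neg (by rw [mem_Ico] at hr; omega)]
      linarith
    funext r
    rw [sharpAddHom_apply, Literature.NumberTheory.DiophantineGeometry.Weight.ofPartition_apply, hsumβ]
    by_cases hr : (r : ℕ) = 0
    · simp only [hr, if_true, hW]
      ring
    · simp only [hr, if_false, add_zero]
      rfl
  -- run the splitting technique in the monoid of occurring weights
  rw [← ofPartition_mem_detOccWeights_iff, hof]
  have key := mem_of_splitting ((detOccWeights m).comap (sharpAddHom m N)) (colBody N) c hM hLM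
    hm hd (hc₁ ▸ hb₁) hc₂ ?_ ?_ ?_
  · exact AddSubmonoid.mem_comap.mp key
  · -- `(m)` occurs
    exact AddSubmonoid.mem_comap.mpr (sharpAddHom_zero_one_mem_detOccWeights m)
  · -- Prop. 2.3
    intro k hk ℓ hℓ0 hℓe hkℓ
    rw [mem_Ioc] at hk
    have hk0 : 0 < k := by omega
    have hℓm : ℓ ≤ m := le_trans (Nat.le_mul_of_pos_left ℓ hk0) hkℓ
    rw [AddSubmonoid.mem_comap, ← ofPartition_rowExtendedRectangle hk0 hℓm (by omega),
      ofPartition_mem_detOccWeights_iff]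
    exact h23 m k ℓ hk0 hℓ0 hℓe hkℓ
  · -- Thm. 6.2
    intro b hb c' hc'
    rw [mem_Ioc] at hb hc'
    obtain ⟨i, hie, hile, hocc⟩ := h62 m M b c' (by omega) (by omega) (by omega) (by omega) hm
    refine ⟨i, hie, hile, ?_⟩
    have hbci : b + c' * i ≤ 3 * M ^ 4 * m := by
      have h1 : b ≤ M ^ 4 * m := by
        calc b ≤ M ^ 2 := by omega
          _ ≤ M ^ 4 := Nat.pow_le_pow_right hMpos (by norm_num)
          _ ≤ M ^ 4 * m := Nat.le_mul_of_pos_right _ (NeZero.pos m)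
      have h2 : c' * i ≤ 2 * (M ^ 4 * m) := by
        calc c' * i ≤ M ^ 2 * (2 * M ^ 4) := Nat.mul_le_mul (by omega) hile
          _ = 2 * (M ^ 4 * M ^ 2) := by ring
          _ ≤ 2 * (M ^ 4 * m) := Nat.mul_le_mul_left 2 (Nat.mul_le_mul_left _ hM2m)
      rw [mul_assoc]
      omega
    rw [AddSubmonoid.mem_comap, ← ofPartition_hookPartition (M := M) (by omega) (by omega)
      (by omega) (by omega) hbci, ofPartition_mem_detOccWeights_iff]
    exact hocc

end Literature.Computability.Complexity

/-! ## 5. BIP Thm. 2.1 = Thm. 4.9 for the padded permanents, and the Kadish–Landsberg padding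
constraint: discharges of `bip2019_thm_2_1`, `exists_partition_of_hasHighestWeight_paddedPerOrbitRep`
and `kadish_landsberg_padding` from the general theorems of `OrbitClosureWeights.lean` -/

namespace Literature.Computability.Complexity

section PaddedVars

variable {k : Type*} [Field k]

/-- Every matrix index is at most the last one in the lexicographic enumeration
`matIdxEquiv m`. [folklore] -/
theorem le_matIdxEquiv_last (m : ℕ) (hmm : m * m ≠ 0) (i : Literature.NumberTheory.DiophantineGeometry.MatIdx m) :
    i ≤ Literature.NumberTheory.DiophantineGeometry.matIdxEquiv m ⟨m * m - 1, Nat.sub_one_lt hmm⟩ := by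
  rw [← (Literature.NumberTheory.DiophantineGeometry.matIdxEquiv m).apply_symm_apply i, (Literature.NumberTheory.DiophantineGeometry.matIdxEquiv m).le_iff_le, Fin.le_def]
  have := ((Literature.NumberTheory.DiophantineGeometry.matIdxEquiv m).symm i).2
  simp only
  omega

/-- BIP's padded permanent in the lexicographic matrix variables is the padded form
`X_{(0,0)}^{m-n} · p` with `p` the (renamed) permanent of the top-left block.
[cite: BurgisserIkenmeyerPanovaJAMS2019, §1(a) (1.2)] -/
theorem bipPaddedPerFormLex_eq (n m : ℕ) [NeZero m] :
    bipPaddedPerFormLex k n m = X (toLex ((0 : Fin m), (0 : Fin m))) ^ (m - n) *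
      rename (fun ij : TopBlockIdx n m × TopBlockIdx n m =>
        (toLex ((ij.1 : Fin m), (ij.2 : Fin m)) : Literature.NumberTheory.DiophantineGeometry.MatIdx m)) (AlgebraicComplexity.perPoly (TopBlockIdx n m) k) := by
  rw [bipPaddedPerFormLex, bipPaddedPerPoly, map_mul, map_pow, rename_X, rename_rename]
  rfl

/-- G20's padded permanent in the lexicographic matrix variables is the padded form
`X_{(0,0)}^{m-n} · p` with `p` the (renamed) permanent of the bottom-right block.
[cite: MulmuleySohoniSIAM2001, §4] -/
theorem paddedPerFormLex_eq (n m : ℕ) [NeZero m] :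
    Literature.NumberTheory.DiophantineGeometry.paddedPerFormLex k n m = X (toLex ((0 : Fin m), (0 : Fin m))) ^ (m - n) *
      rename (fun ij : AlgebraicComplexity.BlockIdx n m × AlgebraicComplexity.BlockIdx n m =>
        (toLex ((ij.1 : Fin m), (ij.2 : Fin m)) : Literature.NumberTheory.DiophantineGeometry.MatIdx m)) (AlgebraicComplexity.perPoly (AlgebraicComplexity.BlockIdx n m) k) := by
  rw [Literature.NumberTheory.DiophantineGeometry.paddedPerFormLex, AlgebraicComplexity.paddedPerPoly, map_mul, map_pow, rename_X, rename_rename]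
  rfl

/-- The variables of BIP's padded permanent lie in the top-left `n × n` block (`0 < n`: the
padding variable `X_{(0,0)}` belongs to the block), a set of at most `n²` variables.
[cite: BurgisserIkenmeyerPanovaJAMS2019, §1(a) (1.2)] -/
theorem vars_bipPaddedPerFormLex_subset {n m : ℕ} [NeZero m] (hn : 0 < n) :
    ↑(bipPaddedPerFormLex k n m).vars ⊆
      ((Finset.univ.image fun ij : TopBlockIdx n m × TopBlockIdx n m =>
        (toLex ((ij.1 : Fin m), (ij.2 : Fin m)) : Literature.NumberTheory.DiophantineGeometry.MatIdx m)) : Set (Literature.NumberTheory.DiophantineGeometry.MatIdx m)) := by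
  classical
  intro x hx
  rw [Finset.mem_coe, bipPaddedPerFormLex_eq] at hx
  rw [Finset.mem_coe, Finset.mem_image]
  rcases Finset.mem_union.mp (vars_mul _ _ hx) with h1 | h2
  · have h1' := vars_pow _ _ h1
    rw [vars_X, Finset.mem_singleton] at h1'
    exact ⟨(⟨(0 : Fin m), by simpa using hn⟩, ⟨(0 : Fin m), by simpa using hn⟩), Finset.mem_univ _,
      h1'.symm⟩
  · obtain ⟨ij, -, rfl⟩ := Finset.mem_image.mp (vars_rename _ _ h2)
    exact ⟨ij, Finset.mem_univ _, rfl⟩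

/-- The top-left block variables are at most `n²` in number. [folklore] -/
theorem card_image_topBlockIdx_le (n m : ℕ) (hnm : n ≤ m) :
    (Finset.univ.image fun ij : TopBlockIdx n m × TopBlockIdx n m =>
      (toLex ((ij.1 : Fin m), (ij.2 : Fin m)) : Literature.NumberTheory.DiophantineGeometry.MatIdx m)).card ≤ n ^ 2 := by
  classical
  refine Finset.card_image_le.trans ?_
  rw [Finset.card_univ, Fintype.card_prod, Fintype.card_fin_lt_of_le hnm, sq]

/-- The variables of G20's padded permanent `X_{(0,0)}^{m-n} per_n(bottom-right block)` lie in
the set `{(0,0)} ∪ block`, of at most `n² + 1` variables. [cite: MulmuleySohoniSIAM2001, §4] -/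
theorem vars_paddedPerFormLex_subset (n m : ℕ) [NeZero m] :
    ↑(Literature.NumberTheory.DiophantineGeometry.paddedPerFormLex k n m).vars ⊆
      (↑(insert (toLex ((0 : Fin m), (0 : Fin m)) : Literature.NumberTheory.DiophantineGeometry.MatIdx m)
        (Finset.univ.image fun ij : AlgebraicComplexity.BlockIdx n m × AlgebraicComplexity.BlockIdx n m =>
          (toLex ((ij.1 : Fin m), (ij.2 : Fin m)) : Literature.NumberTheory.DiophantineGeometry.MatIdx m)) : Finset (Literature.NumberTheory.DiophantineGeometry.MatIdx m)) :
        Set (Literature.NumberTheory.DiophantineGeometry.MatIdx m)) := by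
  classical
  intro x hx
  rw [Finset.mem_coe, paddedPerFormLex_eq] at hx
  rw [Finset.mem_coe, Finset.mem_insert, Finset.mem_image]
  rcases Finset.mem_union.mp (vars_mul _ _ hx) with h1 | h2
  · have h1' := vars_pow _ _ h1
    rw [vars_X, Finset.mem_singleton] at h1'
    exact Or.inl h1'
  · obtain ⟨ij, -, rfl⟩ := Finset.mem_image.mp (vars_rename _ _ h2)
    exact Or.inr ⟨ij, Finset.mem_univ _, rfl⟩

/-- `{(0,0)} ∪ block` has at most `n² + 1` elements (`n ≤ m`). [folklore] -/
theorem card_insert_image_blockIdx_le (n m : ℕ) [NeZero m] (hnm : n ≤ m) :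
    (insert (toLex ((0 : Fin m), (0 : Fin m)) : Literature.NumberTheory.DiophantineGeometry.MatIdx m)
      (Finset.univ.image fun ij : AlgebraicComplexity.BlockIdx n m × AlgebraicComplexity.BlockIdx n m =>
        (toLex ((ij.1 : Fin m), (ij.2 : Fin m)) : Literature.NumberTheory.DiophantineGeometry.MatIdx m))).card ≤ n ^ 2 + 1 := by
  classical
  refine (Finset.card_insert_le _ _).trans (Nat.add_le_add_right ?_ 1)
  refine Finset.card_image_le.trans ?_
  rw [Finset.card_univ, Fintype.card_prod, AlgebraicComplexity.card_blockIdx hnm, sq]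

/-- The size of a weight transported to the matrix index type is unchanged. [folklore] -/
theorem _root_.Literature.NumberTheory.DiophantineGeometry.Weight.size_toMatIdx {m : ℕ} (χ : Literature.NumberTheory.DiophantineGeometry.Weight (Fin (m * m))) : χ.toMatIdx.size = χ.size := by
  rw [Literature.NumberTheory.DiophantineGeometry.Weight.size, Literature.NumberTheory.DiophantineGeometry.Weight.size]
  exact (Literature.NumberTheory.DiophantineGeometry.matIdxEquiv m).symm.toEquiv.sum_comp χ

end PaddedVars

end Literature.Computability.Complexity

namespace Literature.Computability.Complexity

/-- **Discharge of `bip2019_thm_2_1` (BIP Thm. 2.1 = Kadish–Landsberg, via BIP Thm. 4.9 proved in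
`OrbitClosureWeights.lean`).** For `0 < n ≤ m`, every weight occurring in the coordinate ring of
the orbit closure of BIP's padded permanent `X_{(0,0)}^{m-n} per_n(top-left block)` is
`partitionWeightLex m λ` for a partition `λ ⊢ d·m` with `ℓ(λ) ≤ n²` (Thm. 4.9(1): the form
involves only the `n²` block variables) and `|λ̄| ≤ n d` (Thm. 4.9(2): `λ₁ ≥ (m-n) d`).
[cite: BurgisserIkenmeyerPanovaJAMS2019, Thm. 2.1] -/
theorem bip2019_thm_2_1_holds : bip2019_thm_2_1 := by
  intro n m _ hn hnm χ h
  classical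
  have hmm : m * m ≠ 0 := mul_ne_zero (NeZero.ne m) (NeZero.ne m)
  set e := Literature.NumberTheory.DiophantineGeometry.matIdxEquiv m with he
  set iₘ : Literature.NumberTheory.DiophantineGeometry.MatIdx m := e ⟨m * m - 1, Nat.sub_one_lt hmm⟩ with hiₘ'
  have hiₘ : ∀ i, i ≤ iₘ := Complexity.le_matIdxEquiv_last m hmm
  change Literature.NumberTheory.DiophantineGeometry.HasHighestWeight
    (AlgebraicComplexity.orbitCoordRep (Complexity.bipPaddedPerFormLex ℂ n m) m) χ at h
  -- Thm. 4.9(2): the first row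
  have h' := h
  rw [Complexity.bipPaddedPerFormLex_eq] at h'
  obtain ⟨D, hsize, hrow⟩ :=
    AlgebraicComplexity.exists_size_eq_and_mul_le_of_hasHighestWeight_orbitCoordRep_X_pow_mul iₘ hiₘ _
      (m - n) _ h'
  -- the partition form in degree `D`
  obtain ⟨lam, hlamN, hlam⟩ :=
    AlgebraicComplexity.exists_eq_dualOfPartition_of_hasHighestWeight_orbitCoordRep_of_size_eq e _ h hsize
  refine ⟨D, lam, ?_, ?_, hlam⟩
  · -- Thm. 4.9(1): the length
    apply AlgebraicComplexity.card_parts_le_of_dualOfPartition_apply_eq_zero lam hlamN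
    intro i hi
    have hA := Complexity.card_image_topBlockIdx_le n m hnm
    have h0 := AlgebraicComplexity.apply_eq_zero_of_hasHighestWeight_orbitCoordRep_of_vars_subset e _ _
      (Complexity.vars_bipPaddedPerFormLex_subset (k := ℂ) (m := m) hn) h i (by omega)
    rw [hlam] at h0
    simpa only [OrderIso.symm_apply_apply] using h0
  · -- the body
    have hlast : χ iₘ = -(lam.parts.sup : ℤ) := by
      rw [hlam]
      simp only [hiₘ', OrderIso.symm_apply_apply]
      rw [Literature.NumberTheory.DiophantineGeometry.Weight.dualOfPartition_apply_last lam (Nat.pos_of_ne_zero hmm),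
        sup_parts_eq_getD_sortedParts]
    rw [hlast, neg_neg] at hrow
    have h2 : (m - n) * D ≤ lam.parts.sup := by exact_mod_cast hrow
    rw [bodySize, tsub_le_iff_right]
    calc D * m = n * D + (m - n) * D := by
          rw [← Nat.add_mul, Nat.add_sub_cancel' hnm, mul_comm]
      _ ≤ n * D + lam.parts.sup := Nat.add_le_add_left h2 _

/-- **Discharge of `exists_partition_of_hasHighestWeight_paddedPerOrbitRep` (BIP Thm. 4.9(1) for
G20's fresh-variable padding).** For `n ≤ m`, every weight occurring in the coordinate ring of the
orbit closure of `X_{(0,0)}^{m-n} per_n(bottom-right block)` is `partitionWeightLex m λ` for a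
partition `λ ⊢ d·m` with at most `m²` parts and `ℓ(λ) ≤ n² + 1` (the form involves only the
`n² + 1` variables `{X_{(0,0)}} ∪ block`). [cite: BurgisserIkenmeyerPanovaJAMS2019, Thm. 4.9(1)] -/
theorem exists_partition_of_hasHighestWeight_paddedPerOrbitRep_holds :
    exists_partition_of_hasHighestWeight_paddedPerOrbitRep := by
  intro n m _ hnm χ h
  classical
  set e := Literature.NumberTheory.DiophantineGeometry.matIdxEquiv m with he
  change Literature.NumberTheory.DiophantineGeometry.HasHighestWeight
    (AlgebraicComplexity.orbitCoordRep (Literature.NumberTheory.DiophantineGeometry.paddedPerFormLex ℂ n m) m) χ at h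
  obtain ⟨D, lam, hlamN, hlam⟩ :=
    AlgebraicComplexity.exists_eq_dualOfPartition_of_hasHighestWeight_orbitCoordRep e _ h
  refine ⟨D, lam, ?_, hlamN, hlam⟩
  apply AlgebraicComplexity.card_parts_le_of_dualOfPartition_apply_eq_zero lam hlamN
  intro i hi
  have hA := Complexity.card_insert_image_blockIdx_le n m hnm
  have h0 := AlgebraicComplexity.apply_eq_zero_of_hasHighestWeight_orbitCoordRep_of_vars_subset e _ _
    (Complexity.vars_paddedPerFormLex_subset (k := ℂ) n m) h i (by omega)
  rw [hlam] at h0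
  simpa only [OrderIso.symm_apply_apply] using h0

/-- **Discharge of `kadish_landsberg_padding` (Kadish–Landsberg, Comm. Algebra 42 (2014)
2171–2180, main theorem; BIP Thm. 4.9(2) for G20's fresh-variable padding).** If `π ⊢ d·m` (at most `m²` parts)
occurs in the coordinate ring of the orbit closure of `X_{(0,0)}^{m-n} per_n` (`n ≤ m`), then
`π₁ ≥ d (m - n)`. [cite: BurgisserIkenmeyerPanovaJAMS2019, Thm. 4.9(2)] -/
theorem kadish_landsberg_padding_holds : kadish_landsberg_padding := by
  intro n m d _ hnm pi hpi h
  classical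
  have hmm : m * m ≠ 0 := mul_ne_zero (NeZero.ne m) (NeZero.ne m)
  set e := Literature.NumberTheory.DiophantineGeometry.matIdxEquiv m with he
  set iₘ : Literature.NumberTheory.DiophantineGeometry.MatIdx m := e ⟨m * m - 1, Nat.sub_one_lt hmm⟩ with hiₘ'
  have hiₘ : ∀ i, i ≤ iₘ := Complexity.le_matIdxEquiv_last m hmm
  change Literature.NumberTheory.DiophantineGeometry.HasHighestWeight
    (AlgebraicComplexity.orbitCoordRep (Literature.NumberTheory.DiophantineGeometry.paddedPerFormLex ℂ n m) m) _ at h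
  rw [Complexity.paddedPerFormLex_eq] at h
  obtain ⟨D, hsize, hrow⟩ :=
    AlgebraicComplexity.exists_size_eq_and_mul_le_of_hasHighestWeight_orbitCoordRep_X_pow_mul iₘ hiₘ _
      (m - n) _ h
  -- the weight of `π` has size `-(d m)`, so `D = d`
  have hsize' : Literature.NumberTheory.DiophantineGeometry.Weight.size (Literature.NumberTheory.DiophantineGeometry.Weight.dualOfPartition (m * m) pi).toMatIdx =
      -((d * m : ℕ) : ℤ) := by
    rw [Literature.NumberTheory.DiophantineGeometry.Weight.size_toMatIdx, Literature.NumberTheory.DiophantineGeometry.Weight.dualOfPartition, Literature.NumberTheory.DiophantineGeometry.Weight.size_dual,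
      Literature.NumberTheory.DiophantineGeometry.Weight.size_ofPartition_holds hpi]
  have hD : D = d := by
    rw [hsize'] at hsize
    have h1 : ((d * m : ℕ) : ℤ) = ((m * D : ℕ) : ℤ) := neg_injective hsize
    have h2 : m * d = m * D := by rw [mul_comm m d]; exact_mod_cast h1
    exact (Nat.eq_of_mul_eq_mul_left (NeZero.pos m) h2).symm
  subst hD
  -- the last entry of the weight is `-π₁`
  have hlast : (Literature.NumberTheory.DiophantineGeometry.Weight.dualOfPartition (m * m) pi).toMatIdx iₘ = -(pi.parts.sup : ℤ) := by
    rw [Literature.NumberTheory.DiophantineGeometry.Weight.toMatIdx]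
    simp only [hiₘ', he, OrderIso.symm_apply_apply]
    rw [Literature.NumberTheory.DiophantineGeometry.Weight.dualOfPartition_apply_last pi (Nat.pos_of_ne_zero hmm),
      sup_parts_eq_getD_sortedParts]
  rw [hlast, neg_neg] at hrow
  rw [mul_comm]
  exact_mod_cast hrow

end Literature.Computability.Complexity

namespace Literature.Computability.Complexity

/-- BIP Thm. 1.4 for BIP's padded permanent from the remaining named facts only: Props. 2.4, 6.1,
2.3, Thm. 6.2 and the BLMW lift `ℂ[Z] ↝ ℂ[Sym^m V^*]` (Thm. 2.1 and Prop. 6.3 being discharged by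
`bip2019_thm_2_1_holds` and `bip2019_prop_6_3_of_parts`).
[cite: BurgisserIkenmeyerPanovaJAMS2019, Thm. 1.4 and §6 (Proof of Theorem 1.4)] -/
theorem bip2019_no_occurrence_obstructions_of_parts' (h24 : bip2019_prop_2_4)
    (h61 : bip2019_prop_6_1) (h23 : bip2019_prop_2_3) (h62 : bip2019_thm_6_2)
    (hlift : ∀ m : ℕ,
      Literature.NumberTheory.DiophantineGeometry.hasHighestWeight_coordRep_of_orbitCoordRep (k := ℂ) (σ := Literature.NumberTheory.DiophantineGeometry.MatIdx m)) :
    bip2019_no_occurrence_obstructions :=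
  bip2019_no_occurrence_obstructions_of_parts bip2019_thm_2_1_holds h24 h61
    (bip2019_prop_6_3_of_parts h23 h62) hlift

/-- The fresh-variable statement at threshold `(n+1)^25` from the remaining named facts only
(Props. 2.4, 6.1, 2.3, Thm. 6.2, BLMW lift), Thm. 4.9(1) and the Kadish–Landsberg constraint being
discharged by `exists_partition_of_hasHighestWeight_paddedPerOrbitRep_holds` and
`kadish_landsberg_padding_holds`.
[cite: BurgisserIkenmeyerPanovaJAMS2019, §6 (Proof of Theorem 1.4), with M = n + 1] -/
theorem no_occurrence_obstructions_succ_of_parts' (h24 : bip2019_prop_2_4)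
    (h61 : bip2019_prop_6_1) (h23 : bip2019_prop_2_3) (h62 : bip2019_thm_6_2)
    (hlift : ∀ m : ℕ,
      Literature.NumberTheory.DiophantineGeometry.hasHighestWeight_coordRep_of_orbitCoordRep (k := ℂ) (σ := Literature.NumberTheory.DiophantineGeometry.MatIdx m)) :
    no_occurrence_obstructions_succ :=
  no_occurrence_obstructions_succ_of_parts exists_partition_of_hasHighestWeight_paddedPerOrbitRep_holds
    kadish_landsberg_padding_holds h24 h61 (bip2019_prop_6_3_of_parts h23 h62) hlift

end Literature.Computability.Complexity

/-! ## 6. BIP §5(b)–§6(a): the inner degree lifting (Prop. 5.6(2) as a named fact) and Prop. 2.4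
(small degrees) PROVED from it -/

namespace Literature.Computability.Complexity

section DetTop

variable {k : Type*} [Field k]

/-- `det_m ≠ 0` in the lexicographic variables. [folklore] -/
theorem detFormLex_ne_zero (m : ℕ) : Literature.NumberTheory.DiophantineGeometry.detFormLex k m ≠ 0 := by
  rw [Literature.NumberTheory.DiophantineGeometry.detFormLex, Ne, ← map_zero (rename (toLex : Fin m × Fin m → Literature.NumberTheory.DiophantineGeometry.MatIdx m)),
    (rename_injective _ toLex.injective).eq_iff]
  exact Matrix.det_mvPolynomialX_ne_zero (Fin m) k

/-- **The coordinate of `x_{iₘ}^m` does not vanish on the orbit of `det_m`** (`iₘ = (m-1,m-1)` the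
greatest matrix index): at the unipotent substitution `X_{aa} ↦ X_{aa} + X_{iₘ}` (`a < m-1`) the
coefficient of `X_{iₘ}^m` in the substituted determinant is `det 1 = 1` (the computation of
`hasHighestWeight_detOrbitRep_single_top`, BIP §6(a): "`X_1^n ∈ Ω_n` and ... `⟨e_{11}^n, X_1^n⟩ = 1`").
[cite: BurgisserIkenmeyerPanovaJAMS2019, §6(a)] -/
theorem X_single_top_not_mem_orbitVanishingIdeal_detFormLex (m : ℕ) [NeZero m] (iₘ : Literature.NumberTheory.DiophantineGeometry.MatIdx m)
    (hiₘ : ∀ i, i ≤ iₘ) (d : AlgebraicComplexity.DegIdx (Literature.NumberTheory.DiophantineGeometry.MatIdx m) m) (hd : d.1 = Finsupp.single iₘ m) :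
    (X d : MvPolynomial (AlgebraicComplexity.DegIdx (Literature.NumberTheory.DiophantineGeometry.MatIdx m) m) k) ∉ AlgebraicComplexity.orbitVanishingIdeal (Literature.NumberTheory.DiophantineGeometry.detFormLex k m) m := by
  classical
  -- the greatest index is the diagonal position `(m-1, m-1)`
  set a₀ : Fin m := Fin.rev 0 with ha₀
  have htop : iₘ = toLex (a₀, a₀) := by
    refine le_antisymm ?_ (hiₘ _)
    rcases h : ofLex iₘ with ⟨a, b⟩
    have hiₘ' : iₘ = toLex (a, b) := by rw [← h, toLex_ofLex]
    rw [hiₘ', Prod.Lex.toLex_le_toLex]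
    rcases (Fin.le_rev_iff.mpr (Fin.zero_le _) : a ≤ a₀).lt_or_eq with hlt | heq
    · exact Or.inl hlt
    · exact Or.inr ⟨heq, Fin.le_rev_iff.mpr (Fin.zero_le _)⟩
  -- the unipotent substitution `X_{aa} ↦ X_{aa} + X_{iₘ}` for `(a, a) ≠ iₘ`
  set E : Matrix (Literature.NumberTheory.DiophantineGeometry.MatIdx m) (Literature.NumberTheory.DiophantineGeometry.MatIdx m) k := Matrix.of fun j i =>
    if j = iₘ ∧ i ≠ iₘ ∧ (ofLex i).1 = (ofLex i).2 then 1 else 0 with hE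
  have hE2 : E * E = 0 := by
    ext j i
    rw [Matrix.mul_apply, Matrix.zero_apply]
    refine Finset.sum_eq_zero fun l _ => ?_
    by_cases hl : l = iₘ
    · have : E j l = 0 := by
        rw [hE, Matrix.of_apply, if_neg]
        exact fun h => h.2.1 hl
      rw [this, zero_mul]
    · have : E l i = 0 := by
        rw [hE, Matrix.of_apply, if_neg]
        exact fun h => hl h.1
      rw [this, mul_zero]
  set g : GL (Literature.NumberTheory.DiophantineGeometry.MatIdx m) k := ⟨1 + E, 1 - E,
    by rw [add_mul, mul_sub, mul_sub, one_mul, one_mul, mul_one, hE2]; abel,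
    by rw [sub_mul, mul_add, mul_add, one_mul, one_mul, mul_one, hE2]; abel⟩ with hg
  rw [AlgebraicComplexity.mem_orbitVanishingIdeal_iff, not_forall]
  refine ⟨g, ?_⟩
  rw [aeval_X, AlgebraicComplexity.formCoeff_apply, AlgebraicComplexity.linSubstRep_apply, hd]
  change coeff (Finsupp.single iₘ m) (AlgebraicComplexity.linSubst _ k (1 + E) (Literature.NumberTheory.DiophantineGeometry.detFormLex k m)) ≠ 0
  rw [← eval_pi_single_of_isHomogeneous
    (AlgebraicComplexity.linSubst_isHomogeneous _ (Literature.NumberTheory.DiophantineGeometry.detFormLex_isHomogeneous k m)) iₘ, eval_linSubst, Literature.NumberTheory.DiophantineGeometry.detFormLex,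
    eval_rename, AlgebraicComplexity.eval_detPoly]
  -- the evaluated matrix is the identity
  have hmat : (Matrix.of fun a b : Fin m =>
      ((fun i => ∑ j, (1 + E) j i * (Pi.single iₘ (1 : k) : Literature.NumberTheory.DiophantineGeometry.MatIdx m → k) j) ∘ toLex) (a, b)) =
      1 := by
    ext a b
    simp only [Matrix.of_apply, Function.comp_apply]
    rw [Finset.sum_eq_single iₘ (fun j _ hj => by rw [Pi.single_eq_of_ne hj, mul_zero])
      (fun h => absurd (Finset.mem_univ iₘ) h), Pi.single_eq_same, mul_one, Matrix.add_apply,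
      hE, Matrix.of_apply, Matrix.one_apply, Matrix.one_apply, htop]
    by_cases hab : a = b
    · subst hab
      by_cases ha : a = a₀
      · subst ha
        simp
      · have hne : toLex (a, a) ≠ toLex (a₀, a₀) := fun h => ha (congrArg Prod.fst (toLex_inj.mp h))
        simp [hne, Ne.symm hne]
    · have hne : toLex (a₀, a₀) ≠ toLex (a, b) := fun h => hab
        ((congrArg Prod.fst (toLex_inj.mp h)).symm.trans (congrArg Prod.snd (toLex_inj.mp h)))
      simp [hne, hab]
  rw [hmat, Matrix.det_one]
  exact one_ne_zero

/-- Every polynomial of the vanishing ideal of the orbit of `det_m` vanishes at every point of the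
orbit CLOSURE `Ω_m` (`mem_orbitClosure_iff_formCoeff_holds`). Mulmuley–Sohoni 2001 §4. [folklore] -/
theorem aeval_formCoeff_eq_zero_of_mem_orbitClosure_detFormLex {m : ℕ} {q : MvPolynomial (Literature.NumberTheory.DiophantineGeometry.MatIdx m) k}
    (hq : q ∈ AlgebraicComplexity.orbitClosure (Literature.NumberTheory.DiophantineGeometry.detFormLex k m)) {F : MvPolynomial (AlgebraicComplexity.DegIdx (Literature.NumberTheory.DiophantineGeometry.MatIdx m) m) k}
    (hF : F ∈ AlgebraicComplexity.orbitVanishingIdeal (Literature.NumberTheory.DiophantineGeometry.detFormLex k m) m) : aeval (AlgebraicComplexity.formCoeff m q) F = 0 := by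
  have h := ((AlgebraicComplexity.mem_orbitClosure_iff_formCoeff_holds (Literature.NumberTheory.DiophantineGeometry.detFormLex_isHomogeneous k m)
    (detFormLex_ne_zero m)).mp hq).2
  rw [MvPolynomial.mem_zeroLocus_iff] at h
  exact h F hF

/-- A linear combination of the variables is a linear form. [folklore] -/
theorem isHomogeneous_sum_C_mul_X {τ : Type*} [Fintype τ] (c : τ → k) :
    (∑ x, C (c x) * X x : MvPolynomial τ k).IsHomogeneous 1 :=
  IsHomogeneous.sum _ _ _ fun x _ => by
    have h := (isHomogeneous_C τ (c x)).mul (isHomogeneous_X k x)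
    rwa [zero_add] at h

/-- A power sum of `n`-th powers of linear forms is a form of degree `n`. [folklore] -/
theorem isHomogeneous_sum_linearFormPow {τ ι : Type*} [Fintype τ] [Fintype ι] (φ : ι → τ → k)
    (n : ℕ) : (∑ i, (∑ x, C (φ i x) * X x : MvPolynomial τ k) ^ n).IsHomogeneous n :=
  IsHomogeneous.sum _ _ _ fun i _ => by
    have h := (isHomogeneous_sum_C_mul_X (φ i)).pow n
    rwa [one_mul] at h

/-- **BIP Thm. 2.5 in the lexicographic matrix variables**: for linear forms `φ_i`
(`i < r`), `s r ≤ m`, the padded power sum `X_{iₘ}^{m-s} · ∑_i φ_i^s` lies in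
`Ω_m = \overline{GL_{m²} · det_m}` (transport of `X_pow_mul_sum_pow_mem_orbitClosure_detPoly` along
`rename toLex`, `rename_mem_orbitClosure_rename_iff_holds`).
[cite: BurgisserIkenmeyerPanovaJAMS2019, Thm. 2.5] -/
theorem X_pow_mul_sum_linearFormPow_mem_orbitClosure_detFormLex [Infinite k] {m s r : ℕ} [NeZero m]
    (h : s * r ≤ m) (iₘ : Literature.NumberTheory.DiophantineGeometry.MatIdx m) (φ : Fin r → Literature.NumberTheory.DiophantineGeometry.MatIdx m → k) :
    (X iₘ ^ (m - s) * ∑ i, (∑ x, C (φ i x) * X x : MvPolynomial (Literature.NumberTheory.DiophantineGeometry.MatIdx m) k) ^ s) ∈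
      AlgebraicComplexity.orbitClosure (Literature.NumberTheory.DiophantineGeometry.detFormLex k m) := by
  set q' : MvPolynomial (Fin m × Fin m) k :=
    X (ofLex iₘ) ^ (m - s) * ∑ i, (∑ x, C (φ i (toLex x)) * X x : MvPolynomial (Fin m × Fin m) k) ^ s
    with hq'
  have hq'mem : q' ∈ AlgebraicComplexity.orbitClosure (AlgebraicComplexity.detPoly (Fin m) k) :=
    AlgebraicComplexity.X_pow_mul_sum_pow_mem_orbitClosure_detPoly h (isHomogeneous_X k (ofLex iₘ)) _ fun i =>
      isHomogeneous_sum_C_mul_X _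
  have hren : rename (toLex : Fin m × Fin m → Literature.NumberTheory.DiophantineGeometry.MatIdx m) q' =
      X iₘ ^ (m - s) * ∑ i, (∑ x, C (φ i x) * X x : MvPolynomial (Literature.NumberTheory.DiophantineGeometry.MatIdx m) k) ^ s := by
    rw [hq', map_mul, map_pow, rename_X, toLex_ofLex, map_sum]
    congr 1
    refine Finset.sum_congr rfl fun i _ => ?_
    rw [map_pow, map_sum]
    congr 1
    exact Fintype.sum_equiv (toLex : Fin m × Fin m ≃ Literature.NumberTheory.DiophantineGeometry.MatIdx m) _ _ fun x => by
      rw [map_mul, rename_C, rename_X]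
  rw [← hren, Literature.NumberTheory.DiophantineGeometry.detFormLex]
  exact (Literature.NumberTheory.DiophantineGeometry.rename_mem_orbitClosure_rename_iff_holds toLex (AlgebraicComplexity.detPoly (Fin m) k) q').mpr hq'mem

end DetTop

end Literature.Computability.Complexity

namespace Literature.Computability.Complexity

/-- The greatest matrix index `(m-1, m-1)` of `MatIdx m`, for `m ≠ 0`, as the last element of the
lexicographic enumeration. BIP's `e_1`/`X_1` (the first basis vector) in the dual,
greatest-index convention of `coordRep`. [folklore] -/
def topMatIdx (m : ℕ) [NeZero m] : Literature.NumberTheory.DiophantineGeometry.MatIdx m :=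
  Literature.NumberTheory.DiophantineGeometry.matIdxEquiv m ⟨m * m - 1, Nat.sub_one_lt (mul_ne_zero (NeZero.ne m) (NeZero.ne m))⟩

/-- Every matrix index is at most `topMatIdx m`. [folklore] -/
theorem le_topMatIdx (m : ℕ) [NeZero m] (i : Literature.NumberTheory.DiophantineGeometry.MatIdx m) : i ≤ topMatIdx m :=
  Complexity.le_matIdxEquiv_last m (mul_ne_zero (NeZero.ne m) (NeZero.ne m)) i

/-- **BIP Prop. 5.6(2) (surjectivity of the inner degree lifting onto highest-weight vectors with
few non-singleton columns; plethysm stability), as a named fact in weight form.** BIP: "(2) Suppose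
that `λ ⊢ nd` satisfies `λ₂ ≤ m` and `λ₂ + |λ̄| ≤ md`. Then every highest weight vector of weight
`λ` in `Sym^d Sym^n V` is obtained by lifting a highest weight vector in `Sym^d Sym^m V` of weight
`μ`, where `μ ⊢ md` such that `μ̄ = λ̄`" (context §5(a): `n ≥ m`). Here `V = ℂ^{N×N}`
(`MatIdx N`, the case used in §6), inner degrees `m' ≤ n'`, `λ ⊢ d·n'` with at most `N²` parts
(automatic in print), `λ₂ = secondPart λ`, `|λ̄| = bodySize λ`; a highest-weight vector of weight
`λ^*` "viewed as a degree `d` polynomial function" is a form `h` of degree `d` in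
`ℂ[Sym^{n'}] = MvPolynomial (DegIdx (MatIdx N) n') ℂ` in the highest-weight space of weight
`partitionWeightLex N λ`; "obtained by lifting" is `h = CplxAlg.innerLift (topMatIdx N) m' n' f`
(the dual lifting of `PlethysmLifting.lean`, BIP's `κ` up to the nonzero normalisation
`(m!/n!)^d`, which the linear space of `f`'s absorbs); `μ̄ = λ̄` is equality of the multisets of
parts with one copy of the largest part removed. The printed proof rests on the tableau bases
`v_T` (§4, Thm. 5.5, Prop. 4.5). [cite: BurgisserIkenmeyerPanovaJAMS2019, Prop. 5.6(2)] -/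
def bip2019_prop_5_6_2 : Prop :=
  ∀ (N m' n' d : ℕ) [NeZero N] (_hmn : m' ≤ n') (lam : Nat.Partition (d * n'))
    (_hlam : lam.parts.card ≤ N * N) (_h₂ : secondPart lam ≤ m')
    (_hbody : secondPart lam + bodySize lam ≤ m' * d)
    (h : MvPolynomial (AlgebraicComplexity.DegIdx (Literature.NumberTheory.DiophantineGeometry.MatIdx N) n') ℂ) (_hh : h.IsHomogeneous d)
    (_hhw : h ∈ Literature.NumberTheory.DiophantineGeometry.highestWeightSpace (AlgebraicComplexity.coordRep (Literature.NumberTheory.DiophantineGeometry.MatIdx N) ℂ n')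
      (partitionWeightLex N lam)),
    ∃ (mu : Nat.Partition (d * m')) (f : MvPolynomial (AlgebraicComplexity.DegIdx (Literature.NumberTheory.DiophantineGeometry.MatIdx N) m') ℂ),
      mu.parts.card ≤ N * N ∧ mu.parts.erase mu.parts.sup = lam.parts.erase lam.parts.sup ∧
      f.IsHomogeneous d ∧
      f ∈ Literature.NumberTheory.DiophantineGeometry.highestWeightSpace (AlgebraicComplexity.coordRep (Literature.NumberTheory.DiophantineGeometry.MatIdx N) ℂ m')
        (partitionWeightLex N mu) ∧
      h = AlgebraicComplexity.innerLift (topMatIdx N) m' n' f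

/-- The size of `partitionWeightLex m λ` for `λ ⊢ d·m` with at most `m²` parts is `-(m d)`.
[folklore] -/
theorem size_partitionWeightLex {m d : ℕ} (lam : Nat.Partition (d * m)) (hlam : lam.parts.card ≤ m * m) :
    Literature.NumberTheory.DiophantineGeometry.Weight.size (partitionWeightLex m lam) = -((m * d : ℕ) : ℤ) := by
  rw [partitionWeightLex, Literature.NumberTheory.DiophantineGeometry.Weight.size_toMatIdx, Literature.NumberTheory.DiophantineGeometry.Weight.dualOfPartition,
    Literature.NumberTheory.DiophantineGeometry.Weight.size_dual, Literature.NumberTheory.DiophantineGeometry.Weight.size_ofPartition_holds hlam, mul_comm]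

/-- **BIP Prop. 2.4 (small degrees) PROVED from Prop. 5.6(2)** (and the proved Prop. 3.2,
Thm. 2.5, Lemma 5.2, Thm. 5.4), following BIP §6(a) "Proof of Proposition 2.4": for `d ≥ 2`,
`λ₂ ≤ |λ̄| ≤ Md` and `λ₂ + |λ̄| ≤ 2Md ≤ Md·d`, so the highest-weight vector `h` (a form of degree
`d`, a weight pins the degree) is `innerLift f` for a highest-weight vector `f` on `Sym^{Md}`
(Prop. 5.6(2)); `f ∘ Δ ≠ 0` does not vanish at some power sum `p = φ_1^{Md} + ⋯ + φ_d^{Md}`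
(Prop. 3.2); with `q = X_{iₘ}^{m-Md} p ∈ Ω_m` (Thm. 2.5, `m ≥ Md·d`) one has
`h(q) = f(∂^{m-Md} q) = (f ∘ Δ)(p) ≠ 0` (Thm. 5.4, Lemma 5.2), so `h` does not vanish on `Ω_m`,
i.e. `h ∉ I(GL · det_m)`. The case `d = 1`: `h` is a multiple of the coordinate of `x_{iₘ}^m`,
which does not vanish on the orbit of `det_m`. [cite: BurgisserIkenmeyerPanovaJAMS2019, Prop. 2.4 and §6(a)] -/
theorem bip2019_prop_2_4_of_parts (h562 : bip2019_prop_5_6_2) : bip2019_prop_2_4 := by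
  intro m d M _ hd hM lam hlam hbody hMd v hv hv0
  classical
  have hm0 : m ≠ 0 := NeZero.ne m
  set iₘ := topMatIdx m with hiₘ'
  have hiₘ : ∀ i, i ≤ iₘ := le_topMatIdx m
  -- a weight pins the degree: `v` is a form of degree `d`
  have hvd : v.IsHomogeneous d :=
    AlgebraicComplexity.isHomogeneous_of_mem_highestWeightSpace hm0 hv (size_partitionWeightLex lam hlam)
  by_cases hd1 : d = 1
  · -- degree one: `v = c X_{x_{iₘ}^m}`
    subst hd1
    obtain ⟨e, c, hc, rfl⟩ := AlgebraicComplexity.exists_eq_smul_X_of_mem_weightSpace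
      (Literature.NumberTheory.DiophantineGeometry.highestWeightSpace_le_weightSpace _ _ hv) hvd hv0
    have he := AlgebraicComplexity.eq_single_of_smul_X_mem_highestWeightSpace iₘ hiₘ hc hv
    intro hI
    have hX : (X e : MvPolynomial (AlgebraicComplexity.DegIdx (Literature.NumberTheory.DiophantineGeometry.MatIdx m) m) ℂ) ∈
        AlgebraicComplexity.orbitVanishingIdeal (Literature.NumberTheory.DiophantineGeometry.detFormLex ℂ m) m := by
      have := Ideal.mul_mem_left _ (C c⁻¹) hI
      rwa [smul_eq_C_mul, ← mul_assoc, ← map_mul, inv_mul_cancel₀ hc, map_one, one_mul] at this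
    exact Complexity.X_single_top_not_mem_orbitVanishingIdeal_detFormLex m iₘ hiₘ e he hX
  · -- `d ≥ 2`: lift from inner degree `M d`
    have hd2 : 2 ≤ d := by omega
    have hm'm : M * d ≤ m := le_trans (by rw [sq]; exact Nat.mul_le_mul_left _ (by nlinarith)) hMd
    have h₂ : secondPart lam ≤ M * d := (secondPart_le_bodySize lam).trans hbody
    have hb2 : secondPart lam + bodySize lam ≤ M * d * d := by
      have h1 := secondPart_le_bodySize lam
      have h2 : 2 * (M * d) ≤ M * d * d := by nlinarith
      omega
    obtain ⟨mu, f, -, -, hfd, hfw, hvf⟩ := h562 m (M * d) m d hm'm lam hlam h₂ hb2 v hvd hv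
    have hf0 : f ≠ 0 := by
      rintro rfl
      exact hv0 (by rw [hvf, map_zero])
    -- `f ∘ Δ`
    obtain ⟨F, hF⟩ : ∃ F : MvPolynomial (AlgebraicComplexity.DegIdx (Literature.NumberTheory.DiophantineGeometry.MatIdx m) (M * d)) ℂ,
        F = aeval (fun e : AlgebraicComplexity.DegIdx (Literature.NumberTheory.DiophantineGeometry.MatIdx m) (M * d) =>
          C (((e.1 iₘ + (m - M * d)).descFactorial (m - M * d) : ℕ) : ℂ) * X e) f := ⟨_, rfl⟩
    have hsupp := AlgebraicComplexity.support_aeval_C_mul_X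
      (fun e : AlgebraicComplexity.DegIdx (Literature.NumberTheory.DiophantineGeometry.MatIdx m) (M * d) =>
        (((e.1 iₘ + (m - M * d)).descFactorial (m - M * d) : ℕ) : ℂ))
      (fun e => Nat.cast_ne_zero.mpr (AlgebraicComplexity.descFactorial_add_pos _ _).ne') f
    rw [← hF] at hsupp
    have hF0 : F ≠ 0 := by
      intro h0
      apply hf0
      rw [← support_eq_empty, ← hsupp, h0, support_zero]
    have hFdeg : F.totalDegree ≤ d :=
      (totalDegree_le_of_support_subset hsupp.le).trans (hfd.totalDegree hf0).le
    -- Prop. 3.2: a power sum with `d` terms on which `f ∘ Δ` does not vanish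
    have hm'pos : 0 < M * d := Nat.mul_pos hM hd
    obtain ⟨φ, hφ⟩ := AlgebraicComplexity.exists_aeval_formCoeff_sum_linearFormPow_ne_zero hm'pos F hF0 hFdeg
    obtain ⟨p, hp⟩ : ∃ p : MvPolynomial (Literature.NumberTheory.DiophantineGeometry.MatIdx m) ℂ,
        p = ∑ i, (∑ x, C (φ i x) * X x) ^ (M * d) := ⟨_, rfl⟩
    have hphom : p.IsHomogeneous (M * d) := by
      rw [hp]
      exact Complexity.isHomogeneous_sum_linearFormPow φ (M * d)
    -- the padded power sum `q = X_{iₘ}^{m - M * d} p ∈ Ω_m`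
    obtain ⟨q, hq⟩ : ∃ q : MvPolynomial (Literature.NumberTheory.DiophantineGeometry.MatIdx m) ℂ, q = X iₘ ^ (m - M * d) * p := ⟨_, rfl⟩
    have hqhom : q.IsHomogeneous m := by
      have := (isHomogeneous_X_pow (R := ℂ) iₘ (m - M * d)).mul hphom
      rwa [Nat.sub_add_cancel hm'm, ← hq] at this
    have hqmem : q ∈ AlgebraicComplexity.orbitClosure (Literature.NumberTheory.DiophantineGeometry.detFormLex ℂ m) := by
      have hsr : M * d * d ≤ m := by rw [mul_assoc, ← sq]; exact hMd
      rw [hq, hp]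
      exact Complexity.X_pow_mul_sum_linearFormPow_mem_orbitClosure_detFormLex (s := M * d) (r := d)
        hsr iₘ φ
    -- `v(q) = f(∂^{m-m'} q) = (f ∘ Δ)(p) ≠ 0`
    have hvq : aeval (AlgebraicComplexity.formCoeff m q) v ≠ 0 := by
      rw [hvf, AlgebraicComplexity.aeval_formCoeff_innerLift iₘ hqhom, hq,
        AlgebraicComplexity.aeval_formCoeff_iterPderiv_X_pow_mul iₘ (m - M * d) hphom, ← hF, hp]
      exact hφ
    intro hvI
    exact hvq (Complexity.aeval_formCoeff_eq_zero_of_mem_orbitClosure_detFormLex hqmem hvI)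

/-! ### BIP §5(c)–§6(a): the outer degree lifting (Prop. 5.8(2) as a named fact) and Prop. 6.1
(extremely long first rows) PROVED from Props. 5.6(2), 5.8(2) -/

/-- The index of the monomial `x_{iₘ}^s` (`iₘ = topMatIdx N`) among the degree-`s` monomials: the
coordinate `X_{x_{iₘ}^s}` of `ℂ[Sym^s]` is BIP's highest-weight vector `e_1^s ∈ Sym^1 Sym^s V`
(`CplxAlg.X_mem_highestWeightSpace_coordRep`), by which the outer degree lifting (5.8)
`f ↦ (e_1^m)^{d-k} · f` multiplies. [cite: BurgisserIkenmeyerPanovaJAMS2019, §5(c) (5.8)] -/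
def topDegIdx (N s : ℕ) [NeZero N] : AlgebraicComplexity.DegIdx (Literature.NumberTheory.DiophantineGeometry.MatIdx N) s :=
  ⟨Finsupp.single (topMatIdx N) s, AlgebraicComplexity.mem_degMonomials_iff.mpr (Finsupp.degree_single _ _)⟩

/-- **BIP Prop. 5.8(2) (surjectivity of the outer degree lifting; plethysm stability), as a named
fact in weight form.** BIP: "(2) Suppose that `f` is a highest weight vector in `Sym^d Sym^m V` of
weight `μ ⊢ dm` and assume that `μ₂ + |μ̄| ≤ k ≤ d` for some `k`. Then `μ = ν♯dm` for some
`ν ⊢ mk` and `f = (e_1^m)^{d-k} · g` for some `g ∈ HWV_ν(Sym^k Sym^m V)`", where (5.8) is the map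
`Sym^k Sym^m V → Sym^d Sym^m V, f ↦ (e_1^m)^{d-k} · f`. Here `V = ℂ^{N×N}`, inner degree `s`,
`μ ⊢ d·s` with at most `N²` parts, `μ₂ = secondPart μ`, `|μ̄| = bodySize μ`; in the coordinate
ring `ℂ[Sym^s] = MvPolynomial (DegIdx (MatIdx N) s) ℂ` the vector `e_1^m` is the coordinate
`X (topDegIdx N s)` of `x_{iₘ}^s` and (5.8) is multiplication by its `(d-k)`-th power;
`μ = ν♯dm` is rendered as `ν̄ = μ̄` (equal bodies; the first row is then forced by the sizes).
The printed proof rests on the tableau bases `v_T` (§4, Lemma 5.7, Prop. 4.5).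
[cite: BurgisserIkenmeyerPanovaJAMS2019, Prop. 5.8(2)] -/
def bip2019_prop_5_8_2 : Prop :=
  ∀ (N s d k' : ℕ) [NeZero N] (mu : Nat.Partition (d * s)) (_hmu : mu.parts.card ≤ N * N)
    (_hk : secondPart mu + bodySize mu ≤ k') (_hkd : k' ≤ d)
    (f : MvPolynomial (AlgebraicComplexity.DegIdx (Literature.NumberTheory.DiophantineGeometry.MatIdx N) s) ℂ) (_hf : f.IsHomogeneous d)
    (_hfw : f ∈ Literature.NumberTheory.DiophantineGeometry.highestWeightSpace (AlgebraicComplexity.coordRep (Literature.NumberTheory.DiophantineGeometry.MatIdx N) ℂ s)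
      (partitionWeightLex N mu)),
    ∃ (nu : Nat.Partition (k' * s)) (g : MvPolynomial (AlgebraicComplexity.DegIdx (Literature.NumberTheory.DiophantineGeometry.MatIdx N) s) ℂ),
      nu.parts.card ≤ N * N ∧ nu.parts.erase nu.parts.sup = mu.parts.erase mu.parts.sup ∧
      g.IsHomogeneous k' ∧
      g ∈ Literature.NumberTheory.DiophantineGeometry.highestWeightSpace (AlgebraicComplexity.coordRep (Literature.NumberTheory.DiophantineGeometry.MatIdx N) ℂ s)
        (partitionWeightLex N nu) ∧
      f = X (topDegIdx N s) ^ (d - k') * g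

/-- The body of a partition sums to `|λ̄| = |λ| - λ₁`. [folklore] -/
theorem sum_erase_sup_eq_bodySize {D : ℕ} (lam : Nat.Partition D) :
    (lam.parts.erase lam.parts.sup).sum = bodySize lam := by
  unfold bodySize
  by_cases hs : lam.parts = 0
  · have hD := lam.parts_sum
    rw [hs, Multiset.sum_zero] at hD
    subst hD
    simp
  · have hsplit := Multiset.cons_erase (sup_mem_of_ne_zero hs)
    have hsum : lam.parts.sup + (lam.parts.erase lam.parts.sup).sum = D := by
      rw [← Multiset.sum_cons, hsplit, lam.parts_sum]
    omega

/-- `|λ̄| ≤ (ℓ(λ) - 1) λ₂` (BIP, proof of Prop. 6.1: "`λ₂ + |λ̄| ≤ λ₂ + (ℓ(λ)-1) λ₂ = ℓ(λ) λ₂`").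
[cite: BurgisserIkenmeyerPanovaJAMS2019, Prop. 6.1 (proof)] -/
theorem bodySize_le_card_sub_one_mul_secondPart {D : ℕ} (lam : Nat.Partition D) :
    bodySize lam ≤ (lam.parts.card - 1) * secondPart lam := by
  rw [← sum_erase_sup_eq_bodySize]
  by_cases hs : lam.parts = 0
  · simp [hs]
  · have hcard : (lam.parts.erase lam.parts.sup).card = lam.parts.card - 1 := by
      rw [Multiset.card_erase_of_mem (sup_mem_of_ne_zero hs), Nat.pred_eq_sub_one]
    rw [← hcard, ← smul_eq_mul]
    exact Multiset.sum_le_card_nsmul _ _ fun b hb => Multiset.le_sup hb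

/-- Equal bodies have equal `λ₂` and `|λ̄|`. [folklore] -/
theorem secondPart_add_bodySize_eq_of_erase_eq {D D' : ℕ} {mu : Nat.Partition D}
    {lam : Nat.Partition D'} (h : mu.parts.erase mu.parts.sup = lam.parts.erase lam.parts.sup) :
    secondPart mu + bodySize mu = secondPart lam + bodySize lam := by
  rw [secondPart, secondPart, ← sum_erase_sup_eq_bodySize, ← sum_erase_sup_eq_bodySize, h]

/-- **BIP Prop. 6.1 (extremely long first rows) PROVED from Props. 5.6(2), 5.8(2)** (and the
proved Prop. 3.2 two-at-once, Thm. 2.5, Lemma 5.2, Thm. 5.4), following BIP §6(a): since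
`λ₂ ≤ s` and `λ₂ + |λ̄| ≤ ℓ(λ) λ₂ ≤ M² s ≤ d ≤ ds`, `h = innerLift f` with `f` a highest-weight
vector on `Sym^s` of weight `μ`, `μ̄ = λ̄` (Prop. 5.6(2)); with `k = M² s ≤ d` and
`μ₂ + |μ̄| = λ₂ + |λ̄| ≤ k`, `f = (e_1^s)^{d-k} g` (Prop. 5.8(2)); choose a power sum
`p = φ_1^s + ⋯ + φ_k^s` with `g(Δ p) ≠ 0` and `⟨e_1^s, Δ p⟩ ≠ 0` (Prop. 3.2), so that
`q = X_{iₘ}^{m-s} p ∈ Ω_m` (Thm. 2.5, `m ≥ s k = M² s²`) and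
`h(q) = f(Δ p) = ⟨e_1^s, Δ p⟩^{d-k} g(Δ p) ≠ 0`.
[cite: BurgisserIkenmeyerPanovaJAMS2019, Prop. 6.1 and §6(a)] -/
theorem bip2019_prop_6_1_of_parts (h562 : bip2019_prop_5_6_2) (h582 : bip2019_prop_5_8_2) :
    bip2019_prop_6_1 := by
  intro m d s M _ hs hM lam hℓ h₂ hsm hsd v hv hv0
  classical
  have hm0 : m ≠ 0 := NeZero.ne m
  set iₘ := topMatIdx m with hiₘ'
  have hiₘ : ∀ i, i ≤ iₘ := le_topMatIdx m
  -- arithmetic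
  have hM2 : 1 ≤ M ^ 2 := Nat.one_le_pow _ _ hM
  have hsm' : s ≤ m := by nlinarith
  have hlam : lam.parts.card ≤ m * m :=
    hℓ.trans (((Nat.le_mul_of_pos_right (M ^ 2) (pow_pos hs 2)).trans hsm).trans (Nat.le_mul_self m))
  have hsd' : M ^ 2 * s ≤ d * s := hsd.trans (Nat.le_mul_of_pos_right d hs)
  have hb : secondPart lam + bodySize lam ≤ M ^ 2 * s := by
    have h1 := bodySize_le_card_sub_one_mul_secondPart lam
    have h3 : (lam.parts.card - 1) * secondPart lam + secondPart lam = lam.parts.card * secondPart lam := by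
      rcases Nat.eq_zero_or_pos lam.parts.card with hc | hc
      · have : bodySize lam = 0 := bodySize_eq_zero_of_card_le_one lam (by omega)
        have : secondPart lam = 0 := by
          have := secondPart_le_bodySize lam; omega
        simp [hc, this]
      · rw [← Nat.succ_pred_eq_of_pos hc, Nat.succ_sub_one, Nat.succ_mul]
    have h4 : lam.parts.card * secondPart lam ≤ M ^ 2 * s := Nat.mul_le_mul hℓ h₂
    omega
  have hb2 : secondPart lam + bodySize lam ≤ s * d := by
    calc secondPart lam + bodySize lam ≤ M ^ 2 * s := hb
      _ ≤ d * s := hsd'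
      _ = s * d := mul_comm _ _
  have hk1 : 1 ≤ M ^ 2 * s := Nat.mul_pos (by omega) hs
  have hks : s * (M ^ 2 * s) ≤ m := by nlinarith
  -- `v` is a form of degree `d`
  have hvd : v.IsHomogeneous d :=
    AlgebraicComplexity.isHomogeneous_of_mem_highestWeightSpace hm0 hv (size_partitionWeightLex lam hlam)
  -- inner lifting from `Sym^s` (Prop. 5.6(2))
  obtain ⟨mu, f, hmuN, hmubody, hfd, hfw, hvf⟩ := h562 m s m d hsm' lam hlam h₂ hb2 v hvd hv
  -- outer lifting from degree `k = M² s` (Prop. 5.8(2))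
  have hkmu : secondPart mu + bodySize mu ≤ M ^ 2 * s := by
    rw [secondPart_add_bodySize_eq_of_erase_eq hmubody]; exact hb
  obtain ⟨nu, g, -, -, hgd, hgw, hfg⟩ := h582 m s d (M ^ 2 * s) mu hmuN hkmu hsd f hfd hfw
  have hg0 : g ≠ 0 := by
    rintro rfl
    exact hv0 (by rw [hvf, hfg, mul_zero, map_zero])
  -- `g ∘ Δ` and `X_{x_{iₘ}^s} ∘ Δ`, with a common good power sum of `k` terms (Prop. 3.2)
  obtain ⟨G, hG⟩ : ∃ G : MvPolynomial (AlgebraicComplexity.DegIdx (Literature.NumberTheory.DiophantineGeometry.MatIdx m) s) ℂ,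
      G = aeval (fun e : AlgebraicComplexity.DegIdx (Literature.NumberTheory.DiophantineGeometry.MatIdx m) s =>
        C (((e.1 iₘ + (m - s)).descFactorial (m - s) : ℕ) : ℂ) * X e) g := ⟨_, rfl⟩
  have hsupp := AlgebraicComplexity.support_aeval_C_mul_X
    (fun e : AlgebraicComplexity.DegIdx (Literature.NumberTheory.DiophantineGeometry.MatIdx m) s => (((e.1 iₘ + (m - s)).descFactorial (m - s) : ℕ) : ℂ))
    (fun e => Nat.cast_ne_zero.mpr (AlgebraicComplexity.descFactorial_add_pos _ _).ne') g
  rw [← hG] at hsupp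
  have hG0 : G ≠ 0 := by
    intro h0; apply hg0; rw [← support_eq_empty, ← hsupp, h0, support_zero]
  have hGdeg : G.totalDegree ≤ M ^ 2 * s :=
    (totalDegree_le_of_support_subset hsupp.le).trans (hgd.totalDegree hg0).le
  have hXdeg : (X (topDegIdx m s) : MvPolynomial (AlgebraicComplexity.DegIdx (Literature.NumberTheory.DiophantineGeometry.MatIdx m) s) ℂ).totalDegree
      ≤ M ^ 2 * s := by rw [totalDegree_X]; exact hk1
  obtain ⟨φ, hφG, hφX⟩ := AlgebraicComplexity.exists_aeval_formCoeff_sum_linearFormPow_ne_zero_and hs G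
    (X (topDegIdx m s)) hG0 (X_ne_zero _) hGdeg hXdeg
  rw [aeval_X] at hφX
  obtain ⟨p, hp⟩ : ∃ p : MvPolynomial (Literature.NumberTheory.DiophantineGeometry.MatIdx m) ℂ,
      p = ∑ i, (∑ x, C (φ i x) * X x) ^ s := ⟨_, rfl⟩
  rw [← hp] at hφG hφX
  have hphom : p.IsHomogeneous s := by rw [hp]; exact Complexity.isHomogeneous_sum_linearFormPow φ s
  obtain ⟨q, hq⟩ : ∃ q : MvPolynomial (Literature.NumberTheory.DiophantineGeometry.MatIdx m) ℂ, q = X iₘ ^ (m - s) * p := ⟨_, rfl⟩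
  have hqhom : q.IsHomogeneous m := by
    have := (isHomogeneous_X_pow (R := ℂ) iₘ (m - s)).mul hphom
    rwa [Nat.sub_add_cancel hsm', ← hq] at this
  have hqmem : q ∈ AlgebraicComplexity.orbitClosure (Literature.NumberTheory.DiophantineGeometry.detFormLex ℂ m) := by
    rw [hq, hp]
    exact Complexity.X_pow_mul_sum_linearFormPow_mem_orbitClosure_detFormLex (s := s) (r := M ^ 2 * s)
      hks iₘ φ
  -- `v(q) = f(Δ p) = (X_{x^s}(Δ p))^{d-k} · g(Δ p) ≠ 0`
  have hvq : aeval (AlgebraicComplexity.formCoeff m q) v ≠ 0 := by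
    rw [hvf, AlgebraicComplexity.aeval_formCoeff_innerLift iₘ hqhom, hq,
      AlgebraicComplexity.aeval_formCoeff_iterPderiv_X_pow_mul iₘ (m - s) hphom, hfg, map_mul, map_pow,
      map_mul, map_pow, ← hG]
    refine mul_ne_zero (pow_ne_zero _ ?_) hφG
    rw [aeval_X, map_mul, aeval_C, aeval_X, Algebra.algebraMap_self_apply]
    exact mul_ne_zero (Nat.cast_ne_zero.mpr (AlgebraicComplexity.descFactorial_add_pos _ _).ne') hφX
  intro hvI
  exact hvq (Complexity.aeval_formCoeff_eq_zero_of_mem_orbitClosure_detFormLex hqmem hvI)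

/-- **BIP Thm. 1.4 for BIP's padded permanent from the §4–§5 facts only**: Props. 5.6(2), 5.8(2)
(plethysm stability via tableaux), Prop. 2.3, Thm. 6.2 (explicit tableaux, §7) and the BLMW lift —
all other steps of the printed proof (Thm. 2.1, Lemma 2.2, Props. 2.4, 2.5, 3.2, 6.1, 6.3, Thm. 4.9,
§5(a)–(b), the assembly of §6) being proved in the tree.
[cite: BurgisserIkenmeyerPanovaJAMS2019, Thm. 1.4 and §6] -/
theorem bip2019_no_occurrence_obstructions_of_stability (h562 : bip2019_prop_5_6_2)
    (h582 : bip2019_prop_5_8_2) (h23 : bip2019_prop_2_3) (h62 : bip2019_thm_6_2)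
    (hlift : ∀ m : ℕ,
      Literature.NumberTheory.DiophantineGeometry.hasHighestWeight_coordRep_of_orbitCoordRep (k := ℂ) (σ := Literature.NumberTheory.DiophantineGeometry.MatIdx m)) :
    bip2019_no_occurrence_obstructions :=
  bip2019_no_occurrence_obstructions_of_parts' (bip2019_prop_2_4_of_parts h562)
    (bip2019_prop_6_1_of_parts h562 h582) h23 h62 hlift

/-- The fresh-variable statement at threshold `(n+1)^25` from the same facts.
[cite: BurgisserIkenmeyerPanovaJAMS2019, §6 (Proof of Theorem 1.4), with M = n + 1] -/
theorem no_occurrence_obstructions_succ_of_stability (h562 : bip2019_prop_5_6_2)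
    (h582 : bip2019_prop_5_8_2) (h23 : bip2019_prop_2_3) (h62 : bip2019_thm_6_2)
    (hlift : ∀ m : ℕ,
      Literature.NumberTheory.DiophantineGeometry.hasHighestWeight_coordRep_of_orbitCoordRep (k := ℂ) (σ := Literature.NumberTheory.DiophantineGeometry.MatIdx m)) :
    no_occurrence_obstructions_succ :=
  no_occurrence_obstructions_succ_of_parts' (bip2019_prop_2_4_of_parts h562)
    (bip2019_prop_6_1_of_parts h562 h582) h23 h62 hlift

end Literature.Computability.Complexity

/-! ## 7. BIP Prop. 2.3 (row-extended even rectangles occur) PROVED, via the hyperdeterminant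
highest-weight vector -/

namespace Literature.Computability.Complexity

open MvPolynomial

/-- The increasing enumeration of the top `kk` matrix indices. [folklore] -/
def topLetters (m kk : ℕ) (h : kk ≤ m * m) : Fin kk → Literature.NumberTheory.DiophantineGeometry.MatIdx m :=
  fun a => Literature.NumberTheory.DiophantineGeometry.matIdxEquiv m ⟨m * m - kk + a, by omega⟩

/-- The enumeration of the top letters is strictly increasing. [folklore] -/
theorem topLetters_strictMono (m kk : ℕ) (h : kk ≤ m * m) : StrictMono (topLetters m kk h) := by
  intro a b hab
  unfold topLetters
  apply (Literature.NumberTheory.DiophantineGeometry.matIdxEquiv m).strictMono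
  rw [Fin.lt_def]
  simp only
  exact Nat.add_lt_add_left hab _

/-- The top letters form an upper set of matrix indices. [folklore] -/
theorem topLetters_upper (m kk : ℕ) (h : kk ≤ m * m) (a : Fin kk) (x : Literature.NumberTheory.DiophantineGeometry.MatIdx m)
    (hx : topLetters m kk h a ≤ x) : ∃ b, topLetters m kk h b = x := by
  have h1 : (⟨m * m - kk + a, by omega⟩ : Fin (m * m)) ≤ (Literature.NumberTheory.DiophantineGeometry.matIdxEquiv m).symm x := by
    rw [← (Literature.NumberTheory.DiophantineGeometry.matIdxEquiv m).le_iff_le, OrderIso.apply_symm_apply]; exact hx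
  rw [Fin.le_def] at h1
  simp only at h1
  refine ⟨⟨((Literature.NumberTheory.DiophantineGeometry.matIdxEquiv m).symm x : ℕ) - (m * m - kk), by omega⟩, ?_⟩
  unfold topLetters
  apply (Literature.NumberTheory.DiophantineGeometry.matIdxEquiv m).symm.injective
  rw [OrderIso.symm_apply_apply]
  apply Fin.ext
  simp only
  omega

/-- The last top letter is the greatest matrix index `topMatIdx m`. [folklore] -/
theorem topLetters_last (m kk : ℕ) [NeZero m] (h : kk ≤ m * m) (hk : 0 < kk) :
    topLetters m kk h ⟨kk - 1, by omega⟩ = topMatIdx m := by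
  unfold topLetters topMatIdx
  congr 1
  apply Fin.ext
  simp only
  omega

/-- **The weight of the lifted hyperdeterminant is that of the row-extended rectangle**:
`rectWeight ℓ t + (-(m-ℓ)kk) ε_{iₘ} = partitionWeightLex m ((kk × ℓ)♯(kk m))` (`t` the top `kk`
indices). [cite: BurgisserIkenmeyerPanovaJAMS2019, Prop. 2.3] -/
theorem rectWeight_add_single_eq (m kk ℓ : ℕ) [NeZero m] (hk : 0 < kk) (hℓm : ℓ ≤ m)
    (h : kk ≤ m * m) :
    AlgebraicComplexity.rectWeight ℓ (topLetters m kk h) +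
        Pi.single (topMatIdx m) (-(((m - ℓ) * kk : ℕ) : ℤ)) =
      partitionWeightLex m (rowExtendedRectangle kk ℓ (kk * m)) := by
  classical
  funext x
  obtain ⟨i, rfl⟩ := (Literature.NumberTheory.DiophantineGeometry.matIdxEquiv m).surjective x
  rw [partitionWeightLex, Literature.NumberTheory.DiophantineGeometry.Weight.toMatIdx, Pi.add_apply, OrderIso.symm_apply_apply,
    Literature.NumberTheory.DiophantineGeometry.Weight.dualOfPartition, Literature.NumberTheory.DiophantineGeometry.Weight.dual, ofPartition_rowExtendedRectangle hk hℓm h,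
    sharpAddHom_apply]
  simp only [Pi.smul_apply]
  rw [← Finset.smul_sum, sum_colBody h, colBody_apply]
  simp only [nsmul_eq_mul]
  -- membership in the letters and the top index, in coordinates
  have hmem : Literature.NumberTheory.DiophantineGeometry.matIdxEquiv m i ∈ Set.range (topLetters m kk h) ↔ m * m - kk ≤ (i : ℕ) := by
    constructor
    · rintro ⟨a, ha⟩
      have := congrArg (fun y => (((Literature.NumberTheory.DiophantineGeometry.matIdxEquiv m).symm y : Fin (m * m)) : ℕ)) ha
      simp only [topLetters, OrderIso.symm_apply_apply] at this
      omega
    · intro hle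
      exact ⟨⟨i - (m * m - kk), by omega⟩, by
        unfold topLetters; congr 1; apply Fin.ext; simp only; omega⟩
  have htop : Literature.NumberTheory.DiophantineGeometry.matIdxEquiv m i = topMatIdx m ↔ (i : ℕ) = m * m - 1 := by
    rw [topMatIdx, (Literature.NumberTheory.DiophantineGeometry.matIdxEquiv m).injective.eq_iff, Fin.ext_iff]
  rw [AlgebraicComplexity.rectWeight]
  simp only [Pi.single_apply, htop, hmem]
  have hrev : ((Fin.rev i : Fin (m * m)) : ℕ) = m * m - 1 - i := by simp [Fin.rev]; omega
  rw [hrev]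
  have hcast1 : (((m - ℓ) * kk : ℕ) : ℤ) = ((m : ℤ) - ℓ) * kk := by push_cast [Nat.cast_sub hℓm]; ring
  have hcast2 : (((kk - 1 : ℕ) : ℤ)) = (kk : ℤ) - 1 := by push_cast [Nat.cast_sub hk]; ring
  rw [hcast1, hcast2]
  have hi : (i : ℕ) < m * m := i.2
  by_cases h1 : (i : ℕ) = m * m - 1
  · have hc1 : m * m - kk ≤ (i : ℕ) := by omega
    have hc2 : ¬(1 ≤ m * m - 1 - (i : ℕ) ∧ m * m - 1 - (i : ℕ) < kk) := by omega
    have hc3 : m * m - 1 - (i : ℕ) = 0 := by omega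
    rw [if_pos hc1, if_pos h1, if_neg hc2, if_pos hc3]
    ring
  · have hc3 : ¬(m * m - 1 - (i : ℕ) = 0) := by omega
    rw [if_neg h1, add_zero, if_neg hc3]
    by_cases h2 : m * m - kk ≤ (i : ℕ)
    · have hc2 : 1 ≤ m * m - 1 - (i : ℕ) ∧ m * m - 1 - (i : ℕ) < kk := by omega
      rw [if_pos h2, if_pos hc2]
      ring
    · have hc2 : ¬(1 ≤ m * m - 1 - (i : ℕ) ∧ m * m - 1 - (i : ℕ) < kk) := by omega
      rw [if_neg h2, if_neg hc2]
      ring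

/-- **Discharge of `bip2019_prop_2_3` (BIP Prop. 2.3: row-extended even rectangles occur in
`ℂ[Ω_m]_k`).** The dual highest-weight vector `HD` (Cayley's hyperdeterminant of the array of a
form on the top `kk` letters, `CplxAlg.hyperdetPoly`; BIP's `v_T` for the `kk × ℓ` tableau,
Cor. 4.8) lifted by `innerLift` to `ℂ[Sym^m]` has weight `((kk × ℓ)♯(kk m))^*` and does not vanish
at the padded power sum `X_{iₘ}^{m-ℓ}(x_{t_1}^ℓ + ⋯ + x_{t_kk}^ℓ) ∈ Ω_m` (Thm. 2.5), its value there
being `kk! ∏ (positive integers)` for `ℓ` even (`hyperdet_diagArr`), hence it lies outside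
`I(GL · det_m)` and the weight occurs in `ℂ[Ω_m]` (`hasHighestWeight_orbitCoordRep_of_not_mem`).
[cite: BurgisserIkenmeyerPanovaJAMS2019, Prop. 2.3 and §6(b)] -/
theorem bip2019_prop_2_3_holds : bip2019_prop_2_3 := by
  intro m kk ℓ _ hk hℓ he hkℓ
  classical
  have hkN : kk ≤ m * m := le_trans (le_trans (Nat.le_mul_of_pos_right kk hℓ) hkℓ) (Nat.le_mul_self m)
  have hℓm : ℓ ≤ m := le_trans (Nat.le_mul_of_pos_left ℓ hk) hkℓ
  set t := topLetters m kk hkN with ht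
  set iₘ := topMatIdx m with hiₘ'
  have hiₘ : ∀ i, i ≤ iₘ := le_topMatIdx m
  -- the lifted hyperdeterminant and its weight
  set F : MvPolynomial (AlgebraicComplexity.DegIdx (Literature.NumberTheory.DiophantineGeometry.MatIdx m) ℓ) ℂ := AlgebraicComplexity.hyperdetPoly ℓ t with hF
  have hFw := AlgebraicComplexity.hyperdetPoly_mem_highestWeightSpace (k := ℂ) (ℓ := ℓ) (topLetters_strictMono m kk hkN)
    (topLetters_upper m kk hkN)
  have hFd := AlgebraicComplexity.isHomogeneous_hyperdetPoly (k := ℂ) (ℓ := ℓ) t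
  have hhw := AlgebraicComplexity.innerLift_mem_highestWeightSpace iₘ hiₘ hℓm hFd hFw
  rw [rectWeight_add_single_eq m kk ℓ hk hℓm hkN] at hhw
  refine Complexity.hasHighestWeight_orbitCoordRep_of_not_mem _ m hhw ?_
  -- the padded power sum of the letters lies in `Ω_m`
  set p : MvPolynomial (Literature.NumberTheory.DiophantineGeometry.MatIdx m) ℂ := ∑ a, X (t a) ^ ℓ with hp
  have hpsum : p = ∑ a, (∑ x, C (if x = t a then (1 : ℂ) else 0) * X x) ^ ℓ := by
    rw [hp]
    refine Finset.sum_congr rfl fun a _ => ?_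
    congr 1
    rw [Finset.sum_eq_single (t a)]
    · simp
    · intro x _ hx; simp [hx]
    · exact fun h => absurd (Finset.mem_univ _) h
  have hphom : p.IsHomogeneous ℓ := IsHomogeneous.sum _ _ _ fun a _ => isHomogeneous_X_pow _ _
  obtain ⟨q, hq⟩ : ∃ q : MvPolynomial (Literature.NumberTheory.DiophantineGeometry.MatIdx m) ℂ, q = X iₘ ^ (m - ℓ) * p := ⟨_, rfl⟩
  have hqhom : q.IsHomogeneous m := by
    have := (isHomogeneous_X_pow (R := ℂ) iₘ (m - ℓ)).mul hphom
    rwa [Nat.sub_add_cancel hℓm, ← hq] at this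
  have hqmem : q ∈ AlgebraicComplexity.orbitClosure (Literature.NumberTheory.DiophantineGeometry.detFormLex ℂ m) := by
    have hsr : ℓ * kk ≤ m := by rw [mul_comm]; exact hkℓ
    rw [hq, hpsum]
    exact Complexity.X_pow_mul_sum_linearFormPow_mem_orbitClosure_detFormLex (s := ℓ) (r := kk) hsr iₘ _
  -- the lifted hyperdeterminant does not vanish there
  have hval : aeval (AlgebraicComplexity.formCoeff m q) (AlgebraicComplexity.innerLift iₘ ℓ m F) ≠ 0 := by
    rw [AlgebraicComplexity.aeval_formCoeff_innerLift iₘ hqhom, hq]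
    have hpt : AlgebraicComplexity.formCoeff ℓ (AlgebraicComplexity.iterPderiv iₘ (m - ℓ) (X iₘ ^ (m - ℓ) * p)) =
        fun e : AlgebraicComplexity.DegIdx (Literature.NumberTheory.DiophantineGeometry.MatIdx m) ℓ =>
          (((e.1 iₘ + (m - ℓ)).descFactorial (m - ℓ) : ℕ) : ℂ) * AlgebraicComplexity.formCoeff ℓ p e :=
      funext fun e => AlgebraicComplexity.formCoeff_iterPderiv_X_pow_mul iₘ (m - ℓ) hphom e
    rw [hpt, hp, hF, AlgebraicComplexity.aeval_hyperdetPoly_scaled_powerSum (topLetters_strictMono m kk hkN).injective hℓ he]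
    refine mul_ne_zero (Nat.cast_ne_zero.mpr (Nat.factorial_ne_zero kk)) ?_
    exact Finset.prod_ne_zero_iff.mpr fun a _ => Nat.cast_ne_zero.mpr (AlgebraicComplexity.descFactorial_add_pos _ _).ne'
  intro hI
  exact hval (Complexity.aeval_formCoeff_eq_zero_of_mem_orbitClosure_detFormLex hqmem hI)

end Literature.Computability.Complexity

namespace Literature.Computability.Complexity

/-- **BIP Thm. 1.4 for BIP's padded permanent from Props. 5.6(2), 5.8(2), Thm. 6.2 and the BLMW
lift only** (Prop. 2.3 now discharged by `bip2019_prop_2_3_holds`).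
[cite: BurgisserIkenmeyerPanovaJAMS2019, Thm. 1.4 and §6] -/
theorem bip2019_no_occurrence_obstructions_of_stability' (h562 : bip2019_prop_5_6_2)
    (h582 : bip2019_prop_5_8_2) (h62 : bip2019_thm_6_2)
    (hlift : ∀ m : ℕ,
      Literature.NumberTheory.DiophantineGeometry.hasHighestWeight_coordRep_of_orbitCoordRep (k := ℂ) (σ := Literature.NumberTheory.DiophantineGeometry.MatIdx m)) :
    bip2019_no_occurrence_obstructions :=
  bip2019_no_occurrence_obstructions_of_stability h562 h582 bip2019_prop_2_3_holds h62 hlift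

/-- The fresh-variable statement at threshold `(n+1)^25` from the same three facts and the lift.
[cite: BurgisserIkenmeyerPanovaJAMS2019, §6 (Proof of Theorem 1.4), with M = n + 1] -/
theorem no_occurrence_obstructions_succ_of_stability' (h562 : bip2019_prop_5_6_2)
    (h582 : bip2019_prop_5_8_2) (h62 : bip2019_thm_6_2)
    (hlift : ∀ m : ℕ,
      Literature.NumberTheory.DiophantineGeometry.hasHighestWeight_coordRep_of_orbitCoordRep (k := ℂ) (σ := Literature.NumberTheory.DiophantineGeometry.MatIdx m)) :
    no_occurrence_obstructions_succ :=
  no_occurrence_obstructions_succ_of_stability h562 h582 bip2019_prop_2_3_holds h62 hlift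

end Literature.Computability.Complexity
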